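import Mathlib
import Summits.AtomisticToContinuum.Crystallization.Theses.NashClassCertificates
import Literature.MathematicalPhysics.StatisticalMechanics.CrystallizationSymmetries
import Summits.AtomisticToContinuum.Crystallization.Theorems.PhononSlackCertificatesNearFieldConvexityStubCruxOfPureNearField
import Summits.AtomisticToContinuum.Crystallization.Theorems.PhononSlackCertificatesNearFieldConvexityStubInterfaceOfPairCount
import Summits.AtomisticToContinuum.Crystallization.Theorems.PhononSlackCertificatesNearFieldConvexityStubPairCountOfCrossing
import Summits.AtomisticToContinuum.Crystallization.Theorems.PhononSlackCertificatesNearFieldConvexityStubSelfSiteFloor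
import Summits.AtomisticToContinuum.Crystallization.Theorems.PhononSlackCertificatesNearFieldConvexityStubFluxEnvelope
import Summits.AtomisticToContinuum.Crystallization.Theorems.PhononSlackCertificatesNearFieldConvexityStubPnfOfLocalCertificate
import Summits.AtomisticToContinuum.Crystallization.Theorems.PhononSlackCertificatesNearFieldConvexityStubPnfOfLocalCertificate8
import Summits.AtomisticToContinuum.Crystallization.Theorems.PhononSlackCertificatesNearFieldConvexityStubChartSites
import Summits.AtomisticToContinuum.Crystallization.Theorems.PhononSlackCertificatesNearFieldConvexityStubChartCoverage
import Summits.AtomisticToContinuum.Crystallization.Theorems.NashClassCertificatesNashNearFieldStubNashForceBalance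
import Summits.AtomisticToContinuum.Crystallization.Theorems.NashClassCertificatesNashNearFieldStubChartCoreAssemblyWeak
import Summits.AtomisticToContinuum.Crystallization.Theorems.NashClassCertificatesNashNearFieldStubOffFamilyOfNonLayered
import Summits.AtomisticToContinuum.Crystallization.Theorems.ReggeStarCoercivityDefectFreeCrystallizesSqueezeToLayeredA
import Summits.AtomisticToContinuum.Crystallization.Theorems.NashClassCertificatesNashNearFieldStubSmoothRegimeCoercivity
import Summits.AtomisticToContinuum.Crystallization.Theorems.NashClassCertificatesNashNearFieldStubCauchyBornBarlowCoercivityWordFree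
import Summits.AtomisticToContinuum.Crystallization.Theorems.NashClassCertificatesNashNearFieldStubCauchyBornSitewiseOfCoercivity
import Summits.AtomisticToContinuum.Crystallization.Theorems.NashClassCertificatesNashNearFieldStubLayerLandscapeTri
import Summits.AtomisticToContinuum.Crystallization.Theorems.NashClassCertificatesNashNearFieldStubBsmoothOfFlux
import Summits.AtomisticToContinuum.Crystallization.Theorems.NashClassCertificatesNashNearFieldStubLabelledPlacement
import Summits.AtomisticToContinuum.Crystallization.Theorems.PhononSlackCertificatesNearFieldConvexityCoarseRegime
import Summits.AtomisticToContinuum.Crystallization.Theorems.NashClassCertificatesNashNearFieldStubSitewisePlus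

/-!
# Skeleton v10 — line `birth` of the crux `NashClassCertificates.NashNearField` (stmt-AtomisticToContinuum-16827)

Route `route-AtomisticToContinuum-NashClassCertificates`, sub-problem `Crystallization`; leads
`prover-line-stmt-AtomisticToContinuum-16827-0` (cycle 1, v1–v8.3) and `…-16827-c1-0` (v9, v10; 2026-08-17).
File `Cruxes/NashNearField/Lines/birth.lean`.

## v10 (lead c1, THIS FILE) — the A-side becomes the twin crux's banded energy split, on the Nash class
* Cycle-1 evidence: `stub_tubeCoercivitySharp` (TC♯) REFUTED (tc worker, TC_AUDIT.md + witness_TCsharp_p222.json on the item);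
  `stub_flatnessOfTubeCoercivity` (TC♯ → A″) had a false premise and a conclusion A″ FALSE AS STATED (relaxed 9R / mixed words: intrinsic
  non-affinity ≥ 9.8·10⁻⁶ at every interior site against uniform-spacing templates).  Both gone (v9), with the derived
  `stub_tubeCoercivity` / `stub_forceBalancedInteriorFlatness`; v9's interim X-charged flatness A‴ (θ-small multiscale regularity, crux-sized)
  is superseded here.
* NEW A-side = the twin crux 13958's split (line `Sketch`, skeleton v23), weakened to the Nash class: `stub_nashFlatnessPaid` (I_flat:
  `Σ_int₈(2400ν² + 800r²) ≤ K·X + C·#∂₄Ω` for `ε₁`-good clusters, SOME `ε₁ ∈ [1/100, 1/20]`) and `stub_nashRoughSitesPaid` (II_band: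
  `#{¬ε₁-good} ≤ K·X + C·#∂₄Ω` for EVERY such `ε₁`).  Energy pays non-affinity and family distance JOINTLY, so the composition needs NO
  smallness (`θ·C_R < 1/2` of v4–v9 disappears); the twin's verbatim stubs imply ours (`…_of_twin`, proved below): one proof closes both cruxes.
* Composition re-proved: `interiorCoercivity_of_v10` (C′ + I + II + radius-3 charts from the tree's `chart_of_stubs_radius`).
* B-side KEPT as registered inputs-in-waiting of I_flat's intended proof (a): NEAR + FAR (interval arithmetic) ⟹ LL⅒ ⟹ CBBC ⟹ SITEWISE
  (landed) ⟹ FLUX (stub) ⟹ B″ (landed bookkeeping) — derived in this file, no longer on the composition path (workers of wave c1-1 hold them).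
Open registered stubs of v10.3 (6): `stub_triLandscapeNearOblique`, `stub_triLandscapeFar`, `stub_cushion`, `stub_fluxOfSitewisePlus` (B-side inputs), `stub_nashFlatnessPaid`,
`stub_nashRoughSitesPaid` (composition path).

The crux is the near-field inequality of the twin crux `PhononSlackCertificates.NearFieldConvexity`
(stmt-13958) at separation `δ = 1/3`, demanded only for NASH configurations: for every `η > 0` there are
`c > 0`, `C` with `c·#{i ∈ Ω : B(x i,2) not η-layered} − C·#∂₄Ω ≤ Σ_{i∈Ω}(½·siteEnergy_i − e*)` for every
`1/3`-separated Nash `x` and every set `Ω` of `1/20`-good particles.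

## History of the line
* v1 (registrar): S1 coarse `1/3`-chart + S2 pointwise certificate on charts on the Nash class.
* v2 (lead): S1 ↦ the twin's v17 chart pieces (coverage p150430 / sites p148923 LANDED, `stub_chartCore` verbatim);
  `stub_nashForceBalance` (Nash ⇒ exact force balance) registered and LANDED p158662; radius-8 interior.
* v3 (lead): the held stub goes SUMMED (`stub_nashInteriorCoercivity`): pointwise ⇒ summed is `lc_bookkeeping`,
  summed ⇒ pointwise is Hoffman's circulation theorem (Literature, proved; its `c = 0` half is the proved item
  `FreeSplittingCertificates.FreePairSplitting`), so the transfer `τ`, its envelope and the sitewise `e*`-floor leave.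
* v4: `stub_nashInteriorCoercivity` is DERIVED (`interiorCoercivity_of_v4`, now `_v5`, proved, ≈ 250 lines of
  finite bookkeeping) from three registered stubs that separate the roles of the hypotheses:
  - `stub_offFamilyOfNonLayered` (C′, GEOMETRY, S–M): an affinely flat 3-ball (two-way `ν`-matched with a LINEAR image
    `G` of the unit ideal template of the chart's word) that is NOT `η`-layered (`ν ≤ η/2`) has `G` at distance `≥ η − ν`
    from every box-scaled isometric copy of the template on the sites of norm `≤ 5/2` — the layered family contains
    all box-scaled isometric templates, triangle inequality, radius margin `5/2 → 2`;
  - `stub_smoothRegimeCoercivity` (B″, ENERGY, all `1/3`-separated configurations, XL, shareable with 13958): in the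
    SMOOTH regime (flatness witnesses with `ν_i ≤ ν₁` at every radius-8 interior site) the number of interior sites whose
    affine part is `r`-far from the family is paid at rate `κ r²` by the bulk excess `E(x|_Ω) − |Ω|e*` plus `C_R Σ ν_i²`
    plus a radius-4 boundary charge — the summed Cauchy–Born landscape coercivity with Taylor remainder in the
    non-affinity only (letter-change linear terms absorbed by the PROVED Hägg cushion `LjRegistryDomination` because
    `ν_i ≤ ν₁`); no force balance is used;
  - `stub_forceBalancedInteriorFlatness` (A″, THE NASH LEVER, force-balanced class, XL): for force-balanced separated
    configurations, charted good clusters carry flatness witnesses at their radius-8 interior sites with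
    (i) `Σ ν_i² ≤ θ·[E(x|_Ω) − |Ω|e*] + C·#∂₄Ω` for any prescribed `θ > 0` (discrete Caccioppoli: curvature is paid by
    strain oscillation one scale up; Whitney decomposition by depth) and (ii) the ROUGH sites (`ν_i > ν₀`) are
    boundary-many, `#{ν_i > ν₀} ≤ C·#∂₄Ω` (coarse flatness of good Lennard-Jones equilibria; kit probe F3 j026097).
  Composition: `η' = min η (1/10)`, `r = η'/2`, `θ = 1/(2(|C_R|+1))`, `ν₀ = min ν₁ (η'/2)`; excise the rough set
  (boundary-many), apply B″ on the smooth sub-cluster (sub-cluster excess `≤` excess + `(250·3⁶/6)·#removed` by the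
  flux envelope and the periodisation floor), count the non-layered interior sites through C′, pay `C_RΣν²` out of half
  the excess by A″(i); `c = (2/3)κ r²`.  Everything else (chart assembly, PNF ⟸ interior coercivity via the radius-8
  collar, crux ⟸ PNF via the interface lemma) is the proved v2/v3 chain.
* v5: the two XL stubs are split into CERTIFIED-NUMERICS inputs and ANALYSIS: B″ is DERIVED (landed reduction
  `stub_bsmoothOfLocalSmoothCertificate`, p164238, wave-3 worker) from `stub_cauchyBornBarlowCoercivity` (CBBC, k = 0 landscape) and
  `stub_localSmoothCertificateOfCauchyBorn` (CBBC → local smooth certificate); A″ is DERIVED from `stub_tubeCoercivity` (TC, frozen-exterior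
  Hessian coercivity over the tube) and `stub_flatnessOfTubeCoercivity` (TC → A″, held by the lead).
* v8.3: `stub_labelledPlacement` LANDED (p170130; CSP certificates kernel-verified in Literature) — the chart core is PROVED for
  both cruxes; five open stubs remain, all on the energy/regularity side.
* v8.2: the tube slack is restated as TC♯ (`stub_tubeCoercivitySharp`: Hessian coercive at every `x` within sup-`1/200` of a
  1/20-good `x₀`) — no goodness geometry is needed downstream; TC (P-min's premise) is TC♯ at `x₀ = x`.
* v8.1: `stub_bsmoothOfFlux` LANDED p169915 — six open stubs.
* v8: B-side chain NEAR + FAR (interval arithmetic) ⟹ LL⅒ ⟹ CBBC ⟹ SITEWISE (all landed) ⟹ `stub_fluxOfSitewise` (flux lemma,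
  summed min-cut form) ⟹ `stub_bsmoothOfFlux` ⟹ B″; the pointwise LSC detour is dropped from the chain (its landed pieces feed the flux lemma).
* v7.3: the held stub takes TC₊ (3/50) as premise; TC (1/20) remains derived for P-min's consumers.
* v7.2: `stub_cauchyBornSitewiseOfCoercivity` LANDED (p169146) and imported; TC split into the slack numerics stub (3/50) and the
  derived 1/20 form.
* v7: CBBC is DERIVED from the word-free certified-numerics residual `stub_layerLandscapeTenth` (landed reductions p166639,
  p167768, p167922 by the wave-4 CBBC worker).
* v6: CBBC restricted to `r ≤ 1/10` (advisor review); the B″ analysis is cut once more at the worker-named sitewise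
  landscape bound: CBBC ⇒ `stub_cauchyBornSitewiseOfCoercivity` ⇒ `stub_localSmoothCertificateOfSitewise` ⇒ B″; P-min
  (`stub_minimalityOfTubeCoercivity`, TC + force balance ⇒ quadratic gap) LANDED p166438 as a supporting piece of TC → A″.
Stubs of v8: `stub_labelledPlacement` (L, geometry; `stub_chartCore`, shared with 13958, is DERIVED from it by the landed assembly
p161895), `stub_offFamilyOfNonLayered` (S–M; LANDED p163066, imported), `stub_triLandscapeNear`/`stub_triLandscapeFar` (interval arithmetic; LL⅒,
CBBC, SITEWISE derived/landed), `stub_fluxOfSitewise` (XL analysis), `stub_bsmoothOfFlux` (LANDED p169915), `stub_tubeCoercivitySharp` (numerics, sup-1/200 neighbourhood of the 1/20 tube; TC derived), `stub_flatnessOfTubeCoercivity` (XL analysis, lead);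
`stub_smoothRegimeCoercivity` (XL), `stub_forceBalancedInteriorFlatness` (XL).  `stub_nashForceBalance` is LANDED
(p158662) and imported.  `NashNearField_of` concludes the route decl BY NAME from the five stub signatures.

## Disproof / negatives honoured
`Cruxes/NashNearField/Disproof.lean` (cdisprove cycle 1, 2026-08-17): NO KILL; separation kept (`1/3`; also used for
the packing counts `(6ρ+1)³`), `c`, `C` chosen after `η` (`c ∝ η²` as finding 4d forces), boundary charge `C > 0`
(shallow/rough sites, sub-cluster excision, collar), "locally affine ⇏ layered" (finding 4f) is exactly why C′ charges
the AFFINE part's distance to the family and B″ pays it quadratically.  The twin's `Negative/LoadBearing` facts apply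
verbatim.  Refuter Mutation.lean: `stub_nashForceBalance` is stated under pairwise distinctness only.
-/

noncomputable section

open scoped BigOperators
open Literature.MathematicalPhysics.StatisticalMechanics Literature.Geometry.DiscreteGeometry

namespace Summit.AtomisticToContinuum.Crystallization.Cruxes.NashNearField.Birth

open Summit.AtomisticToContinuum.Crystallization.Theorems.PhononSlackNearFieldConvexity

/-! ## The registered stubs (the ONLY sorries of this file) -/

/-- **Stub `stub_labelledPlacement` (GEOMETRY, size L; v4 reshape of `stub_chartCore` after wave 2).**  The wave-2
worker LANDED the pattern–template bridge (p161059), the pair-step label lemmas (p162207) and the assembly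
`stub_chartCore_of_labelled_placement` (p161567/p161895), which PROVES the twin-shared `stub_chartCore` from exactly this
residual: at a particle whose 3-ball is 1/20-good, with goodness witness `(a, A, P, f)`, there are a linear isometry `R` and a
Hägg word `s` carrying the bridge clauses (i)(ii) AND, for every pattern neighbour `v ∈ P`, a goodness witness
`(a', A', P', f')` of the particle `f v` together with an injective, ADJACENT site labelling `(σm, σu, σw)` of `P'` in the
template (sites `≠ v`, within `3/2` of `v`), metrically accurate to `2/5` in the centre's frame on the labels whose site has
norm `≤ 43/20` or whose particle lies within `2` of the centre.  What remains is the twin lead c3's metric-free constraint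
satisfaction (per-pivot accepted placements × cross-pivot consistency ⇒ the 4/13 genuine letter contexts; computable part 1
landed as `Literature/Geometry/DiscreteGeometry/TwoShellPlacementCheck.lean`) plus the ℓ¹ placement bound `≤ 0.3585·a`. -/
theorem stub_labelledPlacement :
    ∀ (N : ℕ) (x : Fin N → EuclideanSpace ℝ (Fin 3)) (i : Fin N),
      (∀ k : Fin N, dist (x k) (x i) ≤ 3 → IsTwoShellGood (1 / 20) (47 / 50) 1 x k) →
      ∀ (a : ℝ) (A : EuclideanSpace ℝ (Fin 3) →ₗᵢ[ℝ] EuclideanSpace ℝ (Fin 3)) (P : Finset (EuclideanSpace ℝ (Fin 3)))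
        (f : EuclideanSpace ℝ (Fin 3) → Fin N),
        47 / 50 ≤ a → a ≤ 1 → (P = fccTwoShellPattern ∨ P = hcpTwoShellPattern) →
        (∀ v ∈ P, f v ≠ i ∧ dist (x (f v)) (x i + a • A v) ≤ 1 / 20 * a) → Set.InjOn f ↑P →
        (∀ j : Fin N, j ≠ i → dist (x j) (x i) ≤ 3 / 2 * a → ∃ v ∈ P, f v = j) →
        ∃ (R : EuclideanSpace ℝ (Fin 3) →ₗᵢ[ℝ] EuclideanSpace ℝ (Fin 3)) (s : ℤ → ℤ), IsHaggSeq s ∧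
          (∀ v ∈ P, ∃ m u w : ℤ, R (barlowPos 1 (Real.sqrt 6 / 3) s m u w) = v) ∧
          (∀ m u w : ℤ, ‖barlowPos 1 (Real.sqrt 6 / 3) s m u w‖ ≤ 3 / 2 → barlowPos 1 (Real.sqrt 6 / 3) s m u w ≠ 0 →
            R (barlowPos 1 (Real.sqrt 6 / 3) s m u w) ∈ P) ∧
          (∀ v ∈ P, ∃ (a' : ℝ) (A' : EuclideanSpace ℝ (Fin 3) →ₗᵢ[ℝ] EuclideanSpace ℝ (Fin 3))
            (P' : Finset (EuclideanSpace ℝ (Fin 3))) (f' : EuclideanSpace ℝ (Fin 3) → Fin N)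
            (σm σu σw : EuclideanSpace ℝ (Fin 3) → ℤ),
            47 / 50 ≤ a' ∧ a' ≤ 1 ∧ (P' = fccTwoShellPattern ∨ P' = hcpTwoShellPattern) ∧
            (∀ w ∈ P', f' w ≠ f v ∧ dist (x (f' w)) (x (f v) + a' • A' w) ≤ 1 / 20 * a') ∧ Set.InjOn f' ↑P' ∧
            (∀ k : Fin N, k ≠ f v → dist (x k) (x (f v)) ≤ 3 / 2 * a' → ∃ w ∈ P', f' w = k) ∧
            Set.InjOn (fun w => barlowPos 1 (Real.sqrt 6 / 3) s (σm w) (σu w) (σw w)) ↑P' ∧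
            (∀ w ∈ P', R (barlowPos 1 (Real.sqrt 6 / 3) s (σm w) (σu w) (σw w)) ≠ v ∧
              dist (R (barlowPos 1 (Real.sqrt 6 / 3) s (σm w) (σu w) (σw w))) v ≤ 3 / 2 ∧
              ((‖barlowPos 1 (Real.sqrt 6 / 3) s (σm w) (σu w) (σw w)‖ ≤ 43 / 20 ∨ dist (x (f' w)) (x i) ≤ 2) →
                dist (x (f' w)) (x i + a • A (R (barlowPos 1 (Real.sqrt 6 / 3) s (σm w) (σu w) (σw w)))) ≤ 2 / 5))) :=
  Summit.AtomisticToContinuum.Crystallization.Theorems.NashClassCertificatesNashNearField.stub_labelledPlacement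

/-- **`stub_chartCore` (shared verbatim with the twin crux 13958) — DERIVED in v4** from `stub_labelledPlacement` by the
landed assembly `stub_chartCore_of_labelled_placement` (p161895). -/
theorem stub_chartCore :
    ∀ (N : ℕ) (x : Fin N → EuclideanSpace ℝ (Fin 3)) (i : Fin N),
      (∀ k : Fin N, dist (x k) (x i) ≤ 3 → IsTwoShellGood (1 / 20) (47 / 50) 1 x k) →
      ∀ (a : ℝ) (A : EuclideanSpace ℝ (Fin 3) →ₗᵢ[ℝ] EuclideanSpace ℝ (Fin 3)) (P : Finset (EuclideanSpace ℝ (Fin 3))) (f : EuclideanSpace ℝ (Fin 3) → Fin N),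
        47 / 50 ≤ a → a ≤ 1 → (P = fccTwoShellPattern ∨ P = hcpTwoShellPattern) →
        (∀ v ∈ P, f v ≠ i ∧ dist (x (f v)) (x i + a • A v) ≤ 1 / 20 * a) → Set.InjOn f ↑P →
        (∀ j : Fin N, j ≠ i → dist (x j) (x i) ≤ 3 / 2 * a → ∃ v ∈ P, f v = j) →
        ∃ (R : EuclideanSpace ℝ (Fin 3) →ₗᵢ[ℝ] EuclideanSpace ℝ (Fin 3)) (s : ℤ → ℤ), IsHaggSeq s ∧
          (∀ v ∈ P, ∃ m u w : ℤ, R (barlowPos 1 (Real.sqrt 6 / 3) s m u w) = v) ∧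
          (∀ m u w : ℤ, ‖barlowPos 1 (Real.sqrt 6 / 3) s m u w‖ ≤ 3 / 2 → barlowPos 1 (Real.sqrt 6 / 3) s m u w ≠ 0 → R (barlowPos 1 (Real.sqrt 6 / 3) s m u w) ∈ P) ∧
          (∀ v ∈ P, ∀ k : Fin N, dist (x k) (x (f v)) ≤ 141 / 100 → dist (x k) (x i) ≤ 2 →
            ∃ m u w : ℤ, dist (x k) (x i + a • A (R (barlowPos 1 (Real.sqrt 6 / 3) s m u w))) ≤ 2 / 5) ∧
          (∀ v ∈ P, ∀ m u w : ℤ, ‖barlowPos 1 (Real.sqrt 6 / 3) s m u w‖ ≤ 43 / 20 → dist (R (barlowPos 1 (Real.sqrt 6 / 3) s m u w)) v ≤ 3 / 2 →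
            ∃ k : Fin N, dist (x k) (x i + a • A (R (barlowPos 1 (Real.sqrt 6 / 3) s m u w))) ≤ 2 / 5) :=
  Summit.AtomisticToContinuum.Crystallization.Theorems.NashClassCertificatesNashNearField.stub_chartCore_of_labelled_placement
    stub_labelledPlacement

/-- **Stub `stub_nashForceBalance` (the route's lever, size M) — LANDED p158662 (wave 1), discharged here by the tree theorem.**  In a configuration of pairwise distinct
points satisfying the crux's best-response (Nash) clause, every particle is in exact Lennard-Jones force
balance: `Σ_{j ≠ i} (V′(r_ij)/r_ij) • (x_i − x_j) = 0`.  Proof plan: `y ↦ Σ_{j≠i} V(|y − x_j|)` is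
differentiable at `y = x_i` (all `x_j ≠ x_i`, `V` smooth on `(0,∞)`, `HasFDerivAt.norm`) and has a local
minimum there on the open set `{y | ∀ j ≠ i, y ≠ x_j}` (the Nash clause; its value at `x_i` is
`siteEnergy`), so its Fréchet derivative vanishes (`IsLocalMin.hasFDerivAt_eq_zero`); the derivative is
`v ↦ ⟪Σ_j (V′(r_ij)/r_ij)(x_i − x_j), v⟫`. [BlancLewin2015 §2.2 (one-particle move); folklore] -/
theorem stub_nashForceBalance :
    ∀ (N : ℕ) (x : Fin N → EuclideanSpace ℝ (Fin 3)),
      (∀ i j : Fin N, i ≠ j → x i ≠ x j) →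
      (∀ (i : Fin N) (y : EuclideanSpace ℝ (Fin 3)), (∀ j : Fin N, j ≠ i → y ≠ x j) → siteEnergy lennardJones x i ≤ ∑ j ∈ Finset.univ.erase i, lennardJones (dist y (x j))) →
      ∀ i : Fin N, ∑ j ∈ Finset.univ.erase i,
        (deriv lennardJones (dist (x i) (x j)) / dist (x i) (x j)) • (x i - x j) = 0 :=
  Summit.AtomisticToContinuum.Crystallization.Theorems.NashClassCertificatesNashNearField.stub_nashForceBalance

/-- **Stub `stub_offFamilyOfNonLayered` (C′, GEOMETRY, size S–M) — LANDED p163066 (wave-3 worker), discharged here by the tree theorem.**  At a particle `i`, let `G` be a continuous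
linear map and `ν ≥ 0` such that the 3-ball of `x i` is two-way `ν`-matched with `x i + G(T_s)`, `T_s` the unit ideal
Barlow template `barlowPos 1 (√6/3) s` of a Hägg word `s` (`G` globally bi-Lipschitz with constants `4/5`, `6/5`).  If the 2-ball of `x i` is NOT `η`-layered (the crux's predicate) and `ν ≤ η/2 ≤ 1/20`, then `G` is `(η − ν)`-far
from the family on the template: for every linear isometry `A` and every box cell `(a, h)` some site `p` of norm `≤ 3`
has `dist (G p₁) (A p_{a,h}) ≥ η − ν` (`p₁` the unit site, `p_{a,h} = barlowPos a h s` the same site of the box-scaled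
template).  Proof plan: contrapositive — if all sites of norm `≤ 5/2` are within `ε := η − ν` then `x` is `(ν + ε)`-matched,
after the translation `t = −x i`, with the layered set `A(barlowPos a h s) = {A(u•u(a) + v•v(a) + L_m•w(a) + z_m•e₃)}`,
`z_m = m h` (uniform spacings `h ∈ [39a/50, 17a/20]` are in the box; `m • layerNormal h = (m h) • layerNormal 1`); particles
within `2` of `x i` have their unit site of norm `≤ (2 + ν)/(4/5) ≤ 3`, template points within `2` come from unit sites of norm
`≤ 2/(0.94·0.78·…) ≤ 3` (in-plane factor `a ≥ 47/50`, normal factor `h/(√6/3) ≥ 0.955·47/50`), and `‖G p₁‖ < 2 + ε ≤ 3` keeps them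
inside the flatness radius. [folklore geometry] -/
theorem stub_offFamilyOfNonLayered :
    ∀ (N : ℕ) (x : Fin N → EuclideanSpace ℝ (Fin 3)) (i : Fin N) (s : ℤ → ℤ) (G : EuclideanSpace ℝ (Fin 3) →L[ℝ] EuclideanSpace ℝ (Fin 3)) (ν η : ℝ),
      IsHaggSeq s → 0 ≤ ν → ν ≤ η / 2 → η ≤ 1 / 10 →
      ((∀ j : Fin N, dist (x j) (x i) ≤ 3 → ∃ m u v : ℤ, dist (x j - x i) (G (barlowPos 1 (Real.sqrt 6 / 3) s m u v)) ≤ ν) ∧ (∀ m u v : ℤ, ‖G (barlowPos 1 (Real.sqrt 6 / 3) s m u v)‖ ≤ 3 → ∃ j : Fin N, dist (x j - x i) (G (barlowPos 1 (Real.sqrt 6 / 3) s m u v)) ≤ ν) ∧ (∀ p : EuclideanSpace ℝ (Fin 3), 4 / 5 * ‖p‖ ≤ ‖G p‖ ∧ ‖G p‖ ≤ 6 / 5 * ‖p‖)) →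
      ¬ (∃ (A : EuclideanSpace ℝ (Fin 3) →ₗᵢ[ℝ] EuclideanSpace ℝ (Fin 3)) (t : EuclideanSpace ℝ (Fin 3)) (a : ℝ) (s : ℤ → ℤ) (z : ℤ → ℝ), 47 / 50 ≤ a ∧ a ≤ 1 ∧ IsHaggSeq s ∧ (∀ m : ℤ, 39 / 50 * a ≤ z (m + 1) - z m ∧ z (m + 1) - z m ≤ 17 / 20 * a) ∧ (fun S : Set (EuclideanSpace ℝ (Fin 3)) => (∀ j : Fin N, dist (x j) (x i) ≤ 2 → ∃ p ∈ S, dist (x j + t) p ≤ η) ∧ (∀ p ∈ S, dist p (x i + t) ≤ 2 → ∃ j : Fin N, dist (x j + t) p ≤ η)) {p | ∃ m i j : ℤ, p = A (((i : ℝ) • triangularVec₁ a) + ((j : ℝ) • triangularVec₂ a) + ((haggLabel s m : ℝ) • barlowOffset a) + (z m • layerNormal 1))}) →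
      (∀ (A : EuclideanSpace ℝ (Fin 3) →ₗᵢ[ℝ] EuclideanSpace ℝ (Fin 3)) (a h : ℝ), 47 / 50 ≤ a → a ≤ 1 → 39 / 50 * a ≤ h → h ≤ 17 / 20 * a → ∃ m u v : ℤ, ‖barlowPos 1 (Real.sqrt 6 / 3) s m u v‖ ≤ 3 ∧ (η - ν) ≤ dist (G (barlowPos 1 (Real.sqrt 6 / 3) s m u v)) (A (barlowPos a h s m u v))) :=
  Summit.AtomisticToContinuum.Crystallization.Theorems.NashClassCertificatesNashNearField.stub_offFamilyOfNonLayered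

/-! ### B-side (energy landscape, force-balance-free), v8 chain:
`stub_triLandscapeNear` + `stub_triLandscapeFar` (interval arithmetic) ⟹ LL⅒ (landed p169028) ⟹ CBBC (landed p167922) ⟹ SITEWISE
(landed p169146) ⟹ `stub_fluxOfSitewise` (the first-order flux lemma in summed min-cut form, XL) ⟹ `stub_bsmoothOfFlux` (bookkeeping, M) ⟹ B″. -/

/-- **Stub `stub_triLandscapeNearOblique` (NEAR′, CERTIFIED NUMERICS; v10.1 reshape of `stub_triLandscapeNear`, which is FALSE as registered
— wave c1-1 worker, NEAR_STATUS.md on the item: at `t = diag(47/50, 47/50, 197/200)` the top `h`-clip is active (`a = 47/50`, `h = 17a/20`),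
clip-`S² = 4.1·10⁻⁵` but `W ≤ −2.6·10⁻⁴ < 0` rigorously: for `47/50 ≤ a < a_c ≈ 0.9443` the zero-normal-stress spacing `h/a ≈ 0.854` lies ABOVE
the box edge `17/20`, so the clipped cell is not energy-adapted there, `W(β) ≈ −0.087β + 7.3β²`).  REPAIR (tested, λ = 1/4): above the top edge the
reference cell is moved OBLIQUELY, `a′ := min 1 (a + ¼·max 0 (√6/3·t₂₂ − 17a/20))`, `h′ :=` clip of `√6/3·t₂₂` to `[39a′/50, 17a′/20]` — still a box
cell, equal to `(a, h)` unless the top clip is active; the hypotheses keep the CLIP distance `S² ≤ 1/100` (so NEAR′ ∪ FAR cover the tube) and the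
conclusion is `c·S′² ≤ W(t; a′, h′)` for the Frobenius distance `S′²` to the oblique cell.  Numerics: `min W/S′² = 0.42` (the transverse soft mode at
`(a, h/a) = (1, 17/20)`), first-order outward rate along the whole top edge `≥ 0.19β`, all other edges outward-stable (weakest: corner `(1, 39/50)`,
rate `0.031`).  Certificate shape (worker §5): per-`(a,h)`-cell LDLᵀ checks of the reduced quadratic model over the 36 `δ`-assignments (`|s| ≤ 2`)
with per-bond cubic absorption (exact lower model for first-shell bonds, `g'''' > 0` for `q < 1.613`) and direction-cone S-procedure, far layers by
norm (`≤ 1.2·10⁻²`), and a DIFFERENCE tail bound (the constant-tail `stub_triTruncation` cannot serve near `S = 0`).** -/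
theorem stub_triLandscapeNearOblique :
    ∃ c : ℝ, 0 < c ∧ ∀ t₀₀ t₀₁ t₀₂ t₁₁ t₁₂ t₂₂ a h a' h' : ℝ, 0 < t₀₀ → 0 < t₁₁ → 0 < t₂₂ →
        (∀ x y z : ℝ, (4 / 5 : ℝ) ^ 2 * (x ^ 2 + y ^ 2 + z ^ 2) ≤
          (t₀₀ * x + t₀₁ * y + t₀₂ * z) ^ 2 + (t₁₁ * y + t₁₂ * z) ^ 2 + (t₂₂ * z) ^ 2 ∧
        (t₀₀ * x + t₀₁ * y + t₀₂ * z) ^ 2 + (t₁₁ * y + t₁₂ * z) ^ 2 + (t₂₂ * z) ^ 2 ≤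
          (6 / 5 : ℝ) ^ 2 * (x ^ 2 + y ^ 2 + z ^ 2)) →
        a = max (47 / 50) (min 1 ((t₀₀ + t₁₁) / 2)) →
        h = max (39 / 50 * a) (min (17 / 20 * a) (Real.sqrt 6 / 3 * t₂₂)) →
        a' = min 1 (a + 1 / 4 * max 0 (Real.sqrt 6 / 3 * t₂₂ - 17 / 20 * a)) →
        h' = max (39 / 50 * a') (min (17 / 20 * a') (Real.sqrt 6 / 3 * t₂₂)) →
        ((t₀₀ - a) ^ 2 + (t₁₁ - a) ^ 2 + (t₂₂ - h / (Real.sqrt 6 / 3)) ^ 2 + t₀₁ ^ 2 + t₀₂ ^ 2 + t₁₂ ^ 2) ≤ 1 / 100 →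
        c * ((t₀₀ - a') ^ 2 + (t₁₁ - a') ^ 2 + (t₂₂ - h' / (Real.sqrt 6 / 3)) ^ 2 + t₀₁ ^ 2 + t₀₂ ^ 2 + t₁₂ ^ 2) ≤
        (fun Δ : ℤ → ℤ → ℝ => (1 / 2 : ℝ) * (Δ 0 0 +
            (∑' k : ℕ, if k = 0 then min (Δ 1 1) (Δ (-1) 1)
              else min (Δ 0 ((k : ℤ) + 1)) (min (Δ 1 ((k : ℤ) + 1)) (Δ (-1) ((k : ℤ) + 1)))) +
            (∑' k : ℕ, if k = 0 then min (Δ 1 (-1)) (Δ (-1) (-1))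
              else min (Δ 0 (-((k : ℤ) + 1))) (min (Δ 1 (-((k : ℤ) + 1))) (Δ (-1) (-((k : ℤ) + 1)))))))
          (fun δ s => (∑' ij : ℤ × ℤ, lennardJones (Real.sqrt ((t₀₀ * ((ij.1 : ℝ) + (ij.2 : ℝ) / 2 + (δ : ℝ) / 2) + t₀₁ * (Real.sqrt 3 / 2 * ((ij.2 : ℝ) + (δ : ℝ) / 3)) + t₀₂ * ((s : ℝ) * (Real.sqrt 6 / 3))) ^ 2 + (t₁₁ * (Real.sqrt 3 / 2 * ((ij.2 : ℝ) + (δ : ℝ) / 3)) + t₁₂ * ((s : ℝ) * (Real.sqrt 6 / 3))) ^ 2 + (t₂₂ * ((s : ℝ) * (Real.sqrt 6 / 3))) ^ 2))) -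
            layerInteraction lennardJones a' h' δ s) := by
  sorry

/-- **Stub `stub_triLandscapeFar` (FAR, CERTIFIED NUMERICS).**  Same data, `1/100 ≤ S²` ⟹ `w₀ ≤ W` (audit: min W = 0.0045 on the S = 1/10
shell, ≥ 0.0127 for S ≥ 0.14; recommended w₀ = 1/300; ≈ 10⁷ boxes away from the shell, the thin shell is the expensive part — levers: smaller
w₀, rigorous third derivatives, or re-split at S₀ = 0.15). -/
theorem stub_triLandscapeFar :
    ∃ w₀ : ℝ, 0 < w₀ ∧ ∀ t₀₀ t₀₁ t₀₂ t₁₁ t₁₂ t₂₂ a h : ℝ, 0 < t₀₀ → 0 < t₁₁ → 0 < t₂₂ →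
        (∀ x y z : ℝ, (4 / 5 : ℝ) ^ 2 * (x ^ 2 + y ^ 2 + z ^ 2) ≤
          (t₀₀ * x + t₀₁ * y + t₀₂ * z) ^ 2 + (t₁₁ * y + t₁₂ * z) ^ 2 + (t₂₂ * z) ^ 2 ∧
        (t₀₀ * x + t₀₁ * y + t₀₂ * z) ^ 2 + (t₁₁ * y + t₁₂ * z) ^ 2 + (t₂₂ * z) ^ 2 ≤
          (6 / 5 : ℝ) ^ 2 * (x ^ 2 + y ^ 2 + z ^ 2)) →
        a = max (47 / 50) (min 1 ((t₀₀ + t₁₁) / 2)) →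
        h = max (39 / 50 * a) (min (17 / 20 * a) (Real.sqrt 6 / 3 * t₂₂)) →
        1 / 100 ≤ ((t₀₀ - a) ^ 2 + (t₁₁ - a) ^ 2 + (t₂₂ - h / (Real.sqrt 6 / 3)) ^ 2 + t₀₁ ^ 2 + t₀₂ ^ 2 + t₁₂ ^ 2) →
        w₀ ≤
        (fun Δ : ℤ → ℤ → ℝ => (1 / 2 : ℝ) * (Δ 0 0 +
            (∑' k : ℕ, if k = 0 then min (Δ 1 1) (Δ (-1) 1)
              else min (Δ 0 ((k : ℤ) + 1)) (min (Δ 1 ((k : ℤ) + 1)) (Δ (-1) ((k : ℤ) + 1)))) +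
            (∑' k : ℕ, if k = 0 then min (Δ 1 (-1)) (Δ (-1) (-1))
              else min (Δ 0 (-((k : ℤ) + 1))) (min (Δ 1 (-((k : ℤ) + 1))) (Δ (-1) (-((k : ℤ) + 1)))))))
          (fun δ s => (∑' ij : ℤ × ℤ, lennardJones (Real.sqrt ((t₀₀ * ((ij.1 : ℝ) + (ij.2 : ℝ) / 2 + (δ : ℝ) / 2) + t₀₁ * (Real.sqrt 3 / 2 * ((ij.2 : ℝ) + (δ : ℝ) / 3)) + t₀₂ * ((s : ℝ) * (Real.sqrt 6 / 3))) ^ 2 + (t₁₁ * (Real.sqrt 3 / 2 * ((ij.2 : ℝ) + (δ : ℝ) / 3)) + t₁₂ * ((s : ℝ) * (Real.sqrt 6 / 3))) ^ 2 + (t₂₂ * ((s : ℝ) * (Real.sqrt 6 / 3))) ^ 2))) -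
            layerInteraction lennardJones a h δ s) := by
  sorry

/-- The oblique selection lands in the box: `a′ = min 1 (a + ¼·max 0 (√6/3·t₂₂ − 17a/20))`, `h′ =` clip to `[39a′/50, 17a′/20]`. -/
theorem tri_piOblique_mem_box (t₀₀ t₁₁ t₂₂ a h a' h' : ℝ) (ha : a = max (47 / 50) (min 1 ((t₀₀ + t₁₁) / 2)))
    (_hh : h = max (39 / 50 * a) (min (17 / 20 * a) (Real.sqrt 6 / 3 * t₂₂)))
    (ha' : a' = min 1 (a + 1 / 4 * max 0 (Real.sqrt 6 / 3 * t₂₂ - 17 / 20 * a)))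
    (hh' : h' = max (39 / 50 * a') (min (17 / 20 * a') (Real.sqrt 6 / 3 * t₂₂))) :
    47 / 50 ≤ a' ∧ a' ≤ 1 ∧ 39 / 50 * a' ≤ h' ∧ h' ≤ 17 / 20 * a' := by
  have ha1 : 47 / 50 ≤ a := by rw [ha]; exact le_max_left _ _
  have hm : 0 ≤ 1 / 4 * max 0 (Real.sqrt 6 / 3 * t₂₂ - 17 / 20 * a) := by positivity
  have ha1' : 47 / 50 ≤ a' := by
    rw [ha']
    exact le_min (by norm_num) (by linarith)
  have ha2' : a' ≤ 1 := by rw [ha']; exact min_le_left _ _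
  refine ⟨ha1', ha2', ?_, ?_⟩
  · rw [hh']; exact le_max_left _ _
  · rw [hh']
    exact max_le (by linarith) (min_le_left _ _)

/-- Scalar bookkeeping, near case: `P ≤ 9S²` and `cS² ≤ W` give `min(c/9, 100w₀)·min(√P, 1/10)² ≤ W`. -/
theorem tri_bookkeeping_near {c w₀ S2 P2 B W : ℝ} (hc : 0 < c) (hw : 0 < w₀) (hP0 : 0 ≤ P2) (hB : B ≤ 9)
    (hpen : P2 ≤ S2 * B) (hS0 : 0 ≤ S2) (hN : c * S2 ≤ W) :
    min (c / 9) (100 * w₀) * (min (Real.sqrt P2) (1 / 10)) ^ 2 ≤ W := by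
  have hκ1 : min (c / 9) (100 * w₀) ≤ c / 9 := min_le_left _ _
  have hpen' : P2 ≤ S2 * 9 := hpen.trans (mul_le_mul_of_nonneg_left hB hS0)
  have hm0 : 0 ≤ min (Real.sqrt P2) (1 / 10) := le_min (Real.sqrt_nonneg _) (by norm_num)
  have hmP : (min (Real.sqrt P2) (1 / 10)) ^ 2 ≤ P2 := by
    calc (min (Real.sqrt P2) (1 / 10)) ^ 2 ≤ (Real.sqrt P2) ^ 2 := pow_le_pow_left₀ hm0 (min_le_left _ _) 2
      _ = P2 := Real.sq_sqrt hP0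
  have hw' : 0 < 100 * w₀ := by positivity
  have hmin0 : 0 ≤ min (c / 9) (100 * w₀) := le_min (by positivity) hw'.le
  calc min (c / 9) (100 * w₀) * (min (Real.sqrt P2) (1 / 10)) ^ 2 ≤ (c / 9) * P2 :=
        mul_le_mul hκ1 hmP (sq_nonneg _) (by positivity)
    _ ≤ c * S2 := by nlinarith [hpen', hc]
    _ ≤ W := hN

/-- Scalar bookkeeping, far case: `w₀ ≤ W` gives `min(c/9, 100w₀)·min(√P, 1/10)² ≤ W`. -/
theorem tri_bookkeeping_far {c w₀ P2 W : ℝ} (hc : 0 < c) (hw : 0 < w₀) (hF : w₀ ≤ W) :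
    min (c / 9) (100 * w₀) * (min (Real.sqrt P2) (1 / 10)) ^ 2 ≤ W := by
  have hκ2 : min (c / 9) (100 * w₀) ≤ 100 * w₀ := min_le_right _ _
  have hm0 : 0 ≤ min (Real.sqrt P2) (1 / 10) := le_min (Real.sqrt_nonneg _) (by norm_num)
  have hm1 : (min (Real.sqrt P2) (1 / 10)) ^ 2 ≤ 1 / 100 := by
    calc (min (Real.sqrt P2) (1 / 10)) ^ 2 ≤ (1 / 10) ^ 2 := pow_le_pow_left₀ hm0 (min_le_right _ _) 2
      _ = 1 / 100 := by norm_num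
  have _h := hc
  calc min (c / 9) (100 * w₀) * (min (Real.sqrt P2) (1 / 10)) ^ 2 ≤ (100 * w₀) * (1 / 100) :=
        mul_le_mul hκ2 hm1 (sq_nonneg _) (by positivity)
    _ = w₀ := by ring
    _ ≤ W := hF

/-- **`TRI⅒` from NEAR′ and FAR (v10.1; the landed `stub_triLandscapeTenth_of_near_far` re-proved with the oblique cell in the near case).**
Case `S²(clip) ≤ 1/100`: use the oblique cell `(a′, h′)` — `|T p − D′ p|² ≤ 9 S′²` and `c·S′² ≤ W(a′, h′)`; case `1/100 ≤ S²(clip)`: use the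
clipped cell — `100w₀·min(·, 1/10)² ≤ w₀ ≤ W(a, h)`.  `κ = min(c/9, 100 w₀)`. -/
theorem triLandscapeTenth_of_nearOblique_far :
    (∃ c : ℝ, 0 < c ∧ ∀ t₀₀ t₀₁ t₀₂ t₁₁ t₁₂ t₂₂ a h a' h' : ℝ, 0 < t₀₀ → 0 < t₁₁ → 0 < t₂₂ →
        (∀ x y z : ℝ, (4 / 5 : ℝ) ^ 2 * (x ^ 2 + y ^ 2 + z ^ 2) ≤
          (t₀₀ * x + t₀₁ * y + t₀₂ * z) ^ 2 + (t₁₁ * y + t₁₂ * z) ^ 2 + (t₂₂ * z) ^ 2 ∧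
        (t₀₀ * x + t₀₁ * y + t₀₂ * z) ^ 2 + (t₁₁ * y + t₁₂ * z) ^ 2 + (t₂₂ * z) ^ 2 ≤
          (6 / 5 : ℝ) ^ 2 * (x ^ 2 + y ^ 2 + z ^ 2)) →
        a = max (47 / 50) (min 1 ((t₀₀ + t₁₁) / 2)) →
        h = max (39 / 50 * a) (min (17 / 20 * a) (Real.sqrt 6 / 3 * t₂₂)) →
        a' = min 1 (a + 1 / 4 * max 0 (Real.sqrt 6 / 3 * t₂₂ - 17 / 20 * a)) →
        h' = max (39 / 50 * a') (min (17 / 20 * a') (Real.sqrt 6 / 3 * t₂₂)) →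
        ((t₀₀ - a) ^ 2 + (t₁₁ - a) ^ 2 + (t₂₂ - h / (Real.sqrt 6 / 3)) ^ 2 + t₀₁ ^ 2 + t₀₂ ^ 2 + t₁₂ ^ 2) ≤ 1 / 100 →
        c * ((t₀₀ - a') ^ 2 + (t₁₁ - a') ^ 2 + (t₂₂ - h' / (Real.sqrt 6 / 3)) ^ 2 + t₀₁ ^ 2 + t₀₂ ^ 2 + t₁₂ ^ 2) ≤
        (fun Δ : ℤ → ℤ → ℝ => (1 / 2 : ℝ) * (Δ 0 0 +
            (∑' k : ℕ, if k = 0 then min (Δ 1 1) (Δ (-1) 1)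
              else min (Δ 0 ((k : ℤ) + 1)) (min (Δ 1 ((k : ℤ) + 1)) (Δ (-1) ((k : ℤ) + 1)))) +
            (∑' k : ℕ, if k = 0 then min (Δ 1 (-1)) (Δ (-1) (-1))
              else min (Δ 0 (-((k : ℤ) + 1))) (min (Δ 1 (-((k : ℤ) + 1))) (Δ (-1) (-((k : ℤ) + 1)))))))
          (fun δ s => (∑' ij : ℤ × ℤ, lennardJones (Real.sqrt ((t₀₀ * ((ij.1 : ℝ) + (ij.2 : ℝ) / 2 + (δ : ℝ) / 2) + t₀₁ * (Real.sqrt 3 / 2 * ((ij.2 : ℝ) + (δ : ℝ) / 3)) + t₀₂ * ((s : ℝ) * (Real.sqrt 6 / 3))) ^ 2 + (t₁₁ * (Real.sqrt 3 / 2 * ((ij.2 : ℝ) + (δ : ℝ) / 3)) + t₁₂ * ((s : ℝ) * (Real.sqrt 6 / 3))) ^ 2 + (t₂₂ * ((s : ℝ) * (Real.sqrt 6 / 3))) ^ 2))) -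
            layerInteraction lennardJones a' h' δ s)) →
    (∃ w₀ : ℝ, 0 < w₀ ∧ ∀ t₀₀ t₀₁ t₀₂ t₁₁ t₁₂ t₂₂ a h : ℝ, 0 < t₀₀ → 0 < t₁₁ → 0 < t₂₂ →
        (∀ x y z : ℝ, (4 / 5 : ℝ) ^ 2 * (x ^ 2 + y ^ 2 + z ^ 2) ≤
          (t₀₀ * x + t₀₁ * y + t₀₂ * z) ^ 2 + (t₁₁ * y + t₁₂ * z) ^ 2 + (t₂₂ * z) ^ 2 ∧
        (t₀₀ * x + t₀₁ * y + t₀₂ * z) ^ 2 + (t₁₁ * y + t₁₂ * z) ^ 2 + (t₂₂ * z) ^ 2 ≤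
          (6 / 5 : ℝ) ^ 2 * (x ^ 2 + y ^ 2 + z ^ 2)) →
        a = max (47 / 50) (min 1 ((t₀₀ + t₁₁) / 2)) →
        h = max (39 / 50 * a) (min (17 / 20 * a) (Real.sqrt 6 / 3 * t₂₂)) →
        1 / 100 ≤ ((t₀₀ - a) ^ 2 + (t₁₁ - a) ^ 2 + (t₂₂ - h / (Real.sqrt 6 / 3)) ^ 2 + t₀₁ ^ 2 + t₀₂ ^ 2 + t₁₂ ^ 2) →
        w₀ ≤
        (fun Δ : ℤ → ℤ → ℝ => (1 / 2 : ℝ) * (Δ 0 0 +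
            (∑' k : ℕ, if k = 0 then min (Δ 1 1) (Δ (-1) 1)
              else min (Δ 0 ((k : ℤ) + 1)) (min (Δ 1 ((k : ℤ) + 1)) (Δ (-1) ((k : ℤ) + 1)))) +
            (∑' k : ℕ, if k = 0 then min (Δ 1 (-1)) (Δ (-1) (-1))
              else min (Δ 0 (-((k : ℤ) + 1))) (min (Δ 1 (-((k : ℤ) + 1))) (Δ (-1) (-((k : ℤ) + 1)))))))
          (fun δ s => (∑' ij : ℤ × ℤ, lennardJones (Real.sqrt ((t₀₀ * ((ij.1 : ℝ) + (ij.2 : ℝ) / 2 + (δ : ℝ) / 2) + t₀₁ * (Real.sqrt 3 / 2 * ((ij.2 : ℝ) + (δ : ℝ) / 3)) + t₀₂ * ((s : ℝ) * (Real.sqrt 6 / 3))) ^ 2 + (t₁₁ * (Real.sqrt 3 / 2 * ((ij.2 : ℝ) + (δ : ℝ) / 3)) + t₁₂ * ((s : ℝ) * (Real.sqrt 6 / 3))) ^ 2 + (t₂₂ * ((s : ℝ) * (Real.sqrt 6 / 3))) ^ 2))) -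
            layerInteraction lennardJones a h δ s)) →
    ∃ κ : ℝ, 0 < κ ∧ ∀ t₀₀ t₀₁ t₀₂ t₁₁ t₁₂ t₂₂ : ℝ, 0 < t₀₀ → 0 < t₁₁ → 0 < t₂₂ →
        (∀ x y z : ℝ, (4 / 5 : ℝ) ^ 2 * (x ^ 2 + y ^ 2 + z ^ 2) ≤
          (t₀₀ * x + t₀₁ * y + t₀₂ * z) ^ 2 + (t₁₁ * y + t₁₂ * z) ^ 2 + (t₂₂ * z) ^ 2 ∧
        (t₀₀ * x + t₀₁ * y + t₀₂ * z) ^ 2 + (t₁₁ * y + t₁₂ * z) ^ 2 + (t₂₂ * z) ^ 2 ≤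
          (6 / 5 : ℝ) ^ 2 * (x ^ 2 + y ^ 2 + z ^ 2)) →
        ∃ a h : ℝ, 47 / 50 ≤ a ∧ a ≤ 1 ∧ 39 / 50 * a ≤ h ∧ h ≤ 17 / 20 * a ∧
          ∀ δ k i j : ℤ, ‖layerVec 1 (Real.sqrt 6 / 3) δ k i j‖ ≤ 3 →
            κ * (min (Real.sqrt (((t₀₀ - a) * ((i : ℝ) + (j : ℝ) / 2 + (δ : ℝ) / 2) + t₀₁ * (Real.sqrt 3 / 2 * ((j : ℝ) + (δ : ℝ) / 3)) + t₀₂ * ((k : ℝ) * (Real.sqrt 6 / 3))) ^ 2 + ((t₁₁ - a) * (Real.sqrt 3 / 2 * ((j : ℝ) + (δ : ℝ) / 3)) + t₁₂ * ((k : ℝ) * (Real.sqrt 6 / 3))) ^ 2 + ((t₂₂ - h / (Real.sqrt 6 / 3)) * ((k : ℝ) * (Real.sqrt 6 / 3))) ^ 2)) (1 / 10)) ^ 2 ≤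
            (fun Δ : ℤ → ℤ → ℝ => (1 / 2 : ℝ) * (Δ 0 0 +
              (∑' k : ℕ, if k = 0 then min (Δ 1 1) (Δ (-1) 1)
                else min (Δ 0 ((k : ℤ) + 1)) (min (Δ 1 ((k : ℤ) + 1)) (Δ (-1) ((k : ℤ) + 1)))) +
              (∑' k : ℕ, if k = 0 then min (Δ 1 (-1)) (Δ (-1) (-1))
                else min (Δ 0 (-((k : ℤ) + 1))) (min (Δ 1 (-((k : ℤ) + 1))) (Δ (-1) (-((k : ℤ) + 1)))))))
            (fun δ s => (∑' ij : ℤ × ℤ, lennardJones (Real.sqrt ((t₀₀ * ((ij.1 : ℝ) + (ij.2 : ℝ) / 2 + (δ : ℝ) / 2) + t₀₁ * (Real.sqrt 3 / 2 * ((ij.2 : ℝ) + (δ : ℝ) / 3)) + t₀₂ * ((s : ℝ) * (Real.sqrt 6 / 3))) ^ 2 + (t₁₁ * (Real.sqrt 3 / 2 * ((ij.2 : ℝ) + (δ : ℝ) / 3)) + t₁₂ * ((s : ℝ) * (Real.sqrt 6 / 3))) ^ 2 + (t₂₂ * ((s : ℝ) * (Real.sqrt 6 / 3))) ^ 2)))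 -
              layerInteraction lennardJones a h δ s) := by
  rintro ⟨c, hc, hN⟩ ⟨w₀, hw₀, hF⟩
  refine ⟨min (c / 9) (100 * w₀), lt_min (by positivity) (by positivity), ?_⟩
  intro t₀₀ t₀₁ t₀₂ t₁₁ t₁₂ t₂₂ h00 h11 h22 htube
  obtain ⟨a, ha⟩ : ∃ a : ℝ, a = max (47 / 50) (min 1 ((t₀₀ + t₁₁) / 2)) := ⟨_, rfl⟩
  obtain ⟨h, hh⟩ : ∃ h : ℝ, h = max (39 / 50 * a) (min (17 / 20 * a) (Real.sqrt 6 / 3 * t₂₂)) := ⟨_, rfl⟩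
  obtain ⟨a', ha'⟩ : ∃ a' : ℝ, a' = min 1 (a + 1 / 4 * max 0 (Real.sqrt 6 / 3 * t₂₂ - 17 / 20 * a)) := ⟨_, rfl⟩
  obtain ⟨h', hh'⟩ : ∃ h' : ℝ, h' = max (39 / 50 * a') (min (17 / 20 * a') (Real.sqrt 6 / 3 * t₂₂)) := ⟨_, rfl⟩
  by_cases hS : ((t₀₀ - a) ^ 2 + (t₁₁ - a) ^ 2 + (t₂₂ - h / (Real.sqrt 6 / 3)) ^ 2 + t₀₁ ^ 2 + t₀₂ ^ 2 + t₁₂ ^ 2) ≤ 1 / 100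
  · -- near: the oblique cell
    obtain ⟨ha1, ha2, hh1, hh2⟩ := tri_piOblique_mem_box t₀₀ t₁₁ t₂₂ a h a' h' ha hh ha' hh'
    refine ⟨a', h', ha1, ha2, hh1, hh2, fun δ k i j hn => ?_⟩
    have hB : ((i : ℝ) + (j : ℝ) / 2 + (δ : ℝ) / 2) ^ 2 + (Real.sqrt 3 / 2 * ((j : ℝ) + (δ : ℝ) / 3)) ^ 2 + ((k : ℝ) * (Real.sqrt 6 / 3)) ^ 2 ≤ 9 := by
      rw [← Summit.AtomisticToContinuum.Crystallization.Theorems.NashClassCertificatesNashNearField.tri_norm_layerVec_sq]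
      nlinarith [norm_nonneg (layerVec 1 (Real.sqrt 6 / 3) δ k i j)]
    exact tri_bookkeeping_near hc hw₀ (by positivity) hB (Summit.AtomisticToContinuum.Crystallization.Theorems.NashClassCertificatesNashNearField.tri_penalty_sq_le t₀₀ t₀₁ t₀₂ t₁₁ t₁₂ t₂₂ a' h' _ _ _)
      (by positivity) (hN t₀₀ t₀₁ t₀₂ t₁₁ t₁₂ t₂₂ a h a' h' h00 h11 h22 htube ha hh ha' hh' hS)
  · -- far: the clipped cell
    obtain ⟨ha1, ha2, hh1, hh2⟩ := Summit.AtomisticToContinuum.Crystallization.Theorems.NashClassCertificatesNashNearField.tri_pi_mem_box t₀₀ t₁₁ t₂₂ a h ha hh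
    refine ⟨a, h, ha1, ha2, hh1, hh2, fun δ k i j _hn => ?_⟩
    exact tri_bookkeeping_far hc hw₀ (hF t₀₀ t₀₁ t₀₂ t₁₁ t₁₂ t₂₂ a h h00 h11 h22 htube ha hh (not_le.1 hS).le)

/-- **LL⅒ `stub_layerLandscapeTenth` — DERIVED (v10.1)** from NEAR′ and FAR (`triLandscapeTenth_of_nearOblique_far` below + the landed QR-gauge reduction
`stub_layerLandscapeTenth_of_tri`, p169028). -/
theorem stub_layerLandscapeTenth :
    ∃ κ : ℝ, 0 < κ ∧ ∀ (G : EuclideanSpace ℝ (Fin 3) ≃L[ℝ] EuclideanSpace ℝ (Fin 3)),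
        (∀ v : EuclideanSpace ℝ (Fin 3), 4 / 5 * ‖v‖ ≤ ‖G v‖ ∧ ‖G v‖ ≤ 6 / 5 * ‖v‖) →
        ∃ (A : EuclideanSpace ℝ (Fin 3) →ₗᵢ[ℝ] EuclideanSpace ℝ (Fin 3)) (a h : ℝ),
          47 / 50 ≤ a ∧ a ≤ 1 ∧ 39 / 50 * a ≤ h ∧ h ≤ 17 / 20 * a ∧
          ∀ δ k i j : ℤ, ‖layerVec 1 (Real.sqrt 6 / 3) δ k i j‖ ≤ 3 →
            κ * (min (dist (G (layerVec 1 (Real.sqrt 6 / 3) δ k i j)) (A (layerVec a h δ k i j))) (1 / 10)) ^ 2 ≤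
            (fun Δ : ℤ → ℤ → ℝ => (1 / 2 : ℝ) * (Δ 0 0 +
              (∑' k : ℕ, if k = 0 then min (Δ 1 1) (Δ (-1) 1)
                else min (Δ 0 ((k : ℤ) + 1)) (min (Δ 1 ((k : ℤ) + 1)) (Δ (-1) ((k : ℤ) + 1)))) +
              (∑' k : ℕ, if k = 0 then min (Δ 1 (-1)) (Δ (-1) (-1))
                else min (Δ 0 (-((k : ℤ) + 1))) (min (Δ 1 (-((k : ℤ) + 1))) (Δ (-1) (-((k : ℤ) + 1)))))))
            (fun δ t => (∑' ij : ℤ × ℤ, lennardJones ‖G (layerVec 1 (Real.sqrt 6 / 3) δ t ij.1 ij.2)‖) -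
              layerInteraction lennardJones a h δ t) :=
  Summit.AtomisticToContinuum.Crystallization.Theorems.NashClassCertificatesNashNearField.stub_layerLandscapeTenth_of_tri
    (triLandscapeTenth_of_nearOblique_far stub_triLandscapeNearOblique stub_triLandscapeFar)

/-- **CBBC `stub_cauchyBornBarlowCoercivity` — DERIVED** from LL⅒ by the landed word-free reduction (p167922). -/
theorem stub_cauchyBornBarlowCoercivity :
    ∃ κ : ℝ, 0 < κ ∧ ∀ (s : ℤ → ℤ) (p : ℕ) (hp : p ≠ 0) (hs : ∀ i, s (i + p) = s i), IsHaggSeq s →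
      ∀ (G : EuclideanSpace ℝ (Fin 3) ≃L[ℝ] EuclideanSpace ℝ (Fin 3)),
        (∀ v : EuclideanSpace ℝ (Fin 3), 4 / 5 * ‖v‖ ≤ ‖G v‖ ∧ ‖G v‖ ≤ 6 / 5 * ‖v‖) →
        ∀ r : ℝ, 0 ≤ r → r ≤ 1 / 10 →
          (∀ (A : EuclideanSpace ℝ (Fin 3) →ₗᵢ[ℝ] EuclideanSpace ℝ (Fin 3)) (a h : ℝ), 47 / 50 ≤ a → a ≤ 1 → 39 / 50 * a ≤ h → h ≤ 17 / 20 * a →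
            ∃ m u v : ℤ, ‖barlowPos 1 (Real.sqrt 6 / 3) s m u v‖ ≤ 3 ∧
              r ≤ dist (G (barlowPos 1 (Real.sqrt 6 / 3) s m u v)) (A (barlowPos a h s m u v))) →
          (⨅ Q : PeriodicConfiguration 3, Q.energyPerParticle lennardJones) + κ * r ^ 2 ≤
            ((barlowPeriodicConfiguration s one_ne_zero
                (div_ne_zero (Real.sqrt_ne_zero'.2 (by norm_num)) three_ne_zero : Real.sqrt 6 / 3 ≠ 0) hp hs).linearImage
              G).energyPerParticle lennardJones :=
  Summit.AtomisticToContinuum.Crystallization.Theorems.NashClassCertificatesNashNearField.stub_cauchyBornBarlowCoercivity_of_layerLandscapeTenth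
    stub_layerLandscapeTenth

/-- **SITEWISE `stub_cauchyBornSitewiseOfCoercivity` — LANDED p169146** (one-sided uniform window bound + window-deficit corrector). -/
theorem stub_cauchyBornSitewiseOfCoercivity :
    (∃ κ : ℝ, 0 < κ ∧ ∀ (s : ℤ → ℤ) (p : ℕ) (hp : p ≠ 0) (hs : ∀ i, s (i + p) = s i), IsHaggSeq s →
      ∀ (G : EuclideanSpace ℝ (Fin 3) ≃L[ℝ] EuclideanSpace ℝ (Fin 3)),
        (∀ v : EuclideanSpace ℝ (Fin 3), 4 / 5 * ‖v‖ ≤ ‖G v‖ ∧ ‖G v‖ ≤ 6 / 5 * ‖v‖) →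
        ∀ r : ℝ, 0 ≤ r → r ≤ 1 / 10 →
          (∀ (A : EuclideanSpace ℝ (Fin 3) →ₗᵢ[ℝ] EuclideanSpace ℝ (Fin 3)) (a h : ℝ), 47 / 50 ≤ a → a ≤ 1 → 39 / 50 * a ≤ h → h ≤ 17 / 20 * a →
            ∃ m u v : ℤ, ‖barlowPos 1 (Real.sqrt 6 / 3) s m u v‖ ≤ 3 ∧
              r ≤ dist (G (barlowPos 1 (Real.sqrt 6 / 3) s m u v)) (A (barlowPos a h s m u v))) →
          (⨅ Q : PeriodicConfiguration 3, Q.energyPerParticle lennardJones) + κ * r ^ 2 ≤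
            ((barlowPeriodicConfiguration s one_ne_zero
                (div_ne_zero (Real.sqrt_ne_zero'.2 (by norm_num)) three_ne_zero : Real.sqrt 6 / 3 ≠ 0) hp hs).linearImage
              G).energyPerParticle lennardJones) →
    ∃ κ : ℝ, 0 < κ ∧ ∃ Cw : ℝ, ∀ (s : ℤ → ℤ) (p : ℕ), p ≠ 0 → (∀ i, s (i + p) = s i) → IsHaggSeq s →
      ∀ (G : (EuclideanSpace ℝ (Fin 3) →L[ℝ] EuclideanSpace ℝ (Fin 3))),
        (∀ v : EuclideanSpace ℝ (Fin 3), 4 / 5 * ‖v‖ ≤ ‖G v‖ ∧ ‖G v‖ ≤ 6 / 5 * ‖v‖) →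
        ∀ r : ℝ, 0 ≤ r → r ≤ 1 / 10 →
          (∀ (A : EuclideanSpace ℝ (Fin 3) →ₗᵢ[ℝ] EuclideanSpace ℝ (Fin 3)) (a h : ℝ), 47 / 50 ≤ a → a ≤ 1 → 39 / 50 * a ≤ h → h ≤ 17 / 20 * a →
            ∃ m u v : ℤ, ‖barlowPos 1 (Real.sqrt 6 / 3) s m u v‖ ≤ 3 ∧
              r ≤ dist (G (barlowPos 1 (Real.sqrt 6 / 3) s m u v)) (A (barlowPos a h s m u v))) →
          ∃ w : ℤ → ℝ, (∀ n : ℤ, |w n| ≤ Cw) ∧ ∀ m : ℤ,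
            (⨅ Q : PeriodicConfiguration 3, Q.energyPerParticle lennardJones) + κ * r ^ 2 ≤
              (1 / 2 : ℝ) * (∑' q : {q : ℤ × ℤ × ℤ // q ≠ (m, 0, 0)},
                lennardJones ‖G (barlowPos 1 (Real.sqrt 6 / 3) s q.1.1 q.1.2.1 q.1.2.2 -
                  barlowPos 1 (Real.sqrt 6 / 3) s m 0 0)‖) + w (m - 1) - w m :=
  Summit.AtomisticToContinuum.Crystallization.Theorems.NashClassCertificatesNashNearField.stub_cauchyBornSitewiseOfCoercivity

/-- **Stub `stub_cushion` (the STRAINED HÄGG CUSHION at nearness radius `1/250`, CERTIFIED NUMERICS; v10.3, formulated and audited by the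
wave c1-1 SITEWISE⁺ worker — SITEWISEPLUS_STATUS.md on the item).**  For every periodic Hägg word `s` (period `p`) and every automorphism `G` of
`ℝ³` in the `4/5–6/5` tube that is within `1/250` of some box-scaled isometric template on the unit-template sites of norm `≤ 3`, the strained
stacking of the alternating (hcp) word lies below the strained stacking of `s` by `cH` per c-layer:
`e(G·T_alt) + cH·#{m < p : s(m−1) = s m}/p ≤ e(G·T_s)`.  Audit: unstrained cushion `|J₂(a,h)| ∈ [3.68e-5, 1.43e-4]` per c-layer on the box
(PROVED sign/domination: `LjRegistryDomination`, item 3063); a bilinear `k = ±1` term (z-shear × in-plane deviatoric) eats it beyond farness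
`≈ 0.009–0.013` (CUSHION(≥ 0.015) is FALSE, CUSHION(1/100) true but thin, min `1.7e-5`); at `r₀ = 1/250` the ratio stays `≥ 3.3e-5` ⇒ certify
`cH = 1e-5`.  Certificate: word-free sufficient condition `C(G) = g₂ − |B₁| − Σ|k|·spread_k ≥ cH` over ≈ 170 `(a,h)`-cells × second-order Taylor
models in 4 strain components (≈ 2e8 interval evaluations) + a strained Poisson–Bessel tail lemma. [PartayOrtnerCsanyi2017, LoachAckland2017] -/
theorem stub_cushion :
    ∃ cH : ℝ, 0 < cH ∧ ∀ (s : ℤ → ℤ) (p : ℕ) (hp : p ≠ 0) (hs : ∀ i, s (i + p) = s i), IsHaggSeq s →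
      ∀ (G : EuclideanSpace ℝ (Fin 3) ≃L[ℝ] EuclideanSpace ℝ (Fin 3)),
        (∀ v : EuclideanSpace ℝ (Fin 3), 4 / 5 * ‖v‖ ≤ ‖G v‖ ∧ ‖G v‖ ≤ 6 / 5 * ‖v‖) →
        (∃ (A : EuclideanSpace ℝ (Fin 3) →ₗᵢ[ℝ] EuclideanSpace ℝ (Fin 3)) (a h : ℝ), 47 / 50 ≤ a ∧ a ≤ 1 ∧ 39 / 50 * a ≤ h ∧
            h ≤ 17 / 20 * a ∧ ∀ m u v : ℤ, ‖barlowPos 1 (Real.sqrt 6 / 3) s m u v‖ ≤ 3 →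
              dist (G (barlowPos 1 (Real.sqrt 6 / 3) s m u v)) (A (barlowPos a h s m u v)) < 1 / 250) →
        ((barlowPeriodicConfiguration alternatingHagg one_ne_zero
                (div_ne_zero (Real.sqrt_ne_zero'.2 (by norm_num)) three_ne_zero : Real.sqrt 6 / 3 ≠ 0) two_ne_zero
                (fun i => by exact_mod_cast alternatingHagg_periodic i)).linearImage G).energyPerParticle lennardJones +
            cH * (((Finset.range p).filter (fun m : ℕ => s ((m : ℤ) - 1) = s m)).card : ℝ) / p ≤
          ((barlowPeriodicConfiguration s one_ne_zero
                (div_ne_zero (Real.sqrt_ne_zero'.2 (by norm_num)) three_ne_zero : Real.sqrt 6 / 3 ≠ 0) hp hs).linearImage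
              G).energyPerParticle lennardJones := by
  sorry

/-- **SITEWISE⁺ `stub_sitewisePlus` — DERIVED (v10.3)** from CBBC (landed chain modulo NEAR′/FAR) and `stub_cushion` by the landed reduction
`sitewisePlus_of_cbbc_cushion` (p172845, wave c1-1 worker; window-deficit corrector places the cushion sitewise; far case by CBBC at `r₀`). -/
theorem stub_sitewisePlus :
    ∃ κ : ℝ, 0 < κ ∧ ∃ Cw cH : ℝ, 0 < cH ∧ ∀ (s : ℤ → ℤ) (p : ℕ), p ≠ 0 → (∀ i, s (i + p) = s i) → IsHaggSeq s →
      ∀ (G : (EuclideanSpace ℝ (Fin 3) →L[ℝ] EuclideanSpace ℝ (Fin 3))),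
        (∀ v : EuclideanSpace ℝ (Fin 3), 4 / 5 * ‖v‖ ≤ ‖G v‖ ∧ ‖G v‖ ≤ 6 / 5 * ‖v‖) →
        ∀ r : ℝ, 0 ≤ r → r ≤ 1 / 10 →
          (∀ (A : EuclideanSpace ℝ (Fin 3) →ₗᵢ[ℝ] EuclideanSpace ℝ (Fin 3)) (a h : ℝ), 47 / 50 ≤ a → a ≤ 1 → 39 / 50 * a ≤ h → h ≤ 17 / 20 * a →
            ∃ m u v : ℤ, ‖barlowPos 1 (Real.sqrt 6 / 3) s m u v‖ ≤ 3 ∧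
              r ≤ dist (G (barlowPos 1 (Real.sqrt 6 / 3) s m u v)) (A (barlowPos a h s m u v))) →
          ∃ w : ℤ → ℝ, (∀ n : ℤ, |w n| ≤ Cw) ∧ ∀ m : ℤ,
            (⨅ Q : PeriodicConfiguration 3, Q.energyPerParticle lennardJones) + κ * r ^ 2 +
                (if s (m - 1) = s m then cH else 0) ≤
              (1 / 2 : ℝ) * (∑' q : {q : ℤ × ℤ × ℤ // q ≠ (m, 0, 0)},
                lennardJones ‖G (barlowPos 1 (Real.sqrt 6 / 3) s q.1.1 q.1.2.1 q.1.2.2 -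
                  barlowPos 1 (Real.sqrt 6 / 3) s m 0 0)‖) + w (m - 1) - w m :=
  Summit.AtomisticToContinuum.Crystallization.Theorems.NashClassCertificatesNashNearField.sitewisePlus_of_cbbc_cushion
    (by norm_num : (0 : ℝ) < 1 / 250) (by norm_num) stub_cauchyBornBarlowCoercivity stub_cushion

/-- **Stub `stub_fluxOfSitewisePlus` (FLUX′ = the FIRST-ORDER FLUX LEMMA from SITEWISE⁺, size XL; v10.2 reshape of `stub_fluxOfSitewise`, which is
MISSTATED — its hypothesis SITEWISE is too weak (term T1e of FLUX_STATUS.md: residual layer forces of letter-asymmetric layers); the conclusion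
FLUX is unchanged and numerically true with margin).**  Proof map (FLUX_STATUS §1–§2, all other terms controlled in principle): CENTRED
canonical charts (re-charting is free: FLUX reads `G_i` only through `FamFar_r` and `ν_i`) make the prestress × chart-gradient term a third
difference that telescopes to the cut up to `(ΔĜ)·(Δ²x) = O(ν²)`; h-site strain-gradient terms cancel on inversion partners; off-family internal
forces scale with the farness (AM–GM uniform in `r`); Taylor remainders `≤ 1.4·10³ν̂²` (`stub_ljPairTaylorSharp`); cut terms and aperiodic
transfer remainders are owned by nearest-neighbour cut bonds (`M·Σd⁻⁶`); far field split at `R ~ ν^(−1/2)`; the corrector-free period-average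
form of SITEWISE⁺ is used (fixed-`G` windows lose `2√(2C_w|P̄|ν)` per site).  Landed pieces: `stub_cutFirstOrderIdentity`, `stub_cutSiteExpansion`,
`stub_fluxAffineExact`, `stub_fluxSingleChart`, p164238 p164648 p165009 p166063 p166342 p166519 p167219 p169456 p169657. [EMing2006, OrtnerTheil2013] -/
theorem stub_fluxOfSitewisePlus :
    (∃ κ : ℝ, 0 < κ ∧ ∃ Cw cH : ℝ, 0 < cH ∧ ∀ (s : ℤ → ℤ) (p : ℕ), p ≠ 0 → (∀ i, s (i + p) = s i) → IsHaggSeq s →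
      ∀ (G : (EuclideanSpace ℝ (Fin 3) →L[ℝ] EuclideanSpace ℝ (Fin 3))),
        (∀ v : EuclideanSpace ℝ (Fin 3), 4 / 5 * ‖v‖ ≤ ‖G v‖ ∧ ‖G v‖ ≤ 6 / 5 * ‖v‖) →
        ∀ r : ℝ, 0 ≤ r → r ≤ 1 / 10 →
          (∀ (A : EuclideanSpace ℝ (Fin 3) →ₗᵢ[ℝ] EuclideanSpace ℝ (Fin 3)) (a h : ℝ), 47 / 50 ≤ a → a ≤ 1 → 39 / 50 * a ≤ h → h ≤ 17 / 20 * a →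
            ∃ m u v : ℤ, ‖barlowPos 1 (Real.sqrt 6 / 3) s m u v‖ ≤ 3 ∧
              r ≤ dist (G (barlowPos 1 (Real.sqrt 6 / 3) s m u v)) (A (barlowPos a h s m u v))) →
          ∃ w : ℤ → ℝ, (∀ n : ℤ, |w n| ≤ Cw) ∧ ∀ m : ℤ,
            (⨅ Q : PeriodicConfiguration 3, Q.energyPerParticle lennardJones) + κ * r ^ 2 +
                (if s (m - 1) = s m then cH else 0) ≤
              (1 / 2 : ℝ) * (∑' q : {q : ℤ × ℤ × ℤ // q ≠ (m, 0, 0)},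
                lennardJones ‖G (barlowPos 1 (Real.sqrt 6 / 3) s q.1.1 q.1.2.1 q.1.2.2 -
                  barlowPos 1 (Real.sqrt 6 / 3) s m 0 0)‖) + w (m - 1) - w m) →
    ∃ κ : ℝ, 0 < κ ∧ ∃ ν₁ : ℝ, 0 < ν₁ ∧ ∃ CR M : ℝ, ∀ r : ℝ, 0 < r → r ≤ 1 / 10 →
      ∀ (N : ℕ) (x : Fin N → EuclideanSpace ℝ (Fin 3)), (∀ i j : Fin N, i ≠ j → 1 / 3 ≤ dist (x i) (x j)) →
      ∀ Ω : Finset (Fin N), (∀ i ∈ Ω, IsTwoShellGood (1 / 20) (47 / 50) 1 x i) →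
      ∀ (sW : Fin N → ℤ → ℤ) (Gw : Fin N → (EuclideanSpace ℝ (Fin 3) →L[ℝ] EuclideanSpace ℝ (Fin 3))) (νw : Fin N → ℝ),
      (∀ i ∈ Ω, (∀ k : Fin N, dist (x k) (x i) ≤ 8 → k ∈ Ω) → IsHaggSeq (sW i) ∧ 0 ≤ νw i ∧ νw i ≤ ν₁ ∧ ((∀ j : Fin N, dist (x j) (x i) ≤ 3 → ∃ m u v : ℤ, dist (x j - x i) ((Gw i) (barlowPos 1 (Real.sqrt 6 / 3) (sW i) m u v)) ≤ (νw i)) ∧ (∀ m u v : ℤ, ‖(Gw i) (barlowPos 1 (Real.sqrt 6 / 3) (sW i) m u v)‖ ≤ 3 → ∃ j : Fin N, dist (x j - x i) ((Gw i) (barlowPos 1 (Real.sqrt 6 / 3) (sW i) m u v)) ≤ (νw i)) ∧ (∀ p : EuclideanSpace ℝ (Fin 3), 4 / 5 * ‖p‖ ≤ ‖(Gw i) p‖ ∧ ‖(Gw i) p‖ ≤ 6 / 5 * ‖p‖))) →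
        ∀ S : Finset (Fin N), S ⊆ Ω.filter (fun i => (∀ k : Fin N, dist (x k) (x i) ≤ 8 → k ∈ Ω)) →
          κ * r ^ 2 * (Nat.card {i : Fin N // i ∈ S ∧ (∀ (A : EuclideanSpace ℝ (Fin 3) →ₗᵢ[ℝ] EuclideanSpace ℝ (Fin 3)) (a h : ℝ), 47 / 50 ≤ a → a ≤ 1 → 39 / 50 * a ≤ h → h ≤ 17 / 20 * a → ∃ m u v : ℤ, ‖barlowPos 1 (Real.sqrt 6 / 3) (sW i) m u v‖ ≤ 3 ∧ r ≤ dist ((Gw i) (barlowPos 1 (Real.sqrt 6 / 3) (sW i) m u v)) (A (barlowPos a h (sW i) m u v)))} : ℝ) - CR * (∑ i ∈ S, (νw i) ^ 2) ≤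
            (∑ i ∈ S, ((1 / 2 : ℝ) * (∑ j ∈ Ω.erase i, lennardJones (dist (x i) (x j))) - (⨅ Q : PeriodicConfiguration 3, Q.energyPerParticle lennardJones))) +
              M * (∑ i ∈ S, ∑ j ∈ Ω \ S, (dist (x i) (x j))⁻¹ ^ 6) := by
  sorry

/-- **Stub `stub_bsmoothOfFlux` (FLUX ⟹ B″, bookkeeping) — LANDED p169915 (wave-6 worker, 4 min), discharged here by the tree theorem.**  Take `S :=` all radius-8 interior sites of `Ω`: the cut capacity
`Σ_(i∈S, j∈Ω∖S) d⁻⁶` is collar-supported (`≤ C·#∂₄Ω` by `latticeSiteSum`-type bounds, `collar8_card_le`, `stub_pairCountOfCrossing`), and the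
non-interior self-site terms missing from `Σ_S` are `≥ −K₁` each and collar-many; cf. the landed `lsc_bookkeeping` (p164238). -/
theorem stub_bsmoothOfFlux :
    (∃ κ : ℝ, 0 < κ ∧ ∃ ν₁ : ℝ, 0 < ν₁ ∧ ∃ CR M : ℝ, ∀ r : ℝ, 0 < r → r ≤ 1 / 10 →
      ∀ (N : ℕ) (x : Fin N → EuclideanSpace ℝ (Fin 3)), (∀ i j : Fin N, i ≠ j → 1 / 3 ≤ dist (x i) (x j)) →
      ∀ Ω : Finset (Fin N), (∀ i ∈ Ω, IsTwoShellGood (1 / 20) (47 / 50) 1 x i) →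
      ∀ (sW : Fin N → ℤ → ℤ) (Gw : Fin N → (EuclideanSpace ℝ (Fin 3) →L[ℝ] EuclideanSpace ℝ (Fin 3))) (νw : Fin N → ℝ),
      (∀ i ∈ Ω, (∀ k : Fin N, dist (x k) (x i) ≤ 8 → k ∈ Ω) → IsHaggSeq (sW i) ∧ 0 ≤ νw i ∧ νw i ≤ ν₁ ∧ ((∀ j : Fin N, dist (x j) (x i) ≤ 3 → ∃ m u v : ℤ, dist (x j - x i) ((Gw i) (barlowPos 1 (Real.sqrt 6 / 3) (sW i) m u v)) ≤ (νw i)) ∧ (∀ m u v : ℤ, ‖(Gw i) (barlowPos 1 (Real.sqrt 6 / 3) (sW i) m u v)‖ ≤ 3 → ∃ j : Fin N, dist (x j - x i) ((Gw i) (barlowPos 1 (Real.sqrt 6 / 3) (sW i) m u v)) ≤ (νw i)) ∧ (∀ p : EuclideanSpace ℝ (Fin 3), 4 / 5 * ‖p‖ ≤ ‖(Gw i) p‖ ∧ ‖(Gw i) p‖ ≤ 6 / 5 * ‖p‖))) →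
        ∀ S : Finset (Fin N), S ⊆ Ω.filter (fun i => (∀ k : Fin N, dist (x k) (x i) ≤ 8 → k ∈ Ω)) →
          κ * r ^ 2 * (Nat.card {i : Fin N // i ∈ S ∧ (∀ (A : EuclideanSpace ℝ (Fin 3) →ₗᵢ[ℝ] EuclideanSpace ℝ (Fin 3)) (a h : ℝ), 47 / 50 ≤ a → a ≤ 1 → 39 / 50 * a ≤ h → h ≤ 17 / 20 * a → ∃ m u v : ℤ, ‖barlowPos 1 (Real.sqrt 6 / 3) (sW i) m u v‖ ≤ 3 ∧ r ≤ dist ((Gw i) (barlowPos 1 (Real.sqrt 6 / 3) (sW i) m u v)) (A (barlowPos a h (sW i) m u v)))} : ℝ) - CR * (∑ i ∈ S, (νw i) ^ 2) ≤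
            (∑ i ∈ S, ((1 / 2 : ℝ) * (∑ j ∈ Ω.erase i, lennardJones (dist (x i) (x j))) - (⨅ Q : PeriodicConfiguration 3, Q.energyPerParticle lennardJones))) +
              M * (∑ i ∈ S, ∑ j ∈ Ω \ S, (dist (x i) (x j))⁻¹ ^ 6)) →
    ∃ κ : ℝ, 0 < κ ∧ ∃ ν₁ : ℝ, 0 < ν₁ ∧ ∃ CR C : ℝ, ∀ r : ℝ, 0 < r → r ≤ 1 / 10 →
      ∀ (N : ℕ) (x : Fin N → EuclideanSpace ℝ (Fin 3)), (∀ i j : Fin N, i ≠ j → 1 / 3 ≤ dist (x i) (x j)) →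
      ∀ Ω : Finset (Fin N), (∀ i ∈ Ω, IsTwoShellGood (1 / 20) (47 / 50) 1 x i) →
      ∀ (sW : Fin N → ℤ → ℤ) (Gw : Fin N → (EuclideanSpace ℝ (Fin 3) →L[ℝ] EuclideanSpace ℝ (Fin 3))) (νw : Fin N → ℝ),
      (∀ i ∈ Ω, (∀ k : Fin N, dist (x k) (x i) ≤ 8 → k ∈ Ω) → IsHaggSeq (sW i) ∧ 0 ≤ νw i ∧ νw i ≤ ν₁ ∧ ((∀ j : Fin N, dist (x j) (x i) ≤ 3 → ∃ m u v : ℤ, dist (x j - x i) ((Gw i) (barlowPos 1 (Real.sqrt 6 / 3) (sW i) m u v)) ≤ (νw i)) ∧ (∀ m u v : ℤ, ‖(Gw i) (barlowPos 1 (Real.sqrt 6 / 3) (sW i) m u v)‖ ≤ 3 → ∃ j : Fin N, dist (x j - x i) ((Gw i) (barlowPos 1 (Real.sqrt 6 / 3) (sW i) m u v)) ≤ (νw i)) ∧ (∀ p : EuclideanSpace ℝ (Fin 3), 4 / 5 * ‖p‖ ≤ ‖(Gw i) p‖ ∧ ‖(Gw i) p‖ ≤ 6 / 5 * ‖p‖)))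 →
        κ * r ^ 2 * (Nat.card {i : Fin N // i ∈ Ω ∧ ((∀ k : Fin N, dist (x k) (x i) ≤ 8 → k ∈ Ω) ∧ (∀ (A : EuclideanSpace ℝ (Fin 3) →ₗᵢ[ℝ] EuclideanSpace ℝ (Fin 3)) (a h : ℝ), 47 / 50 ≤ a → a ≤ 1 → 39 / 50 * a ≤ h → h ≤ 17 / 20 * a → ∃ m u v : ℤ, ‖barlowPos 1 (Real.sqrt 6 / 3) (sW i) m u v‖ ≤ 3 ∧ r ≤ dist ((Gw i) (barlowPos 1 (Real.sqrt 6 / 3) (sW i) m u v)) (A (barlowPos a h (sW i) m u v))))} : ℝ) ≤ (∑ i ∈ Ω, (1 / 2 : ℝ) * (∑ j ∈ Ω.erase i, lennardJones (dist (x i) (x j)))) - (Ω.card : ℝ) * (⨅ Q : PeriodicConfiguration 3, Q.energyPerParticle lennardJones) + CR * (∑ i ∈ Ω.filter (fun i => (∀ k : Fin N, dist (x k) (x i) ≤ 8 → k ∈ Ω)), (νw i) ^ 2) + C * (Nat.card {i : Fin N // i ∈ Ω ∧ ∃ j : Fin N, j ∉ Ω ∧ dist (x j) (x i) ≤ 4}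 : ℝ) :=
  Summit.AtomisticToContinuum.Crystallization.Theorems.NashClassCertificatesNashNearField.stub_bsmoothOfFlux

/-- **B″ `stub_smoothRegimeCoercivity` — DERIVED (v10.2)**: SITEWISE⁺ ⟹ FLUX ⟹ B″ (SITEWISE⁺ ⟸ CBBC ⟸ LL⅒ ⟸ NEAR′ + FAR, plus the strained
Hägg cushion, is the intended proof of `stub_sitewisePlus`). -/
theorem stub_smoothRegimeCoercivity :
    ∃ κ : ℝ, 0 < κ ∧ ∃ ν₁ : ℝ, 0 < ν₁ ∧ ∃ CR C : ℝ, ∀ r : ℝ, 0 < r → r ≤ 1 / 10 →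
      ∀ (N : ℕ) (x : Fin N → EuclideanSpace ℝ (Fin 3)), (∀ i j : Fin N, i ≠ j → 1 / 3 ≤ dist (x i) (x j)) →
      ∀ Ω : Finset (Fin N), (∀ i ∈ Ω, IsTwoShellGood (1 / 20) (47 / 50) 1 x i) →
      ∀ (sW : Fin N → ℤ → ℤ) (Gw : Fin N → (EuclideanSpace ℝ (Fin 3) →L[ℝ] EuclideanSpace ℝ (Fin 3))) (νw : Fin N → ℝ),
      (∀ i ∈ Ω, (∀ k : Fin N, dist (x k) (x i) ≤ 8 → k ∈ Ω) → IsHaggSeq (sW i) ∧ 0 ≤ νw i ∧ νw i ≤ ν₁ ∧ ((∀ j : Fin N, dist (x j) (x i) ≤ 3 → ∃ m u v : ℤ, dist (x j - x i) ((Gw i) (barlowPos 1 (Real.sqrt 6 / 3) (sW i) m u v)) ≤ (νw i)) ∧ (∀ m u v : ℤ, ‖(Gw i) (barlowPos 1 (Real.sqrt 6 / 3) (sW i) m u v)‖ ≤ 3 → ∃ j : Fin N, dist (x j - x i) ((Gw i) (barlowPos 1 (Real.sqrt 6 / 3) (sW i) m u v)) ≤ (νw i)) ∧ (∀ p : EuclideanSpace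 ℝ (Fin 3), 4 / 5 * ‖p‖ ≤ ‖(Gw i) p‖ ∧ ‖(Gw i) p‖ ≤ 6 / 5 * ‖p‖))) →
        κ * r ^ 2 * (Nat.card {i : Fin N // i ∈ Ω ∧ ((∀ k : Fin N, dist (x k) (x i) ≤ 8 → k ∈ Ω) ∧ (∀ (A : EuclideanSpace ℝ (Fin 3) →ₗᵢ[ℝ] EuclideanSpace ℝ (Fin 3)) (a h : ℝ), 47 / 50 ≤ a → a ≤ 1 → 39 / 50 * a ≤ h → h ≤ 17 / 20 * a → ∃ m u v : ℤ, ‖barlowPos 1 (Real.sqrt 6 / 3) (sW i) m u v‖ ≤ 3 ∧ r ≤ dist ((Gw i) (barlowPos 1 (Real.sqrt 6 / 3) (sW i) m u v)) (A (barlowPos a h (sW i) m u v))))} : ℝ) ≤ (∑ i ∈ Ω, (1 / 2 : ℝ) * (∑ j ∈ Ω.erase i, lennardJones (dist (x i) (x j)))) - (Ω.card : ℝ) * (⨅ Q : PeriodicConfiguration 3, Q.energyPerParticle lennardJones) + CR * (∑ i ∈ Ω.filter (fun i => (∀ k : Fin N, dist (x k) (x i) ≤ 8 → k ∈ Ω)),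 (νw i) ^ 2) + C * (Nat.card {i : Fin N // i ∈ Ω ∧ ∃ j : Fin N, j ∉ Ω ∧ dist (x j) (x i) ≤ 4} : ℝ) :=
  stub_bsmoothOfFlux (stub_fluxOfSitewisePlus stub_sitewisePlus)

/-! ### A-side v10 (lead c1): the twin crux's banded energy split, on the Nash class
The cycle-1 A-side (TC♯ → A″) is refuted / false as stated; the v9 X-charged flatness A‴ needed a θ-small multiscale regularity theory
(crux-sized).  v10 adopts the split of the twin crux 13958 (line `Sketch`, skeleton v23, stubs `stub_flatnessPaid` (I_flat) and
`stub_roughSitesPaid` (II_band)), WEAKENED to the Nash class (extra hypotheses: `1/3`-separation fixed, the Nash clause, exact force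
balance): energy pays non-affinity AND family distance JOINTLY (`Σ(2400ν² + 800r²) ≤ K·X + C·#∂₄Ω`, no smallness of `K` needed), and the
particles of the 5 % tube that are not even `ε₁`-good are paid separately.  The twin's verbatim statements imply ours
(`stub_nashFlatnessPaid_of_twin`, `stub_nashRoughSitesPaid_of_twin` below): ONE proof of the twin's stubs closes both cruxes; a proof using
the Nash lever (interior regularity of force-balanced data) closes ours alone.  The composition `interiorCoercivity_of_v10` (C′ + I + II,
proved) replaces v5/v9. -/

/-- **Stub `stub_nashFlatnessPaid` (I_flat on the Nash class, size XL; = the twin's `stub_flatnessPaid` at `δ = 1/3` under the Nash clause and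
force balance).**  There is a goodness tolerance `ε₁ ∈ [1/100, 1/20]` and `K ≥ 0`, `C` with: for every `1/3`-separated, Nash, force-balanced `x`
and every finite set `Ω` of `ε₁`-good particles one can choose, at each radius-8 interior site `i`, a Hägg word `s_i`, a continuous linear
`G_i` (bi-Lipschitz `4/5, 6/5`) and `ν_i ≥ 0` such that the 3-ball of `x i` is two-way `ν_i`-matched with `x i + G_i(barlowPos 1 (√6/3) s_i)`,
together with a linear isometry `A_i` and a box cell `(a_i, h_i)` whose scaled template is `r_i`-close to `G_i` on the unit sites of norm `≤ 3`,
with `Σ_(i ∈ int₈Ω) (2400 ν_i² + 800 r_i²) ≤ K·[E_self(Ω) − |Ω|·e*] + C·#∂₄Ω`.  Intended proofs: (a) all configurations (twin): Cauchy–Born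
landscape coercivity of strained stackings, SITEWISE with per-site `r_i` (this line's landed chain NEAR + FAR ⟹ LL⅒ ⟹ CBBC ⟹ SITEWISE, modulo the
two interval-arithmetic stubs below) + harmonic coercivity modulo rigid motions along the local segment from `G_i·T` to `x` inside the `2ε₁`
tube (tube coercivity at tolerance `≈ 1/50`, NOT the refuted 3/50 / sup-1/200 forms) + the landed cut/first-order identities
(`stub_cutFirstOrderIdentity`, `stub_cutSiteExpansion`); (b) Nash class only: interior regularity of force-balanced data (excess-decay port).
[EMing2006, OrtnerTheil2013, EhrlacherOrtnerShapeev2016, Theil2006] -/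
theorem stub_nashFlatnessPaid :
    ∃ ε₁ : ℝ, 1 / 100 ≤ ε₁ ∧ ε₁ ≤ 1 / 20 ∧ ∃ K : ℝ, 0 ≤ K ∧ ∃ C : ℝ, ∀ (N : ℕ) (x : Fin N → EuclideanSpace ℝ (Fin 3)),
      (∀ i j : Fin N, i ≠ j → 1 / 3 ≤ dist (x i) (x j)) →
      (∀ (i : Fin N) (y : EuclideanSpace ℝ (Fin 3)), (∀ j : Fin N, j ≠ i → y ≠ x j) → siteEnergy lennardJones x i ≤ ∑ j ∈ Finset.univ.erase i, lennardJones (dist y (x j))) →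
      (∀ i : Fin N, ∑ j ∈ Finset.univ.erase i, (deriv lennardJones (dist (x i) (x j)) / dist (x i) (x j)) • (x i - x j) = 0) →
      ∀ Ω : Finset (Fin N), (∀ i ∈ Ω, IsTwoShellGood ε₁ (47 / 50) 1 x i) →
      ∃ (sW : Fin N → ℤ → ℤ) (Gw : Fin N → (EuclideanSpace ℝ (Fin 3) →L[ℝ] EuclideanSpace ℝ (Fin 3))) (νw rw : Fin N → ℝ) (Aw : Fin N → (EuclideanSpace ℝ (Fin 3) →ₗᵢ[ℝ] EuclideanSpace ℝ (Fin 3))) (aw hw : Fin N → ℝ), (∀ i ∈ Ω, (∀ k : Fin N, dist (x k) (x i) ≤ 8 → k ∈ Ω) → IsHaggSeq (sW i) ∧ 0 ≤ νw i ∧ ((∀ j : Fin N, dist (x j) (x i) ≤ 3 → ∃ m u v : ℤ, dist (x j - x i) ((Gw i) (barlowPos 1 (Real.sqrt 6 / 3) (sW i) m u v)) ≤ (νw i)) ∧ (∀ m u v : ℤ, ‖(Gw i) (barlowPos 1 (Real.sqrt 6 / 3) (sW i) m u v)‖ ≤ 3 → ∃ j : Fin N, dist (x j - x i) ((Gw i)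 (barlowPos 1 (Real.sqrt 6 / 3) (sW i) m u v)) ≤ (νw i)) ∧ (∀ p : EuclideanSpace ℝ (Fin 3), 4 / 5 * ‖p‖ ≤ ‖(Gw i) p‖ ∧ ‖(Gw i) p‖ ≤ 6 / 5 * ‖p‖)) ∧ 47 / 50 ≤ aw i ∧ aw i ≤ 1 ∧ 39 / 50 * aw i ≤ hw i ∧ hw i ≤ 17 / 20 * aw i ∧ (∀ m u v : ℤ, ‖barlowPos 1 (Real.sqrt 6 / 3) (sW i) m u v‖ ≤ 3 → dist ((Gw i) (barlowPos 1 (Real.sqrt 6 / 3) (sW i) m u v)) ((Aw i) (barlowPos (aw i) (hw i) (sW i) m u v)) < rw i)) ∧ (∑ i ∈ Ω.filter (fun i => ∀ k : Fin N, dist (x k) (x i) ≤ 8 → k ∈ Ω), (2400 * (νw i) ^ 2 + 800 * (rw i) ^ 2)) ≤ K * ((∑ i ∈ Ω, (1 / 2 : ℝ) * (∑ j ∈ Ω.erase i, lennardJones (dist (x i) (x j)))) - (Ω.card : ℝ) * (⨅ Q : PeriodicConfiguration 3, Q.energyPerParticle lennardJones)) + C * (Nat.card {i : Fin N // i ∈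 Ω ∧ ∃ j : Fin N, j ∉ Ω ∧ dist (x j) (x i) ≤ 4} : ℝ) := by
  sorry

/-- **Stub `stub_nashRoughSitesPaid` (II_band on the Nash class, size XL; = the twin's `stub_roughSitesPaid` at `δ = 1/3` under the Nash clause
and force balance).**  For EVERY `ε₁ ∈ [1/100, 1/20]` there are `K ≥ 0`, `C` with: for every `1/3`-separated, Nash, force-balanced `x` and every
set `Ω` of `1/20`-good particles carrying `2/5`-charts at its radius-3 interior sites, `#{i ∈ Ω : ¬ ε₁-good} ≤ K·[E_self(Ω) − |Ω|·e*] + C·#∂₄Ω`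
— particles of the 5 % tube that are not even `ε₁`-good cost a definite amount each (the non-perturbative residue: basin of the relaxed
polytypes in the 1/20 tube; on the Nash class single-particle relocation stability and force balance are available as extra slack).
[Theil2006, FlatleyTheil2015, HalesDSP2012] -/
theorem stub_nashRoughSitesPaid :
    ∀ ε₁ : ℝ, 1 / 100 ≤ ε₁ → ε₁ ≤ 1 / 20 → ∃ K : ℝ, 0 ≤ K ∧ ∃ C : ℝ, ∀ (N : ℕ) (x : Fin N → EuclideanSpace ℝ (Fin 3)),
      (∀ i j : Fin N, i ≠ j → 1 / 3 ≤ dist (x i) (x j)) →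
      (∀ (i : Fin N) (y : EuclideanSpace ℝ (Fin 3)), (∀ j : Fin N, j ≠ i → y ≠ x j) → siteEnergy lennardJones x i ≤ ∑ j ∈ Finset.univ.erase i, lennardJones (dist y (x j))) →
      (∀ i : Fin N, ∑ j ∈ Finset.univ.erase i, (deriv lennardJones (dist (x i) (x j)) / dist (x i) (x j)) • (x i - x j) = 0) →
      ∀ Ω : Finset (Fin N), (∀ i ∈ Ω, IsTwoShellGood (1 / 20) (47 / 50) 1 x i) →
      (∀ i ∈ Ω, (∀ k : Fin N, dist (x k) (x i) ≤ 3 → k ∈ Ω) → (∃ (A : EuclideanSpace ℝ (Fin 3) →ₗᵢ[ℝ] EuclideanSpace ℝ (Fin 3)) (a h : ℝ) (s : ℤ → ℤ), 47 / 50 ≤ a ∧ a ≤ 1 ∧ 39 / 50 * a ≤ h ∧ h ≤ 17 / 20 * a ∧ IsHaggSeq s ∧ (fun S : Set (EuclideanSpace ℝ (Fin 3)) => (∀ j : Fin N, dist (x j) (x i) ≤ 2 → ∃ p ∈ S, dist (x j) p ≤ 2 / 5) ∧ (∀ p ∈ S, dist p (x i) ≤ 2 → ∃ j : Fin N, dist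 (x j) p ≤ 2 / 5)) {p | ∃ m u v : ℤ, p = x i + A (((u : ℝ) • triangularVec₁ a) + ((v : ℝ) • triangularVec₂ a) + ((haggLabel s m : ℝ) • barlowOffset a) + ((m : ℝ) • layerNormal h))})) → (Nat.card {i : Fin N // i ∈ Ω ∧ ¬ IsTwoShellGood ε₁ (47 / 50) 1 x i} : ℝ) ≤ K * ((∑ i ∈ Ω, (1 / 2 : ℝ) * (∑ j ∈ Ω.erase i, lennardJones (dist (x i) (x j)))) - (Ω.card : ℝ) * (⨅ Q : PeriodicConfiguration 3, Q.energyPerParticle lennardJones)) + C * (Nat.card {i : Fin N // i ∈ Ω ∧ ∃ j : Fin N, j ∉ Ω ∧ dist (x j) (x i) ≤ 4} : ℝ) := by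
  sorry

/-- The twin crux's `stub_flatnessPaid` (13958, skeleton v23, VERBATIM) implies `stub_nashFlatnessPaid` (take `δ = 1/3`, drop Nash and
force balance): one proof of the twin's stub closes this one. -/
theorem stub_nashFlatnessPaid_of_twin
    (h : ∃ ε₁ : ℝ, 1 / 100 ≤ ε₁ ∧ ε₁ ≤ 1 / 20 ∧ ∀ δ : ℝ, 0 < δ → ∃ K : ℝ, 0 ≤ K ∧ ∃ C : ℝ, ∀ (N : ℕ) (x : Fin N → EuclideanSpace ℝ (Fin 3)), (∀ i j : Fin N, i ≠ j → δ ≤ dist (x i) (x j)) → ∀ Ω : Finset (Fin N), (∀ i ∈ Ω, IsTwoShellGood ε₁ (47 / 50) 1 x i) → ∃ (sW : Fin N → ℤ → ℤ) (Gw : Fin N → (EuclideanSpace ℝ (Fin 3) →L[ℝ] EuclideanSpace ℝ (Fin 3))) (νw rw : Fin N → ℝ) (Aw : Fin N → (EuclideanSpace ℝ (Fin 3) →ₗᵢ[ℝ] EuclideanSpace ℝ (Fin 3))) (aw hw : Fin N → ℝ), (∀ i ∈ Ω, (∀ k : Fin N, dist (x k) (x i) ≤ 8 → k ∈ Ω)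 → IsHaggSeq (sW i) ∧ 0 ≤ νw i ∧ ((∀ j : Fin N, dist (x j) (x i) ≤ 3 → ∃ m u v : ℤ, dist (x j - x i) ((Gw i) (barlowPos 1 (Real.sqrt 6 / 3) (sW i) m u v)) ≤ (νw i)) ∧ (∀ m u v : ℤ, ‖(Gw i) (barlowPos 1 (Real.sqrt 6 / 3) (sW i) m u v)‖ ≤ 3 → ∃ j : Fin N, dist (x j - x i) ((Gw i) (barlowPos 1 (Real.sqrt 6 / 3) (sW i) m u v)) ≤ (νw i)) ∧ (∀ p : EuclideanSpace ℝ (Fin 3), 4 / 5 * ‖p‖ ≤ ‖(Gw i) p‖ ∧ ‖(Gw i) p‖ ≤ 6 / 5 * ‖p‖)) ∧ 47 / 50 ≤ aw i ∧ aw i ≤ 1 ∧ 39 / 50 * aw i ≤ hw i ∧ hw i ≤ 17 / 20 * aw i ∧ (∀ m u v : ℤ, ‖barlowPos 1 (Real.sqrt 6 / 3) (sW i) m u v‖ ≤ 3 → dist ((Gw i) (barlowPos 1 (Real.sqrt 6 / 3) (sW i) m u v)) ((Aw i) (barlowPos (aw i) (hw i) (sW i) m u v)) < rw i)) ∧ (∑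 i ∈ Ω.filter (fun i => ∀ k : Fin N, dist (x k) (x i) ≤ 8 → k ∈ Ω), (2400 * (νw i) ^ 2 + 800 * (rw i) ^ 2)) ≤ K * ((∑ i ∈ Ω, (1 / 2 : ℝ) * (∑ j ∈ Ω.erase i, lennardJones (dist (x i) (x j)))) - (Ω.card : ℝ) * (⨅ Q : PeriodicConfiguration 3, Q.energyPerParticle lennardJones)) + C * (Nat.card {i : Fin N // i ∈ Ω ∧ ∃ j : Fin N, j ∉ Ω ∧ dist (x j) (x i) ≤ 4} : ℝ)) :
    ∃ ε₁ : ℝ, 1 / 100 ≤ ε₁ ∧ ε₁ ≤ 1 / 20 ∧ ∃ K : ℝ, 0 ≤ K ∧ ∃ C : ℝ, ∀ (N : ℕ) (x : Fin N → EuclideanSpace ℝ (Fin 3)),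
      (∀ i j : Fin N, i ≠ j → 1 / 3 ≤ dist (x i) (x j)) →
      (∀ (i : Fin N) (y : EuclideanSpace ℝ (Fin 3)), (∀ j : Fin N, j ≠ i → y ≠ x j) → siteEnergy lennardJones x i ≤ ∑ j ∈ Finset.univ.erase i, lennardJones (dist y (x j))) →
      (∀ i : Fin N, ∑ j ∈ Finset.univ.erase i, (deriv lennardJones (dist (x i) (x j)) / dist (x i) (x j)) • (x i - x j) = 0) →
      ∀ Ω : Finset (Fin N), (∀ i ∈ Ω, IsTwoShellGood ε₁ (47 / 50) 1 x i) →
      ∃ (sW : Fin N → ℤ → ℤ) (Gw : Fin N → (EuclideanSpace ℝ (Fin 3) →L[ℝ] EuclideanSpace ℝ (Fin 3))) (νw rw : Fin N → ℝ) (Aw : Fin N → (EuclideanSpace ℝ (Fin 3) →ₗᵢ[ℝ] EuclideanSpace ℝ (Fin 3))) (aw hw : Fin N → ℝ), (∀ i ∈ Ω, (∀ k : Fin N, dist (x k) (x i) ≤ 8 → k ∈ Ω) → IsHaggSeq (sW i) ∧ 0 ≤ νw i ∧ ((∀ j : Fin N, dist (x j) (x i) ≤ 3 → ∃ m u v : ℤ,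 dist (x j - x i) ((Gw i) (barlowPos 1 (Real.sqrt 6 / 3) (sW i) m u v)) ≤ (νw i)) ∧ (∀ m u v : ℤ, ‖(Gw i) (barlowPos 1 (Real.sqrt 6 / 3) (sW i) m u v)‖ ≤ 3 → ∃ j : Fin N, dist (x j - x i) ((Gw i) (barlowPos 1 (Real.sqrt 6 / 3) (sW i) m u v)) ≤ (νw i)) ∧ (∀ p : EuclideanSpace ℝ (Fin 3), 4 / 5 * ‖p‖ ≤ ‖(Gw i) p‖ ∧ ‖(Gw i) p‖ ≤ 6 / 5 * ‖p‖)) ∧ 47 / 50 ≤ aw i ∧ aw i ≤ 1 ∧ 39 / 50 * aw i ≤ hw i ∧ hw i ≤ 17 / 20 * aw i ∧ (∀ m u v : ℤ, ‖barlowPos 1 (Real.sqrt 6 / 3) (sW i) m u v‖ ≤ 3 → dist ((Gw i) (barlowPos 1 (Real.sqrt 6 / 3) (sW i) m u v)) ((Aw i) (barlowPos (aw i) (hw i) (sW i) m u v)) < rw i)) ∧ (∑ i ∈ Ω.filter (fun i => ∀ k : Fin N, dist (x k) (x i) ≤ 8 → k ∈ Ω), (2400 * (νw i) ^ 2 + 800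 * (rw i) ^ 2)) ≤ K * ((∑ i ∈ Ω, (1 / 2 : ℝ) * (∑ j ∈ Ω.erase i, lennardJones (dist (x i) (x j)))) - (Ω.card : ℝ) * (⨅ Q : PeriodicConfiguration 3, Q.energyPerParticle lennardJones)) + C * (Nat.card {i : Fin N // i ∈ Ω ∧ ∃ j : Fin N, j ∉ Ω ∧ dist (x j) (x i) ≤ 4} : ℝ) := by
  obtain ⟨ε₁, h1, h2, hall⟩ := h
  obtain ⟨K, hK, C, hC⟩ := hall (1 / 3) (by norm_num)
  exact ⟨ε₁, h1, h2, K, hK, C, fun N x hsep _ _ Ω hΩ => hC N x hsep Ω hΩ⟩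

/-- The twin crux's `stub_roughSitesPaid` (13958, skeleton v23, VERBATIM) implies `stub_nashRoughSitesPaid`. -/
theorem stub_nashRoughSitesPaid_of_twin
    (h : ∀ ε₁ : ℝ, 1 / 100 ≤ ε₁ → ε₁ ≤ 1 / 20 → ∀ δ : ℝ, 0 < δ → ∃ K : ℝ, 0 ≤ K ∧ ∃ C : ℝ, ∀ (N : ℕ) (x : Fin N → EuclideanSpace ℝ (Fin 3)), (∀ i j : Fin N, i ≠ j → δ ≤ dist (x i) (x j)) → ∀ Ω : Finset (Fin N), (∀ i ∈ Ω, IsTwoShellGood (1 / 20) (47 / 50) 1 x i) → (∀ i ∈ Ω, (∀ k : Fin N, dist (x k) (x i) ≤ 3 → k ∈ Ω) → (∃ (A : EuclideanSpace ℝ (Fin 3) →ₗᵢ[ℝ] EuclideanSpace ℝ (Fin 3)) (a h : ℝ) (s : ℤ → ℤ), 47 / 50 ≤ a ∧ a ≤ 1 ∧ 39 / 50 * a ≤ h ∧ h ≤ 17 / 20 * a ∧ IsHaggSeq s ∧ (fun S : Set (EuclideanSpace ℝ (Fin 3)) => (∀ j : Fin N, dist (x j) (x i) ≤ 2 → ∃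 p ∈ S, dist (x j) p ≤ 2 / 5) ∧ (∀ p ∈ S, dist p (x i) ≤ 2 → ∃ j : Fin N, dist (x j) p ≤ 2 / 5)) {p | ∃ m u v : ℤ, p = x i + A (((u : ℝ) • triangularVec₁ a) + ((v : ℝ) • triangularVec₂ a) + ((haggLabel s m : ℝ) • barlowOffset a) + ((m : ℝ) • layerNormal h))})) → (Nat.card {i : Fin N // i ∈ Ω ∧ ¬ IsTwoShellGood ε₁ (47 / 50) 1 x i} : ℝ) ≤ K * ((∑ i ∈ Ω, (1 / 2 : ℝ) * (∑ j ∈ Ω.erase i, lennardJones (dist (x i) (x j)))) - (Ω.card : ℝ) * (⨅ Q : PeriodicConfiguration 3, Q.energyPerParticle lennardJones)) + C * (Nat.card {i : Fin N // i ∈ Ω ∧ ∃ j : Fin N, j ∉ Ω ∧ dist (x j) (x i) ≤ 4} : ℝ)) :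
    ∀ ε₁ : ℝ, 1 / 100 ≤ ε₁ → ε₁ ≤ 1 / 20 → ∃ K : ℝ, 0 ≤ K ∧ ∃ C : ℝ, ∀ (N : ℕ) (x : Fin N → EuclideanSpace ℝ (Fin 3)),
      (∀ i j : Fin N, i ≠ j → 1 / 3 ≤ dist (x i) (x j)) →
      (∀ (i : Fin N) (y : EuclideanSpace ℝ (Fin 3)), (∀ j : Fin N, j ≠ i → y ≠ x j) → siteEnergy lennardJones x i ≤ ∑ j ∈ Finset.univ.erase i, lennardJones (dist y (x j))) →
      (∀ i : Fin N, ∑ j ∈ Finset.univ.erase i, (deriv lennardJones (dist (x i) (x j)) / dist (x i) (x j)) • (x i - x j) = 0) →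
      ∀ Ω : Finset (Fin N), (∀ i ∈ Ω, IsTwoShellGood (1 / 20) (47 / 50) 1 x i) →
      (∀ i ∈ Ω, (∀ k : Fin N, dist (x k) (x i) ≤ 3 → k ∈ Ω) → (∃ (A : EuclideanSpace ℝ (Fin 3) →ₗᵢ[ℝ] EuclideanSpace ℝ (Fin 3)) (a h : ℝ) (s : ℤ → ℤ), 47 / 50 ≤ a ∧ a ≤ 1 ∧ 39 / 50 * a ≤ h ∧ h ≤ 17 / 20 * a ∧ IsHaggSeq s ∧ (fun S : Set (EuclideanSpace ℝ (Fin 3)) => (∀ j : Fin N, dist (x j) (x i) ≤ 2 → ∃ p ∈ S, dist (x j) p ≤ 2 / 5) ∧ (∀ p ∈ S, dist p (x i) ≤ 2 → ∃ j : Fin N, dist (x j) p ≤ 2 / 5)) {p | ∃ m u v : ℤ, p = x i + A (((u : ℝ) • triangularVec₁ a) + ((v : ℝ) • triangularVec₂ a) + ((haggLabel s m : ℝ) • barlowOffset a) + ((m : ℝ) • layerNormal h))})) → (Nat.card {i : Fin N // i ∈ Ω ∧ ¬ IsTwoShellGood ε₁ (47 / 50) 1 x i} : ℝ) ≤ K *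 ((∑ i ∈ Ω, (1 / 2 : ℝ) * (∑ j ∈ Ω.erase i, lennardJones (dist (x i) (x j)))) - (Ω.card : ℝ) * (⨅ Q : PeriodicConfiguration 3, Q.energyPerParticle lennardJones)) + C * (Nat.card {i : Fin N // i ∈ Ω ∧ ∃ j : Fin N, j ∉ Ω ∧ dist (x j) (x i) ≤ 4} : ℝ) := by
  intro ε₁ h1 h2
  obtain ⟨K, hK, C, hC⟩ := h ε₁ h1 h2 (1 / 3) (by norm_num)
  exact ⟨K, hK, C, fun N x hsep _ _ Ω hΩ hch => hC N x hsep Ω hΩ hch⟩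

/-! ## The chart (geometry): the twin's proved assembly, re-run here -/

/-- Homogeneity of the Barlow template in its two spacings. -/
theorem barlowPos_smul (a h₀ : ℝ) (s : ℤ → ℤ) (m u v : ℤ) :
    barlowPos a (a * h₀) s m u v = a • barlowPos 1 h₀ s m u v := by
  ext l
  fin_cases l <;> simp <;> ring

/-- The template point of the chart in the centre's frame. -/
theorem chart_template_eq (a h₀ : ℝ) (s : ℤ → ℤ) (A R : EuclideanSpace ℝ (Fin 3) →ₗᵢ[ℝ] EuclideanSpace ℝ (Fin 3)) (m u v : ℤ) :
    (A.comp R) (((u : ℝ) • triangularVec₁ a) + ((v : ℝ) • triangularVec₂ a) + ((haggLabel s m : ℝ) • barlowOffset a) +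
        ((m : ℝ) • layerNormal (a * h₀))) = a • A (R (barlowPos 1 h₀ s m u v)) := by
  show (A.comp R) (barlowPos a (a * h₀) s m u v) = _
  rw [barlowPos_smul, LinearIsometry.coe_comp, Function.comp_apply, map_smul, map_smul]

/-- `√6 / 3 ∈ [39/50, 17/20]`. -/
theorem sqrt_six_div_three_mem : (39 / 50 : ℝ) ≤ Real.sqrt 6 / 3 ∧ Real.sqrt 6 / 3 ≤ 17 / 20 := by
  have h1 : (117 / 50 : ℝ) ≤ Real.sqrt 6 := by
    rw [show (117 / 50 : ℝ) = Real.sqrt ((117 / 50) ^ 2) by rw [Real.sqrt_sq]; norm_num]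
    exact Real.sqrt_le_sqrt (by norm_num)
  have h2 : Real.sqrt 6 ≤ 51 / 20 := by
    rw [show (51 / 20 : ℝ) = Real.sqrt ((51 / 20) ^ 2) by rw [Real.sqrt_sq]; norm_num]
    exact Real.sqrt_le_sqrt (by norm_num)
  constructor <;> linarith

/-- **ASSEMBLY of the chart (proved; the twin's `chart_of_stubs` verbatim): coverage → core → sites → the
radius-8 chart at tolerance `2/5`**, scale window `[47/50,1]`, spacing window `[39a/50, 17a/20]`. -/
theorem chart_of_stubs
    (hcov : ∀ P : Finset (EuclideanSpace ℝ (Fin 3)), (P = fccTwoShellPattern ∨ P = hcpTwoShellPattern) →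
      ∀ (A : EuclideanSpace ℝ (Fin 3) →ₗᵢ[ℝ] EuclideanSpace ℝ (Fin 3)) (a : ℝ), 47 / 50 ≤ a → a ≤ 1 →
        ∀ y : EuclideanSpace ℝ (Fin 3), ‖y‖ ≤ 2 → ∃ v ∈ insert (0 : EuclideanSpace ℝ (Fin 3)) P, ‖y - a • A v‖ ≤ 141 / 100 - a / 20)
    (hcore : ∀ (N : ℕ) (x : Fin N → EuclideanSpace ℝ (Fin 3)) (i : Fin N),
      (∀ k : Fin N, dist (x k) (x i) ≤ 3 → IsTwoShellGood (1 / 20) (47 / 50) 1 x k) →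
      ∀ (a : ℝ) (A : EuclideanSpace ℝ (Fin 3) →ₗᵢ[ℝ] EuclideanSpace ℝ (Fin 3)) (P : Finset (EuclideanSpace ℝ (Fin 3))) (f : EuclideanSpace ℝ (Fin 3) → Fin N),
        47 / 50 ≤ a → a ≤ 1 → (P = fccTwoShellPattern ∨ P = hcpTwoShellPattern) →
        (∀ v ∈ P, f v ≠ i ∧ dist (x (f v)) (x i + a • A v) ≤ 1 / 20 * a) → Set.InjOn f ↑P →
        (∀ j : Fin N, j ≠ i → dist (x j) (x i) ≤ 3 / 2 * a → ∃ v ∈ P, f v = j) →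
        ∃ (R : EuclideanSpace ℝ (Fin 3) →ₗᵢ[ℝ] EuclideanSpace ℝ (Fin 3)) (s : ℤ → ℤ), IsHaggSeq s ∧
          (∀ v ∈ P, ∃ m u w : ℤ, R (barlowPos 1 (Real.sqrt 6 / 3) s m u w) = v) ∧
          (∀ m u w : ℤ, ‖barlowPos 1 (Real.sqrt 6 / 3) s m u w‖ ≤ 3 / 2 → barlowPos 1 (Real.sqrt 6 / 3) s m u w ≠ 0 → R (barlowPos 1 (Real.sqrt 6 / 3) s m u w) ∈ P) ∧
          (∀ v ∈ P, ∀ k : Fin N, dist (x k) (x (f v)) ≤ 141 / 100 → dist (x k) (x i) ≤ 2 →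
            ∃ m u w : ℤ, dist (x k) (x i + a • A (R (barlowPos 1 (Real.sqrt 6 / 3) s m u w))) ≤ 2 / 5) ∧
          (∀ v ∈ P, ∀ m u w : ℤ, ‖barlowPos 1 (Real.sqrt 6 / 3) s m u w‖ ≤ 43 / 20 → dist (R (barlowPos 1 (Real.sqrt 6 / 3) s m u w)) v ≤ 3 / 2 →
            ∃ k : Fin N, dist (x k) (x i + a • A (R (barlowPos 1 (Real.sqrt 6 / 3) s m u w))) ≤ 2 / 5))
    (hsites : ∀ s : ℤ → ℤ, IsHaggSeq s → ∀ m u v : ℤ, ‖barlowPos 1 (Real.sqrt 6 / 3) s m u v‖ ≤ 43 / 20 →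
      barlowPos 1 (Real.sqrt 6 / 3) s m u v = 0 ∨
        ∃ m' u' v' : ℤ, 0 < ‖barlowPos 1 (Real.sqrt 6 / 3) s m' u' v'‖ ∧ ‖barlowPos 1 (Real.sqrt 6 / 3) s m' u' v'‖ ≤ 3 / 2 ∧
          ‖barlowPos 1 (Real.sqrt 6 / 3) s m u v - barlowPos 1 (Real.sqrt 6 / 3) s m' u' v'‖ ≤ 3 / 2) :
    ∀ (N : ℕ) (x : Fin N → EuclideanSpace ℝ (Fin 3)) (Ω : Finset (Fin N)), (∀ i ∈ Ω, IsTwoShellGood (1 / 20) (47 / 50) 1 x i) →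
      ∀ i ∈ Ω, (∀ k : Fin N, dist (x k) (x i) ≤ 8 → k ∈ Ω) →
        (∃ (A : EuclideanSpace ℝ (Fin 3) →ₗᵢ[ℝ] EuclideanSpace ℝ (Fin 3)) (a h : ℝ) (s : ℤ → ℤ), 47 / 50 ≤ a ∧ a ≤ 1 ∧ 39 / 50 * a ≤ h ∧ h ≤ 17 / 20 * a ∧ IsHaggSeq s ∧ (fun S : Set (EuclideanSpace ℝ (Fin 3)) => (∀ j : Fin N, dist (x j) (x i) ≤ 2 → ∃ p ∈ S, dist (x j) p ≤ 2 / 5) ∧ (∀ p ∈ S, dist p (x i) ≤ 2 → ∃ j : Fin N, dist (x j) p ≤ 2 / 5)) {p | ∃ m u v : ℤ, p = x i + A (((u : ℝ) • triangularVec₁ a) + ((v : ℝ) • triangularVec₂ a) + ((haggLabel s m : ℝ) • barlowOffset a) + ((m : ℝ) • layerNormal h))}) := by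
  intro N x Ω hΩ i hi h8
  have hgood3 : ∀ k : Fin N, dist (x k) (x i) ≤ 3 → IsTwoShellGood (1 / 20) (47 / 50) 1 x k :=
    fun k hk => hΩ k (h8 k (by linarith))
  obtain ⟨a, ha1, ha2, A, P, f, hP, hf, hinj, hcomp⟩ := hΩ i hi
  obtain ⟨R, s, hs, hc1, hc2, hA, hB⟩ := hcore N x i hgood3 a A P f ha1 ha2 hP hf hinj hcomp
  obtain ⟨h6lo, h6hi⟩ := sqrt_six_div_three_mem
  have ha0 : 0 < a := by linarith
  refine ⟨A.comp R, a, a * (Real.sqrt 6 / 3), s, ha1, ha2, by nlinarith, by nlinarith, hs, ?_, ?_⟩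
  · -- particles within `2` of `x i`
    intro j hj
    have hy : ‖x j - x i‖ ≤ 2 := by rwa [← dist_eq_norm]
    obtain ⟨v, hv, hvy⟩ := hcov P hP A a ha1 ha2 (x j - x i) hy
    rcases Finset.mem_insert.1 hv with rfl | hvP
    · -- covered by the centre itself: `j` is `i` or one of its pattern particles
      have hji : dist (x j) (x i) ≤ 3 / 2 * a := by
        rw [dist_eq_norm]
        have : ‖x j - x i - a • A (0 : EuclideanSpace ℝ (Fin 3))‖ = ‖x j - x i‖ := by simp
        linarith [this ▸ hvy]
      by_cases hji' : j = i
      · subst hji'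
        refine ⟨x j, ⟨0, 0, 0, ?_⟩, by rw [dist_self]; norm_num⟩
        rw [chart_template_eq]
        simp [barlowPos]
      · obtain ⟨w, hw, hfw⟩ := hcomp j hji' hji
        obtain ⟨m, u, w', hRw⟩ := hc1 w hw
        refine ⟨x i + a • A w, ⟨m, u, w', by rw [chart_template_eq, hRw]⟩, ?_⟩
        have := (hf w hw).2
        rw [hfw] at this
        calc dist (x j) (x i + a • A w) ≤ 1 / 20 * a := this
          _ ≤ 2 / 5 := by linarith
    · -- covered by the pattern neighbour `f v`
      have hd : dist (x j) (x (f v)) ≤ 141 / 100 := by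
        calc dist (x j) (x (f v)) ≤ dist (x j) (x i + a • A v) + dist (x i + a • A v) (x (f v)) := dist_triangle _ _ _
          _ ≤ (141 / 100 - a / 20) + 1 / 20 * a := by
              refine add_le_add ?_ ?_
              · rw [dist_eq_norm]
                have : x j - (x i + a • A v) = x j - x i - a • A v := by abel
                rw [this]; exact hvy
              · rw [dist_comm]; exact (hf v hvP).2
          _ = 141 / 100 := by ring
      obtain ⟨m, u, w, hk⟩ := hA v hvP j hd hj
      exact ⟨_, ⟨m, u, w, by rw [chart_template_eq]⟩, hk⟩
  · -- template points within `2` of `x i`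
    rintro p ⟨m, u, v, rfl⟩ hp
    rw [chart_template_eq] at hp ⊢
    have hnorm : ∀ b : EuclideanSpace ℝ (Fin 3), ‖a • A (R b)‖ = a * ‖b‖ := fun b => by
      rw [norm_smul, Real.norm_of_nonneg ha0.le, LinearIsometry.norm_map, LinearIsometry.norm_map]
    have hp' : ‖a • A (R (barlowPos 1 (Real.sqrt 6 / 3) s m u v))‖ ≤ 2 := by
      have := hp
      rwa [dist_eq_norm, add_sub_cancel_left] at this
    have hb2 : a * ‖barlowPos 1 (Real.sqrt 6 / 3) s m u v‖ ≤ 2 := by rwa [hnorm] at hp'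
    have hb : ‖barlowPos 1 (Real.sqrt 6 / 3) s m u v‖ ≤ 43 / 20 := by
      by_contra hcon
      push Not at hcon
      have h1 : (47 / 50 : ℝ) * (43 / 20) ≤ a * (43 / 20) := by nlinarith
      have h2 : a * (43 / 20) < a * ‖barlowPos 1 (Real.sqrt 6 / 3) s m u v‖ := mul_lt_mul_of_pos_left hcon ha0
      linarith
    rcases hsites s hs m u v hb with hb0 | ⟨m', u', v', hpos, hc, hnear⟩
    · refine ⟨i, ?_⟩
      rw [hb0, map_zero, map_zero, smul_zero, add_zero, dist_self]
      norm_num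
    · have hne : barlowPos 1 (Real.sqrt 6 / 3) s m' u' v' ≠ 0 := by
        intro h0; rw [h0, norm_zero] at hpos; exact lt_irrefl _ hpos
      have hcP : R (barlowPos 1 (Real.sqrt 6 / 3) s m' u' v') ∈ P := hc2 m' u' v' hc hne
      have hdist : dist (R (barlowPos 1 (Real.sqrt 6 / 3) s m u v)) (R (barlowPos 1 (Real.sqrt 6 / 3) s m' u' v')) ≤ 3 / 2 := by
        rw [dist_eq_norm, ← map_sub, LinearIsometry.norm_map]
        exact hnear
      obtain ⟨k, hk⟩ := hB _ hcP m u v hb hdist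
      exact ⟨k, hk⟩

/-! ## Intermediate statements of the proved chain (Nash class, `δ = 1/3`) -/

/-- NashPNF: the PURE near-field inequality on the Nash class (self-energy of `Ω` on the right). -/
def Stmt.nashPureNearField : Prop :=
  ∀ η : ℝ, 0 < η → ∃ c : ℝ, 0 < c ∧ ∃ C : ℝ, ∀ (N : ℕ) (x : Fin N → EuclideanSpace ℝ (Fin 3)),
      (∀ i j : Fin N, i ≠ j → 1 / 3 ≤ dist (x i) (x j)) →
      (∀ (i : Fin N) (y : EuclideanSpace ℝ (Fin 3)), (∀ j : Fin N, j ≠ i → y ≠ x j) → siteEnergy lennardJones x i ≤ ∑ j ∈ Finset.univ.erase i, lennardJones (dist y (x j))) →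
      ∀ Ω : Finset (Fin N), (∀ i ∈ Ω, IsTwoShellGood (1 / 20) (47 / 50) 1 x i) →
        c * (Nat.card {i : Fin N // i ∈ Ω ∧ ¬ (∃ (A : EuclideanSpace ℝ (Fin 3) →ₗᵢ[ℝ] EuclideanSpace ℝ (Fin 3)) (t : EuclideanSpace ℝ (Fin 3)) (a : ℝ) (s : ℤ → ℤ) (z : ℤ → ℝ), 47 / 50 ≤ a ∧ a ≤ 1 ∧ IsHaggSeq s ∧ (∀ m : ℤ, 39 / 50 * a ≤ z (m + 1) - z m ∧ z (m + 1) - z m ≤ 17 / 20 * a) ∧ (fun S : Set (EuclideanSpace ℝ (Fin 3)) => (∀ j : Fin N, dist (x j) (x i) ≤ 2 → ∃ p ∈ S, dist (x j + t) p ≤ η) ∧ (∀ p ∈ S, dist p (x i + t) ≤ 2 → ∃ j : Fin N, dist (x j + t) p ≤ η)) {p | ∃ m i j : ℤ, p = A (((i : ℝ) • triangularVec₁ a) + ((j : ℝ) • triangularVec₂ a) + ((haggLabel s m : ℝ) • barlowOffset a) + (z m • layerNormal 1))})} : ℝ) - C * (Nat.card {i : Fin N // i ∈ Ω ∧ ∃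 j : Fin N, j ∉ Ω ∧ dist (x j) (x i) ≤ 4} : ℝ) ≤ (∑ i ∈ Ω, (1 / 2 : ℝ) * (∑ j ∈ Ω.erase i, lennardJones (dist (x i) (x j)))) - (Ω.card : ℝ) * (⨅ Q : PeriodicConfiguration 3, Q.energyPerParticle lennardJones)

/-- The crux `NashNearField`, inline (the route decl unfolds to this text, with `let S := …;` for the
`(fun S => …) …` redexes). -/
def Stmt.nashNearFieldInline : Prop :=
  ∀ η : ℝ, 0 < η → ∃ c : ℝ, 0 < c ∧ ∃ C : ℝ, ∀ (N : ℕ) (x : Fin N → EuclideanSpace ℝ (Fin 3)),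
      (∀ i j : Fin N, i ≠ j → 1 / 3 ≤ dist (x i) (x j)) →
      (∀ (i : Fin N) (y : EuclideanSpace ℝ (Fin 3)), (∀ j : Fin N, j ≠ i → y ≠ x j) → siteEnergy lennardJones x i ≤ ∑ j ∈ Finset.univ.erase i, lennardJones (dist y (x j))) →
      ∀ Ω : Finset (Fin N), (∀ i ∈ Ω, IsTwoShellGood (1 / 20) (47 / 50) 1 x i) →
        c * (Nat.card {i : Fin N // i ∈ Ω ∧ ¬ (∃ (A : EuclideanSpace ℝ (Fin 3) →ₗᵢ[ℝ] EuclideanSpace ℝ (Fin 3)) (t : EuclideanSpace ℝ (Fin 3)) (a : ℝ) (s : ℤ → ℤ) (z : ℤ → ℝ), 47 / 50 ≤ a ∧ a ≤ 1 ∧ IsHaggSeq s ∧ (∀ m : ℤ, 39 / 50 * a ≤ z (m + 1) - z m ∧ z (m + 1) - z m ≤ 17 / 20 * a) ∧ (fun S : Set (EuclideanSpace ℝ (Fin 3)) => (∀ j : Fin N, dist (x j) (x i) ≤ 2 → ∃ p ∈ S, dist (x j + t) p ≤ η) ∧ (∀ p ∈ S, dist p (x i + t) ≤ 2 → ∃ j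 : Fin N, dist (x j + t) p ≤ η)) {p | ∃ m i j : ℤ, p = A (((i : ℝ) • triangularVec₁ a) + ((j : ℝ) • triangularVec₂ a) + ((haggLabel s m : ℝ) • barlowOffset a) + (z m • layerNormal 1))})} : ℝ) - C * (Nat.card {i : Fin N // i ∈ Ω ∧ ∃ j : Fin N, j ∉ Ω ∧ dist (x j) (x i) ≤ 4} : ℝ) ≤ ∑ i ∈ Ω, ((1 / 2 : ℝ) * (∑ j ∈ Finset.univ.erase i, lennardJones (dist (x i) (x j))) - (⨅ Q : PeriodicConfiguration 3, Q.energyPerParticle lennardJones))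

/-! ## v4: the split of the interior coercivity — statements, helpers and the proved composition -/

/-- C′. -/
def Stmt.cprime : Prop :=
  ∀ (N : ℕ) (x : Fin N → EuclideanSpace ℝ (Fin 3)) (i : Fin N) (s : ℤ → ℤ) (G : EuclideanSpace ℝ (Fin 3) →L[ℝ] EuclideanSpace ℝ (Fin 3)) (ν η : ℝ),
      IsHaggSeq s → 0 ≤ ν → ν ≤ η / 2 → η ≤ 1 / 10 →
      ((∀ j : Fin N, dist (x j) (x i) ≤ 3 → ∃ m u v : ℤ, dist (x j - x i) (G (barlowPos 1 (Real.sqrt 6 / 3) s m u v)) ≤ ν) ∧ (∀ m u v : ℤ, ‖G (barlowPos 1 (Real.sqrt 6 / 3) s m u v)‖ ≤ 3 → ∃ j : Fin N, dist (x j - x i) (G (barlowPos 1 (Real.sqrt 6 / 3) s m u v)) ≤ ν) ∧ (∀ p : EuclideanSpace ℝ (Fin 3), 4 / 5 * ‖p‖ ≤ ‖G p‖ ∧ ‖G p‖ ≤ 6 / 5 * ‖p‖)) →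
      ¬ (∃ (A : EuclideanSpace ℝ (Fin 3) →ₗᵢ[ℝ] EuclideanSpace ℝ (Fin 3)) (t : EuclideanSpace ℝ (Fin 3)) (a : ℝ) (s : ℤ → ℤ) (z : ℤ → ℝ), 47 / 50 ≤ a ∧ a ≤ 1 ∧ IsHaggSeq s ∧ (∀ m : ℤ, 39 / 50 * a ≤ z (m + 1) - z m ∧ z (m + 1) - z m ≤ 17 / 20 * a) ∧ (fun S : Set (EuclideanSpace ℝ (Fin 3)) => (∀ j : Fin N, dist (x j) (x i) ≤ 2 → ∃ p ∈ S, dist (x j + t) p ≤ η) ∧ (∀ p ∈ S, dist p (x i + t) ≤ 2 → ∃ j : Fin N, dist (x j + t) p ≤ η)) {p | ∃ m i j : ℤ, p = A (((i : ℝ) • triangularVec₁ a) + ((j : ℝ) • triangularVec₂ a) + ((haggLabel s m : ℝ) • barlowOffset a) + (z m • layerNormal 1))}) →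
      (∀ (A : EuclideanSpace ℝ (Fin 3) →ₗᵢ[ℝ] EuclideanSpace ℝ (Fin 3)) (a h : ℝ), 47 / 50 ≤ a → a ≤ 1 → 39 / 50 * a ≤ h → h ≤ 17 / 20 * a → ∃ m u v : ℤ, ‖barlowPos 1 (Real.sqrt 6 / 3) s m u v‖ ≤ 3 ∧ (η - ν) ≤ dist (G (barlowPos 1 (Real.sqrt 6 / 3) s m u v)) (A (barlowPos a h s m u v)))

/-- B″. -/
def Stmt.bsmooth : Prop :=
  ∃ κ : ℝ, 0 < κ ∧ ∃ ν₁ : ℝ, 0 < ν₁ ∧ ∃ CR C : ℝ, ∀ r : ℝ, 0 < r → r ≤ 1 / 10 →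
      ∀ (N : ℕ) (x : Fin N → EuclideanSpace ℝ (Fin 3)), (∀ i j : Fin N, i ≠ j → 1 / 3 ≤ dist (x i) (x j)) →
      ∀ Ω : Finset (Fin N), (∀ i ∈ Ω, IsTwoShellGood (1 / 20) (47 / 50) 1 x i) →
      ∀ (sW : Fin N → ℤ → ℤ) (Gw : Fin N → (EuclideanSpace ℝ (Fin 3) →L[ℝ] EuclideanSpace ℝ (Fin 3))) (νw : Fin N → ℝ),
      (∀ i ∈ Ω, (∀ k : Fin N, dist (x k) (x i) ≤ 8 → k ∈ Ω) → IsHaggSeq (sW i) ∧ 0 ≤ νw i ∧ νw i ≤ ν₁ ∧ ((∀ j : Fin N, dist (x j) (x i) ≤ 3 → ∃ m u v : ℤ, dist (x j - x i) ((Gw i) (barlowPos 1 (Real.sqrt 6 / 3) (sW i) m u v)) ≤ (νw i)) ∧ (∀ m u v : ℤ, ‖(Gw i) (barlowPos 1 (Real.sqrt 6 / 3) (sW i) m u v)‖ ≤ 3 → ∃ j : Fin N, dist (x j - x i) ((Gw i) (barlowPos 1 (Real.sqrt 6 / 3) (sW i) m u v)) ≤ (νw i)) ∧ (∀ p : EuclideanSpace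 ℝ (Fin 3), 4 / 5 * ‖p‖ ≤ ‖(Gw i) p‖ ∧ ‖(Gw i) p‖ ≤ 6 / 5 * ‖p‖))) →
        κ * r ^ 2 * (Nat.card {i : Fin N // i ∈ Ω ∧ ((∀ k : Fin N, dist (x k) (x i) ≤ 8 → k ∈ Ω) ∧ (∀ (A : EuclideanSpace ℝ (Fin 3) →ₗᵢ[ℝ] EuclideanSpace ℝ (Fin 3)) (a h : ℝ), 47 / 50 ≤ a → a ≤ 1 → 39 / 50 * a ≤ h → h ≤ 17 / 20 * a → ∃ m u v : ℤ, ‖barlowPos 1 (Real.sqrt 6 / 3) (sW i) m u v‖ ≤ 3 ∧ r ≤ dist ((Gw i) (barlowPos 1 (Real.sqrt 6 / 3) (sW i) m u v)) (A (barlowPos a h (sW i) m u v))))} : ℝ) ≤ (∑ i ∈ Ω, (1 / 2 : ℝ) * (∑ j ∈ Ω.erase i, lennardJones (dist (x i) (x j)))) - (Ω.card : ℝ) * (⨅ Q : PeriodicConfiguration 3, Q.energyPerParticle lennardJones) + CR * (∑ i ∈ Ω.filter (fun i => (∀ k : Fin N, dist (x k) (x i) ≤ 8 → k ∈ Ω)),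 (νw i) ^ 2) + C * (Nat.card {i : Fin N // i ∈ Ω ∧ ∃ j : Fin N, j ∉ Ω ∧ dist (x j) (x i) ≤ 4} : ℝ)

/-- I_flat on the Nash class (v10). -/
def Stmt.iflatNash : Prop :=
    ∃ ε₁ : ℝ, 1 / 100 ≤ ε₁ ∧ ε₁ ≤ 1 / 20 ∧ ∃ K : ℝ, 0 ≤ K ∧ ∃ C : ℝ, ∀ (N : ℕ) (x : Fin N → EuclideanSpace ℝ (Fin 3)),
      (∀ i j : Fin N, i ≠ j → 1 / 3 ≤ dist (x i) (x j)) →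
      (∀ (i : Fin N) (y : EuclideanSpace ℝ (Fin 3)), (∀ j : Fin N, j ≠ i → y ≠ x j) → siteEnergy lennardJones x i ≤ ∑ j ∈ Finset.univ.erase i, lennardJones (dist y (x j))) →
      (∀ i : Fin N, ∑ j ∈ Finset.univ.erase i, (deriv lennardJones (dist (x i) (x j)) / dist (x i) (x j)) • (x i - x j) = 0) →
      ∀ Ω : Finset (Fin N), (∀ i ∈ Ω, IsTwoShellGood ε₁ (47 / 50) 1 x i) →
      ∃ (sW : Fin N → ℤ → ℤ) (Gw : Fin N → (EuclideanSpace ℝ (Fin 3) →L[ℝ] EuclideanSpace ℝ (Fin 3))) (νw rw : Fin N → ℝ) (Aw : Fin N → (EuclideanSpace ℝ (Fin 3) →ₗᵢ[ℝ] EuclideanSpace ℝ (Fin 3))) (aw hw : Fin N → ℝ), (∀ i ∈ Ω, (∀ k : Fin N, dist (x k) (x i) ≤ 8 → k ∈ Ω) → IsHaggSeq (sW i) ∧ 0 ≤ νw i ∧ ((∀ j : Fin N, dist (x j) (x i) ≤ 3 → ∃ m u v : ℤ, dist (x j - x i) ((Gw i) (barlowPos 1 (Real.sqrt 6 / 3)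 (sW i) m u v)) ≤ (νw i)) ∧ (∀ m u v : ℤ, ‖(Gw i) (barlowPos 1 (Real.sqrt 6 / 3) (sW i) m u v)‖ ≤ 3 → ∃ j : Fin N, dist (x j - x i) ((Gw i) (barlowPos 1 (Real.sqrt 6 / 3) (sW i) m u v)) ≤ (νw i)) ∧ (∀ p : EuclideanSpace ℝ (Fin 3), 4 / 5 * ‖p‖ ≤ ‖(Gw i) p‖ ∧ ‖(Gw i) p‖ ≤ 6 / 5 * ‖p‖)) ∧ 47 / 50 ≤ aw i ∧ aw i ≤ 1 ∧ 39 / 50 * aw i ≤ hw i ∧ hw i ≤ 17 / 20 * aw i ∧ (∀ m u v : ℤ, ‖barlowPos 1 (Real.sqrt 6 / 3) (sW i) m u v‖ ≤ 3 → dist ((Gw i) (barlowPos 1 (Real.sqrt 6 / 3) (sW i) m u v)) ((Aw i) (barlowPos (aw i) (hw i) (sW i) m u v)) < rw i)) ∧ (∑ i ∈ Ω.filter (fun i => ∀ k : Fin N, dist (x k) (x i) ≤ 8 → k ∈ Ω), (2400 * (νw i) ^ 2 + 800 * (rw i) ^ 2)) ≤ K * ((∑ i ∈ Ω, (1 / 2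 : ℝ) * (∑ j ∈ Ω.erase i, lennardJones (dist (x i) (x j)))) - (Ω.card : ℝ) * (⨅ Q : PeriodicConfiguration 3, Q.energyPerParticle lennardJones)) + C * (Nat.card {i : Fin N // i ∈ Ω ∧ ∃ j : Fin N, j ∉ Ω ∧ dist (x j) (x i) ≤ 4} : ℝ)

/-- II_band on the Nash class (v10). -/
def Stmt.iibandNash : Prop :=
    ∀ ε₁ : ℝ, 1 / 100 ≤ ε₁ → ε₁ ≤ 1 / 20 → ∃ K : ℝ, 0 ≤ K ∧ ∃ C : ℝ, ∀ (N : ℕ) (x : Fin N → EuclideanSpace ℝ (Fin 3)),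
      (∀ i j : Fin N, i ≠ j → 1 / 3 ≤ dist (x i) (x j)) →
      (∀ (i : Fin N) (y : EuclideanSpace ℝ (Fin 3)), (∀ j : Fin N, j ≠ i → y ≠ x j) → siteEnergy lennardJones x i ≤ ∑ j ∈ Finset.univ.erase i, lennardJones (dist y (x j))) →
      (∀ i : Fin N, ∑ j ∈ Finset.univ.erase i, (deriv lennardJones (dist (x i) (x j)) / dist (x i) (x j)) • (x i - x j) = 0) →
      ∀ Ω : Finset (Fin N), (∀ i ∈ Ω, IsTwoShellGood (1 / 20) (47 / 50) 1 x i) →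
      (∀ i ∈ Ω, (∀ k : Fin N, dist (x k) (x i) ≤ 3 → k ∈ Ω) → (∃ (A : EuclideanSpace ℝ (Fin 3) →ₗᵢ[ℝ] EuclideanSpace ℝ (Fin 3)) (a h : ℝ) (s : ℤ → ℤ), 47 / 50 ≤ a ∧ a ≤ 1 ∧ 39 / 50 * a ≤ h ∧ h ≤ 17 / 20 * a ∧ IsHaggSeq s ∧ (fun S : Set (EuclideanSpace ℝ (Fin 3)) => (∀ j : Fin N, dist (x j) (x i) ≤ 2 → ∃ p ∈ S, dist (x j) p ≤ 2 / 5) ∧ (∀ p ∈ S, dist p (x i) ≤ 2 → ∃ j : Fin N, dist (x j) p ≤ 2 / 5)) {p | ∃ m u v : ℤ, p = x i + A (((u : ℝ) • triangularVec₁ a) + ((v : ℝ) • triangularVec₂ a) + ((haggLabel s m : ℝ) • barlowOffset a) + ((m : ℝ) • layerNormal h))})) → (Nat.card {i : Fin N // i ∈ Ω ∧ ¬ IsTwoShellGood ε₁ (47 / 50) 1 x i} : ℝ) ≤ K * ((∑ i ∈ Ω, (1 / 2 : ℝ) * (∑ j ∈ Ω.erase i, lennardJones (dist (x i) (x j))))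 - (Ω.card : ℝ) * (⨅ Q : PeriodicConfiguration 3, Q.energyPerParticle lennardJones)) + C * (Nat.card {i : Fin N // i ∈ Ω ∧ ∃ j : Fin N, j ∉ Ω ∧ dist (x j) (x i) ≤ 4} : ℝ)

/-- Charts at the radius-3 interior of a good set. -/
def Stmt.chart3 : Prop :=
  ∀ (N : ℕ) (x : Fin N → EuclideanSpace ℝ (Fin 3)) (Ω : Finset (Fin N)), (∀ i ∈ Ω, IsTwoShellGood (1 / 20) (47 / 50) 1 x i) → ∀ i ∈ Ω, (∀ k : Fin N, dist (x k) (x i) ≤ 3 → k ∈ Ω) → (∃ (A : EuclideanSpace ℝ (Fin 3) →ₗᵢ[ℝ] EuclideanSpace ℝ (Fin 3)) (a h : ℝ) (s : ℤ → ℤ), 47 / 50 ≤ a ∧ a ≤ 1 ∧ 39 / 50 * a ≤ h ∧ h ≤ 17 / 20 * a ∧ IsHaggSeq s ∧ (fun S : Set (EuclideanSpace ℝ (Fin 3)) => (∀ j : Fin N, dist (x j) (x i) ≤ 2 → ∃ p ∈ S, dist (x j) p ≤ 2 / 5) ∧ (∀ p ∈ S, dist p (x i) ≤ 2 → ∃ j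 : Fin N, dist (x j) p ≤ 2 / 5)) {p | ∃ m u v : ℤ, p = x i + A (((u : ℝ) • triangularVec₁ a) + ((v : ℝ) • triangularVec₂ a) + ((haggLabel s m : ℝ) • barlowOffset a) + ((m : ℝ) • layerNormal h))})

/-- The (former, v3) held stub, now DERIVED: summed interior coercivity on the Nash class. -/
def Stmt.interiorCoercivity : Prop :=
  ∀ η : ℝ, 0 < η → ∃ c : ℝ, 0 < c ∧ ∃ C : ℝ, ∀ (N : ℕ) (x : Fin N → EuclideanSpace ℝ (Fin 3)),
      (∀ i j : Fin N, i ≠ j → 1 / 3 ≤ dist (x i) (x j)) →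
      (∀ (i : Fin N) (y : EuclideanSpace ℝ (Fin 3)), (∀ j : Fin N, j ≠ i → y ≠ x j) → siteEnergy lennardJones x i ≤ ∑ j ∈ Finset.univ.erase i, lennardJones (dist y (x j))) →
      (∀ i : Fin N, ∑ j ∈ Finset.univ.erase i, (deriv lennardJones (dist (x i) (x j)) / dist (x i) (x j)) • (x i - x j) = 0) →
      ∀ Ω : Finset (Fin N), (∀ i ∈ Ω, IsTwoShellGood (1 / 20) (47 / 50) 1 x i) →
      (∀ i ∈ Ω, (∀ k : Fin N, dist (x k) (x i) ≤ 8 → k ∈ Ω) →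
        (∃ (A : EuclideanSpace ℝ (Fin 3) →ₗᵢ[ℝ] EuclideanSpace ℝ (Fin 3)) (a h : ℝ) (s : ℤ → ℤ), 47 / 50 ≤ a ∧ a ≤ 1 ∧ 39 / 50 * a ≤ h ∧ h ≤ 17 / 20 * a ∧ IsHaggSeq s ∧ (fun S : Set (EuclideanSpace ℝ (Fin 3)) => (∀ j : Fin N, dist (x j) (x i) ≤ 2 → ∃ p ∈ S, dist (x j) p ≤ 2 / 5) ∧ (∀ p ∈ S, dist p (x i) ≤ 2 → ∃ j : Fin N, dist (x j) p ≤ 2 / 5)) {p | ∃ m u v : ℤ, p = x i + A (((u : ℝ) • triangularVec₁ a) + ((v : ℝ) • triangularVec₂ a) + ((haggLabel s m : ℝ) • barlowOffset a) + ((m : ℝ) • layerNormal h))})) →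
        c * (Nat.card {i : Fin N // i ∈ Ω ∧ ((∀ k : Fin N, dist (x k) (x i) ≤ 8 → k ∈ Ω) ∧ ¬ (∃ (A : EuclideanSpace ℝ (Fin 3) →ₗᵢ[ℝ] EuclideanSpace ℝ (Fin 3)) (t : EuclideanSpace ℝ (Fin 3)) (a : ℝ) (s : ℤ → ℤ) (z : ℤ → ℝ), 47 / 50 ≤ a ∧ a ≤ 1 ∧ IsHaggSeq s ∧ (∀ m : ℤ, 39 / 50 * a ≤ z (m + 1) - z m ∧ z (m + 1) - z m ≤ 17 / 20 * a) ∧ (fun S : Set (EuclideanSpace ℝ (Fin 3)) => (∀ j : Fin N, dist (x j) (x i) ≤ 2 → ∃ p ∈ S, dist (x j + t) p ≤ η) ∧ (∀ p ∈ S, dist p (x i + t) ≤ 2 → ∃ j : Fin N, dist (x j + t) p ≤ η)) {p | ∃ m i j : ℤ, p = A (((i : ℝ) • triangularVec₁ a) + ((j : ℝ) • triangularVec₂ a) + ((haggLabel s m : ℝ) • barlowOffset a) + (z m • layerNormal 1))}))} : ℝ) ≤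
          (∑ i ∈ Ω, (1 / 2 : ℝ) * (∑ j ∈ Ω.erase i, lennardJones (dist (x i) (x j)))) - (Ω.card : ℝ) * (⨅ Q : PeriodicConfiguration 3, Q.energyPerParticle lennardJones) + C * (Nat.card {i : Fin N // i ∈ Ω ∧ ∃ j : Fin N, j ∉ Ω ∧ dist (x j) (x i) ≤ 4} : ℝ)

/-! ## Helpers for the composition (all proved) -/

section Helpers

variable {N : ℕ}

/-- `V_LJ(r) ≥ −r⁻⁶/6`. -/
theorem lennardJones_ge_neg (r : ℝ) : -(1 / 6 * r⁻¹ ^ 6) ≤ lennardJones r := by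
  unfold lennardJones
  have h : (0 : ℝ) ≤ 1 / 12 * r⁻¹ ^ 12 := by positivity
  linarith

/-- Ball count under `1/3`-separation: at most `(6ρ+1)³` particles within `ρ` of a particle. -/
theorem card_filter_dist_le (x : Fin N → EuclideanSpace ℝ (Fin 3))
    (hsep : ∀ i j : Fin N, i ≠ j → 1 / 3 ≤ dist (x i) (x j)) (Ω : Finset (Fin N)) (i₀ : Fin N)
    {ρ : ℝ} (hρ : 0 ≤ ρ) :
    ((Ω.filter fun i : Fin N => dist (x i) (x i₀) ≤ ρ).card : ℝ) ≤ (6 * ρ + 1) ^ 3 := by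
  classical
  have h := Summit.AtomisticToContinuum.Crystallization.Theorems.PrestressSplitKorn.squeeze_card_filter_dist_le
    (by norm_num : (0 : ℝ) < 1 / 3) hρ hsep i₀
  have hsub : (Ω.filter fun i : Fin N => dist (x i) (x i₀) ≤ ρ) ⊆
      Finset.univ.filter fun i : Fin N => dist (x i₀) (x i) ≤ ρ := by
    intro i hi
    rw [Finset.mem_filter] at hi ⊢
    exact ⟨Finset.mem_univ _, by rw [dist_comm]; exact hi.2⟩
  have h1 : ((Ω.filter fun i : Fin N => dist (x i) (x i₀) ≤ ρ).card : ℝ) ≤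
      ((Finset.univ.filter fun i : Fin N => dist (x i₀) (x i) ≤ ρ).card : ℝ) := by
    exact_mod_cast Finset.card_le_card hsub
  have h2 : (2 * ρ / (1 / 3) + 1) ^ 3 = (6 * ρ + 1) ^ 3 := by ring
  linarith [h2 ▸ h]

/-- Neighbourhood count: the particles of `Ω` within `ρ` of SOME particle of `R` number at most `(6ρ+1)³·#R`. -/
theorem card_filter_near_le (x : Fin N → EuclideanSpace ℝ (Fin 3))
    (hsep : ∀ i j : Fin N, i ≠ j → 1 / 3 ≤ dist (x i) (x j)) (Ω R : Finset (Fin N)) {ρ : ℝ} (hρ : 0 ≤ ρ) :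
    ((Ω.filter fun i : Fin N => ∃ k ∈ R, dist (x i) (x k) ≤ ρ).card : ℝ) ≤ (6 * ρ + 1) ^ 3 * (R.card : ℝ) := by
  classical
  have hsub : (Ω.filter fun i : Fin N => ∃ k ∈ R, dist (x i) (x k) ≤ ρ) ⊆
      R.biUnion fun k => Ω.filter fun i : Fin N => dist (x i) (x k) ≤ ρ := by
    intro i hi
    rw [Finset.mem_filter] at hi
    obtain ⟨k, hk, hd⟩ := hi.2
    rw [Finset.mem_biUnion]
    exact ⟨k, hk, Finset.mem_filter.2 ⟨hi.1, hd⟩⟩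
  have h1 : ((Ω.filter fun i : Fin N => ∃ k ∈ R, dist (x i) (x k) ≤ ρ).card : ℝ) ≤
      ((R.biUnion fun k => Ω.filter fun i : Fin N => dist (x i) (x k) ≤ ρ).card : ℝ) := by
    exact_mod_cast Finset.card_le_card hsub
  have h2 : ((R.biUnion fun k => Ω.filter fun i : Fin N => dist (x i) (x k) ≤ ρ).card : ℝ) ≤
      ∑ k ∈ R, ((Ω.filter fun i : Fin N => dist (x i) (x k) ≤ ρ).card : ℝ) := by
    exact_mod_cast Finset.card_biUnion_le
  have h3 : ∑ k ∈ R, ((Ω.filter fun i : Fin N => dist (x i) (x k) ≤ ρ).card : ℝ) ≤ ∑ _k ∈ R, (6 * ρ + 1) ^ 3 :=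
    Finset.sum_le_sum fun k _ => card_filter_dist_le x hsep Ω k hρ
  rw [Finset.sum_const, nsmul_eq_mul] at h3
  linarith

/-- **Sub-cluster excess.**  Removing a set of particles from a `1/3`-separated cluster raises the bulk excess
`E(x|_Ω) − |Ω|·e*` by at most `(250·3⁶/6)` per removed particle: the removed part has `E ≥ |·| e*`
(periodisation floor) and the cross interaction is `≥ −Σ r⁻⁶/6 ≥ −(250·3⁶/6)·#removed` (flux envelope). -/
theorem subcluster_excess_le (x : Fin N → EuclideanSpace ℝ (Fin 3))
    (hsep : ∀ i j : Fin N, i ≠ j → 1 / 3 ≤ dist (x i) (x j)) (Ω : Finset (Fin N))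
    (p : Fin N → Prop) [DecidablePred p] :
    (∑ i ∈ Ω.filter p, (1 / 2 : ℝ) * (∑ j ∈ (Ω.filter p).erase i, lennardJones (dist (x i) (x j)))) -
        ((Ω.filter p).card : ℝ) * (⨅ Q : PeriodicConfiguration 3, Q.energyPerParticle lennardJones) ≤
      (∑ i ∈ Ω, (1 / 2 : ℝ) * (∑ j ∈ Ω.erase i, lennardJones (dist (x i) (x j)))) -
        (Ω.card : ℝ) * (⨅ Q : PeriodicConfiguration 3, Q.energyPerParticle lennardJones) +
      250 * (1 / 3 : ℝ)⁻¹ ^ 6 / 6 * ((Ω.filter fun i => ¬ p i).card : ℝ) := by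
  classical
  set A := Ω.filter p with hA
  set B := Ω.filter fun i => ¬ p i with hB
  have hδ : (0 : ℝ) < 1 / 3 := by norm_num
  have hAB : Disjoint A B := Finset.disjoint_filter_filter_not Ω Ω p
  have hBA : Disjoint B A := hAB.symm
  -- split the outer sum
  have hsplit : (∑ i ∈ Ω, (1 / 2 : ℝ) * (∑ j ∈ Ω.erase i, lennardJones (dist (x i) (x j)))) =
      (∑ i ∈ A, (1 / 2 : ℝ) * (∑ j ∈ Ω.erase i, lennardJones (dist (x i) (x j)))) +
        ∑ i ∈ B, (1 / 2 : ℝ) * (∑ j ∈ Ω.erase i, lennardJones (dist (x i) (x j))) :=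
    (Finset.sum_filter_add_sum_filter_not Ω p _).symm
  -- inner sums: for `i ∈ A`, `Ω.erase i = A.erase i ∪ B`; for `i ∈ B`, `Ω.erase i = B.erase i ∪ A`
  have heraseA : ∀ i ∈ A, Ω.erase i = A.erase i ∪ B := by
    intro i hi
    have hpi : p i := (Finset.mem_filter.1 hi).2
    ext j
    simp only [hA, hB, Finset.mem_erase, Finset.mem_union, Finset.mem_filter]
    constructor
    · rintro ⟨hji, hj⟩
      by_cases hpj : p j
      · exact Or.inl ⟨hji, hj, hpj⟩
      · exact Or.inr ⟨hj, hpj⟩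
    · rintro (⟨hji, hj, -⟩ | ⟨hj, hpj⟩)
      · exact ⟨hji, hj⟩
      · exact ⟨fun h => hpj (h ▸ hpi), hj⟩
  have heraseB : ∀ i ∈ B, Ω.erase i = B.erase i ∪ A := by
    intro i hi
    have hpi : ¬ p i := (Finset.mem_filter.1 hi).2
    ext j
    simp only [hA, hB, Finset.mem_erase, Finset.mem_union, Finset.mem_filter]
    constructor
    · rintro ⟨hji, hj⟩
      by_cases hpj : p j
      · exact Or.inr ⟨hj, hpj⟩
      · exact Or.inl ⟨hji, hj, hpj⟩
    · rintro (⟨hji, hj, -⟩ | ⟨hj, hpj⟩)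
      · exact ⟨hji, hj⟩
      · exact ⟨fun h => hpi (h ▸ hpj), hj⟩
  have hsumA : (∑ i ∈ A, (1 / 2 : ℝ) * (∑ j ∈ Ω.erase i, lennardJones (dist (x i) (x j)))) =
      (∑ i ∈ A, (1 / 2 : ℝ) * (∑ j ∈ A.erase i, lennardJones (dist (x i) (x j)))) +
        (1 / 2 : ℝ) * ∑ i ∈ A, ∑ j ∈ B, lennardJones (dist (x i) (x j)) := by
    rw [Finset.mul_sum, ← Finset.sum_add_distrib]
    refine Finset.sum_congr rfl fun i hi => ?_
    rw [heraseA i hi, Finset.sum_union ((Finset.disjoint_of_subset_left (Finset.erase_subset _ _)) hAB)]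
    ring
  have hsumB : (∑ i ∈ B, (1 / 2 : ℝ) * (∑ j ∈ Ω.erase i, lennardJones (dist (x i) (x j)))) =
      (∑ i ∈ B, (1 / 2 : ℝ) * (∑ j ∈ B.erase i, lennardJones (dist (x i) (x j)))) +
        (1 / 2 : ℝ) * ∑ i ∈ B, ∑ j ∈ A, lennardJones (dist (x i) (x j)) := by
    rw [Finset.mul_sum, ← Finset.sum_add_distrib]
    refine Finset.sum_congr rfl fun i hi => ?_
    rw [heraseB i hi, Finset.sum_union ((Finset.disjoint_of_subset_left (Finset.erase_subset _ _)) hBA)]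
    ring
  -- the cross terms are `≥ −(1/6)·Σ r⁻⁶ ≥ −(250·3⁶/6)·#B`
  have hcross1 : -(250 * (1 / 3 : ℝ)⁻¹ ^ 6 / 6 * (B.card : ℝ)) ≤ ∑ i ∈ A, ∑ j ∈ B, lennardJones (dist (x i) (x j)) := by
    have h1 : ∑ i ∈ A, ∑ j ∈ B, -(1 / 6 * (dist (x i) (x j))⁻¹ ^ 6) ≤ ∑ i ∈ A, ∑ j ∈ B, lennardJones (dist (x i) (x j)) :=
      Finset.sum_le_sum fun i _ => Finset.sum_le_sum fun j _ => lennardJones_ge_neg _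
    have h2 : ∑ i ∈ A, ∑ j ∈ B, -(1 / 6 * (dist (x i) (x j))⁻¹ ^ 6) =
        -(1 / 6) * ∑ i ∈ A, ∑ j ∈ B, (dist (x i) (x j))⁻¹ ^ 6 := by
      rw [Finset.mul_sum]
      refine Finset.sum_congr rfl fun i _ => ?_
      rw [Finset.mul_sum]
      refine Finset.sum_congr rfl fun j _ => by ring
    have h3 := stub_fluxEnvelope N x (1 / 3) hδ hsep A B hAB
    rw [h2] at h1
    nlinarith
  have hcross2 : -(250 * (1 / 3 : ℝ)⁻¹ ^ 6 / 6 * (B.card : ℝ)) ≤ ∑ i ∈ B, ∑ j ∈ A, lennardJones (dist (x i) (x j)) := by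
    rw [Finset.sum_comm]
    have heq : ∑ j ∈ A, ∑ i ∈ B, lennardJones (dist (x i) (x j)) = ∑ i ∈ A, ∑ j ∈ B, lennardJones (dist (x i) (x j)) :=
      Finset.sum_congr rfl fun i _ => Finset.sum_congr rfl fun j _ => by rw [dist_comm]
    rw [heq]
    exact hcross1
  -- the removed part is floored by periodisation
  have hBfloor := pureNearField_self_floor x hδ hsep B
  have hcard : (A.card : ℝ) + (B.card : ℝ) = (Ω.card : ℝ) := by
    exact_mod_cast Finset.card_filter_add_card_filter_not p
  rw [hsplit, hsumA, hsumB]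
  set E := (⨅ Q : PeriodicConfiguration 3, Q.energyPerParticle lennardJones) with hE
  have hce : (Ω.card : ℝ) * E = (A.card : ℝ) * E + (B.card : ℝ) * E := by rw [← hcard]; ring
  linarith [hcross1, hcross2, hBfloor, hce]

end Helpers

/-- Layeredness is monotone in the tolerance (inline predicate of the crux). -/
theorem layered_mono {N : ℕ} (x : Fin N → EuclideanSpace ℝ (Fin 3)) (i : Fin N) {η η' : ℝ} (hle : η' ≤ η)
    (h : (∃ (A : EuclideanSpace ℝ (Fin 3) →ₗᵢ[ℝ] EuclideanSpace ℝ (Fin 3)) (t : EuclideanSpace ℝ (Fin 3)) (a : ℝ) (s : ℤ → ℤ) (z : ℤ → ℝ), 47 / 50 ≤ a ∧ a ≤ 1 ∧ IsHaggSeq s ∧ (∀ m : ℤ, 39 / 50 * a ≤ z (m + 1) - z m ∧ z (m + 1) - z m ≤ 17 / 20 * a) ∧ (fun S : Set (EuclideanSpace ℝ (Fin 3)) => (∀ j : Fin N, dist (x j) (x i) ≤ 2 → ∃ p ∈ S, dist (x j + t) p ≤ η') ∧ (∀ p ∈ S, dist p (x i + t) ≤ 2 → ∃ j : Fin N, dist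 (x j + t) p ≤ η')) {p | ∃ m i j : ℤ, p = A (((i : ℝ) • triangularVec₁ a) + ((j : ℝ) • triangularVec₂ a) + ((haggLabel s m : ℝ) • barlowOffset a) + (z m • layerNormal 1))})) : (∃ (A : EuclideanSpace ℝ (Fin 3) →ₗᵢ[ℝ] EuclideanSpace ℝ (Fin 3)) (t : EuclideanSpace ℝ (Fin 3)) (a : ℝ) (s : ℤ → ℤ) (z : ℤ → ℝ), 47 / 50 ≤ a ∧ a ≤ 1 ∧ IsHaggSeq s ∧ (∀ m : ℤ, 39 / 50 * a ≤ z (m + 1) - z m ∧ z (m + 1) - z m ≤ 17 / 20 * a) ∧ (fun S : Set (EuclideanSpace ℝ (Fin 3)) => (∀ j : Fin N, dist (x j) (x i) ≤ 2 → ∃ p ∈ S, dist (x j + t) p ≤ η) ∧ (∀ p ∈ S, dist p (x i + t) ≤ 2 → ∃ j : Fin N, dist (x j + t) p ≤ η)) {p | ∃ m i j : ℤ, p = A (((i : ℝ) • triangularVec₁ a) + ((j : ℝ) • triangularVec₂ a) + ((haggLabel s m : ℝ) • barlowOffset a) + (z m • layerNormal 1))}) := by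
  obtain ⟨A, t, a, s, z, ha₁, ha₂, hs, hz, h₁, h₂⟩ := h
  refine ⟨A, t, a, s, z, ha₁, ha₂, hs, hz, fun j hj => ?_, fun p hp hd => ?_⟩
  · obtain ⟨p, hp, hd⟩ := h₁ j hj
    exact ⟨p, hp, hd.trans hle⟩
  · obtain ⟨j, hj⟩ := h₂ p hp hd
    exact ⟨j, hj.trans hle⟩

/-- Far-from-family is antitone in the threshold. -/
theorem famfar_anti (s : ℤ → ℤ) (G : (EuclideanSpace ℝ (Fin 3) →L[ℝ] EuclideanSpace ℝ (Fin 3))) {r r' : ℝ} (hle : r' ≤ r)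
    (h : (∀ (A : EuclideanSpace ℝ (Fin 3) →ₗᵢ[ℝ] EuclideanSpace ℝ (Fin 3)) (a h : ℝ), 47 / 50 ≤ a → a ≤ 1 → 39 / 50 * a ≤ h → h ≤ 17 / 20 * a → ∃ m u v : ℤ, ‖barlowPos 1 (Real.sqrt 6 / 3) s m u v‖ ≤ 3 ∧ r ≤ dist (G (barlowPos 1 (Real.sqrt 6 / 3) s m u v)) (A (barlowPos a h s m u v)))) : (∀ (A : EuclideanSpace ℝ (Fin 3) →ₗᵢ[ℝ] EuclideanSpace ℝ (Fin 3)) (a h : ℝ), 47 / 50 ≤ a → a ≤ 1 → 39 / 50 * a ≤ h → h ≤ 17 / 20 * a → ∃ m u v : ℤ, ‖barlowPos 1 (Real.sqrt 6 / 3) s m u v‖ ≤ 3 ∧ r' ≤ dist (G (barlowPos 1 (Real.sqrt 6 / 3) s m u v)) (A (barlowPos a h s m u v))) := by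
  intro A a hh ha₁ ha₂ hh₁ hh₂
  obtain ⟨m, u, v, hn, hd⟩ := h A a hh ha₁ ha₂ hh₁ hh₂
  exact ⟨m, u, v, hn, hle.trans hd⟩


/-- **COMPOSITION (v10, lead c1): C′ + I_flat + II_band (+ radius-3 charts) ⟹ the summed interior coercivity.**
Constants: `η' = min η (1/10)`; `ε₁, K, C_I` from I, `K₂, C_II` from II at `ε₁`; rough set `R = {i ∈ Ω : ¬ε₁-good}` (`#R ≤ K₂X + |C_II|#∂₄Ω`),
`ε₁`-good sub-cluster `Ω' = Ω ∖ R`, I on `Ω'`; a non-`η'`-layered radius-8 interior site of `Ω` is rough, or within `8` of a rough site, or a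
radius-8 interior site of `Ω'` with `ν_i > η'/2` or `r_i > η'/2` — for otherwise C′ makes `G_i` `(η' − ν_i ≥ η'/2)`-far from EVERY box cell,
including its own `(A_i, a_i, h_i)` which is `r_i ≤ η'/2`-close; Chebyshev: `200η'²·#bad ≤ Σ(2400ν² + 800r²)`.  With
`L = K·K₁ + |C_I|K₄ + 200η'²(1+K₈)`, `D = K + L·K₂ + 1`: `c = 200η'²/D`, `C = (L|C_II| + |C_I|)/D`. -/
theorem interiorCoercivity_of_v10 (hC : Stmt.cprime) (hI : Stmt.iflatNash) (hII : Stmt.iibandNash) (h3 : Stmt.chart3) :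
    Stmt.interiorCoercivity := by
  intro η hη
  obtain ⟨ε₁, hε₁, hε₁', K, hK, CI, hIall⟩ := hI
  obtain ⟨K2, hK2, CII, hIIall⟩ := hII ε₁ hε₁ hε₁'
  -- the small tolerance and the constants
  set η' : ℝ := min η (1 / 10) with hη'def
  have hη'pos : 0 < η' := lt_min hη (by norm_num)
  have hη'le : η' ≤ 1 / 10 := min_le_right _ _
  have hη'leη : η' ≤ η := min_le_left _ _
  set K₁ : ℝ := 250 * (1 / 3 : ℝ)⁻¹ ^ 6 / 6 with hK₁
  set K₄ : ℝ := (6 * 4 + 1) ^ 3 with hK₄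
  set K₈ : ℝ := (6 * 8 + 1) ^ 3 with hK₈
  set L : ℝ := K * K₁ + |CI| * K₄ + 200 * η' ^ 2 * (1 + K₈) with hLdef
  have hLpos : 0 ≤ L := by
    have : 0 ≤ K₁ := by rw [hK₁]; positivity
    have : 0 ≤ K₄ := by rw [hK₄]; positivity
    have : 0 ≤ K₈ := by rw [hK₈]; positivity
    rw [hLdef]; positivity
  set D : ℝ := K + L * K2 + 1 with hDdef
  have hDpos : 0 < D := by rw [hDdef]; positivity
  set Mtot : ℝ := L * |CII| + |CI| with hMtot
  refine ⟨200 * η' ^ 2 / D, by positivity, Mtot / D, ?_⟩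
  intro N x hsep hNash hFB Ω hΩ _hchart
  classical
  -- II: the non-`ε₁`-good particles of `Ω`
  have hIIapp := hIIall N x hsep hNash hFB Ω hΩ (h3 N x Ω hΩ)
  -- the rough set and the `ε₁`-good sub-cluster
  set R : Finset (Fin N) := Ω.filter (fun i => ¬ IsTwoShellGood ε₁ (47 / 50) 1 x i) with hRdef
  set Ω' : Finset (Fin N) := Ω.filter (fun i => IsTwoShellGood ε₁ (47 / 50) 1 x i) with hΩ'def
  have hΩ'sub : Ω' ⊆ Ω := Finset.filter_subset _ _
  have hΩ'good : ∀ i ∈ Ω', IsTwoShellGood ε₁ (47 / 50) 1 x i := fun i hi => (Finset.mem_filter.1 hi).2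
  -- I on the sub-cluster
  obtain ⟨sW, Gw, νw, rw, Aw, aw, hw, hwit, hsum⟩ := hIall N x hsep hNash hFB Ω' hΩ'good
  -- counts as filter cardinalities
  simp only [lc_natCard_eq] at hIIapp hsum ⊢
  -- the finite sets of the bookkeeping
  set NL : Finset (Fin N) := Ω.filter (fun i : Fin N => (∀ k : Fin N, dist (x k) (x i) ≤ 8 → k ∈ Ω) ∧ ¬ (∃ (A : EuclideanSpace ℝ (Fin 3) →ₗᵢ[ℝ] EuclideanSpace ℝ (Fin 3)) (t : EuclideanSpace ℝ (Fin 3)) (a : ℝ) (s : ℤ → ℤ) (z : ℤ → ℝ), 47 / 50 ≤ a ∧ a ≤ 1 ∧ IsHaggSeq s ∧ (∀ m : ℤ, 39 / 50 * a ≤ z (m + 1) - z m ∧ z (m + 1) - z m ≤ 17 / 20 * a) ∧ (fun S : Set (EuclideanSpace ℝ (Fin 3)) => (∀ j : Fin N, dist (x j) (x i) ≤ 2 → ∃ p ∈ S, dist (x j + t) p ≤ η) ∧ (∀ p ∈ S, dist p (x i + t) ≤ 2 → ∃ j : Fin N, dist (x j + t) p ≤ η)) {p | ∃ m i j : ℤ,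 p = A (((i : ℝ) • triangularVec₁ a) + ((j : ℝ) • triangularVec₂ a) + ((haggLabel s m : ℝ) • barlowOffset a) + (z m • layerNormal 1))})) with hNLdef
  set NL' : Finset (Fin N) := Ω.filter (fun i : Fin N => (∀ k : Fin N, dist (x k) (x i) ≤ 8 → k ∈ Ω) ∧ ¬ (∃ (A : EuclideanSpace ℝ (Fin 3) →ₗᵢ[ℝ] EuclideanSpace ℝ (Fin 3)) (t : EuclideanSpace ℝ (Fin 3)) (a : ℝ) (s : ℤ → ℤ) (z : ℤ → ℝ), 47 / 50 ≤ a ∧ a ≤ 1 ∧ IsHaggSeq s ∧ (∀ m : ℤ, 39 / 50 * a ≤ z (m + 1) - z m ∧ z (m + 1) - z m ≤ 17 / 20 * a) ∧ (fun S : Set (EuclideanSpace ℝ (Fin 3)) => (∀ j : Fin N, dist (x j) (x i) ≤ 2 → ∃ p ∈ S, dist (x j + t) p ≤ η') ∧ (∀ p ∈ S, dist p (x i + t) ≤ 2 → ∃ j : Fin N, dist (x j + t) p ≤ η')) {p | ∃ m i j : ℤ, p = A (((i : ℝ) • triangularVec₁ a) + ((j : ℝ) • triangularVec₂ a) + ((haggLabel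 s m : ℝ) • barlowOffset a) + (z m • layerNormal 1))})) with hNL'def
  set I8' : Finset (Fin N) := Ω'.filter (fun i : Fin N => (∀ k : Fin N, dist (x k) (x i) ≤ 8 → k ∈ Ω')) with hI8'def
  set BAD : Finset (Fin N) := I8'.filter (fun i : Fin N => η' / 2 < νw i ∨ η' / 2 < rw i) with hBADdef
  set NR8 : Finset (Fin N) := Ω.filter (fun i : Fin N => ∃ k ∈ R, dist (x i) (x k) ≤ 8) with hNR8def
  set NR4 : Finset (Fin N) := Ω.filter (fun i : Fin N => ∃ k ∈ R, dist (x i) (x k) ≤ 4) with hNR4def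
  set B4 : Finset (Fin N) := (Ω.filter fun i : Fin N => ∃ j : Fin N, j ∉ Ω ∧ dist (x j) (x i) ≤ 4) with hB4def
  set B4' : Finset (Fin N) := (Ω'.filter fun i : Fin N => ∃ j : Fin N, j ∉ Ω' ∧ dist (x j) (x i) ≤ 4) with hB4'def
  -- (F1) monotonicity in the tolerance
  have hF1 : (NL.card : ℝ) ≤ (NL'.card : ℝ) := by
    have hsub : NL ⊆ NL' := by
      intro i hi
      rw [hNLdef, Finset.mem_filter] at hi
      rw [hNL'def, Finset.mem_filter]
      exact ⟨hi.1, hi.2.1, fun h => hi.2.2 (layered_mono x i hη'leη h)⟩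
    exact_mod_cast Finset.card_le_card hsub
  -- (F2) covering of the non-layered interior sites
  have hF2 : (NL'.card : ℝ) ≤ (BAD.card : ℝ) + (R.card : ℝ) + (NR8.card : ℝ) := by
    have hsub : NL' ⊆ BAD ∪ R ∪ NR8 := by
      intro i hi
      rw [hNL'def, Finset.mem_filter] at hi
      obtain ⟨hiΩ, h8, hnl⟩ := hi
      rw [Finset.mem_union, Finset.mem_union]
      by_cases hiR : i ∈ R
      · exact Or.inl (Or.inr hiR)
      · have hgi : IsTwoShellGood ε₁ (47 / 50) 1 x i := by
          by_contra hno
          exact hiR (by rw [hRdef, Finset.mem_filter]; exact ⟨hiΩ, hno⟩)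
        have hiΩ' : i ∈ Ω' := by
          rw [hΩ'def, Finset.mem_filter]; exact ⟨hiΩ, hgi⟩
        by_cases h8' : ∀ k : Fin N, dist (x k) (x i) ≤ 8 → k ∈ Ω'
        · -- radius-8 interior site of `Ω'`: bad, by C′ against its own box cell
          have hiI : i ∈ I8' := by rw [hI8'def, Finset.mem_filter]; exact ⟨hiΩ', h8'⟩
          obtain ⟨hs, h0, hflat, ha1, ha2, hh1, hh2, hclose⟩ := hwit i hiΩ' h8'
          refine Or.inl (Or.inl ?_)
          rw [hBADdef, Finset.mem_filter]
          refine ⟨hiI, ?_⟩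
          by_contra hno
          push Not at hno
          obtain ⟨hν, hr⟩ := hno
          have hfar := hC N x i (sW i) (Gw i) (νw i) η' hs h0 (by linarith) hη'le hflat hnl
          obtain ⟨m, u, v, hn, hd⟩ := hfar (Aw i) (aw i) (hw i) ha1 ha2 hh1 hh2
          have hlt := hclose m u v hn
          linarith
        · -- within `8` of a rough site
          push Not at h8'
          obtain ⟨k, hk, hkΩ'⟩ := h8'
          have hkΩ : k ∈ Ω := h8 k hk
          have hkR : k ∈ R := by
            rw [hRdef, Finset.mem_filter]
            refine ⟨hkΩ, ?_⟩
            intro hgk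
            exact hkΩ' (by rw [hΩ'def, Finset.mem_filter]; exact ⟨hkΩ, hgk⟩)
          exact Or.inr (by rw [hNR8def, Finset.mem_filter]; exact ⟨hiΩ, k, hkR, by rw [dist_comm]; exact hk⟩)
    calc (NL'.card : ℝ) ≤ ((BAD ∪ R ∪ NR8).card : ℝ) := by exact_mod_cast Finset.card_le_card hsub
      _ ≤ ((BAD ∪ R).card : ℝ) + (NR8.card : ℝ) := by exact_mod_cast Finset.card_union_le _ _
      _ ≤ (BAD.card : ℝ) + (R.card : ℝ) + (NR8.card : ℝ) := by
          have := Finset.card_union_le BAD R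
          linarith [show ((BAD ∪ R).card : ℝ) ≤ BAD.card + R.card by exact_mod_cast this]
  -- (F3), (F4) neighbourhood counts
  have hF3 : (NR8.card : ℝ) ≤ K₈ * (R.card : ℝ) := by
    have := card_filter_near_le x hsep Ω R (by norm_num : (0 : ℝ) ≤ 8)
    rw [hK₈]; norm_num at this ⊢; exact this
  have hF4 : (NR4.card : ℝ) ≤ K₄ * (R.card : ℝ) := by
    have := card_filter_near_le x hsep Ω R (by norm_num : (0 : ℝ) ≤ 4)
    rw [hK₄]; norm_num at this ⊢; exact this
  -- (F5) Chebyshev on the bad sites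
  have hF5 : 200 * η' ^ 2 * (BAD.card : ℝ) ≤ ∑ i ∈ I8', (2400 * (νw i) ^ 2 + 800 * (rw i) ^ 2) := by
    have h1 : ∑ i ∈ BAD, (2400 * (νw i) ^ 2 + 800 * (rw i) ^ 2) ≤ ∑ i ∈ I8', (2400 * (νw i) ^ 2 + 800 * (rw i) ^ 2) :=
      Finset.sum_le_sum_of_subset_of_nonneg (Finset.filter_subset _ _) (fun i _ _ => by positivity)
    have h2 : ∑ _i ∈ BAD, 200 * η' ^ 2 ≤ ∑ i ∈ BAD, (2400 * (νw i) ^ 2 + 800 * (rw i) ^ 2) := by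
      refine Finset.sum_le_sum fun i hi => ?_
      rw [hBADdef, Finset.mem_filter] at hi
      rcases hi.2 with hν | hr
      · nlinarith [sq_nonneg (rw i), sq_nonneg (νw i - η' / 2)]
      · nlinarith [sq_nonneg (νw i), sq_nonneg (rw i - η' / 2)]
    rw [Finset.sum_const, nsmul_eq_mul] at h2
    linarith
  -- (F6) the sub-cluster excess
  have hF6 : (∑ i ∈ Ω', (1 / 2 : ℝ) * (∑ j ∈ Ω'.erase i, lennardJones (dist (x i) (x j)))) - (Ω'.card : ℝ) * (⨅ Q : PeriodicConfiguration 3, Q.energyPerParticle lennardJones) ≤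
      (∑ i ∈ Ω, (1 / 2 : ℝ) * (∑ j ∈ Ω.erase i, lennardJones (dist (x i) (x j)))) - (Ω.card : ℝ) * (⨅ Q : PeriodicConfiguration 3, Q.energyPerParticle lennardJones) + K₁ * (R.card : ℝ) := by
    have h := subcluster_excess_le x hsep Ω (fun i : Fin N => IsTwoShellGood ε₁ (47 / 50) 1 x i)
    rw [hK₁]
    exact h
  -- (F9) the boundary of the sub-cluster
  have hF9 : (B4'.card : ℝ) ≤ (B4.card : ℝ) + (NR4.card : ℝ) := by
    have hsub : B4' ⊆ B4 ∪ NR4 := by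
      intro i hi
      rw [hB4'def, Finset.mem_filter] at hi
      obtain ⟨hiΩ', j, hjΩ', hd⟩ := hi
      rw [Finset.mem_union]
      by_cases hjΩ : j ∈ Ω
      · refine Or.inr (by
          rw [hNR4def, Finset.mem_filter]
          refine ⟨hΩ'sub hiΩ', j, ?_, by rw [dist_comm]; exact hd⟩
          rw [hRdef, Finset.mem_filter]
          refine ⟨hjΩ, ?_⟩
          intro hgj
          exact hjΩ' (by rw [hΩ'def, Finset.mem_filter]; exact ⟨hjΩ, hgj⟩))
      · exact Or.inl (by rw [hB4def, Finset.mem_filter]; exact ⟨hΩ'sub hiΩ', j, hjΩ, hd⟩)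
    calc (B4'.card : ℝ) ≤ ((B4 ∪ NR4).card : ℝ) := by exact_mod_cast Finset.card_le_card hsub
      _ ≤ (B4.card : ℝ) + (NR4.card : ℝ) := by exact_mod_cast Finset.card_union_le _ _
  -- (F10) the bulk excess is nonnegative
  have hXpos : (0 : ℝ) ≤ (∑ i ∈ Ω, (1 / 2 : ℝ) * (∑ j ∈ Ω.erase i, lennardJones (dist (x i) (x j)))) - (Ω.card : ℝ) * (⨅ Q : PeriodicConfiguration 3, Q.energyPerParticle lennardJones) :=
    pureNearField_self_floor x (by norm_num : (0 : ℝ) < 1 / 3) hsep Ω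
  -- the final linear combination (all products written out as syntactic atoms)
  obtain ⟨X, hXdef⟩ : ∃ X : ℝ, (∑ i ∈ Ω, (1 / 2 : ℝ) * (∑ j ∈ Ω.erase i, lennardJones (dist (x i) (x j)))) - (Ω.card : ℝ) * (⨅ Q : PeriodicConfiguration 3, Q.energyPerParticle lennardJones) = X := ⟨_, rfl⟩
  obtain ⟨XP, hXPdef⟩ : ∃ XP : ℝ, (∑ i ∈ Ω', (1 / 2 : ℝ) * (∑ j ∈ Ω'.erase i, lennardJones (dist (x i) (x j)))) - (Ω'.card : ℝ) * (⨅ Q : PeriodicConfiguration 3, Q.energyPerParticle lennardJones) = XP := ⟨_, rfl⟩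
  obtain ⟨FS, hFSdef⟩ : ∃ FS : ℝ, (∑ i ∈ I8', (2400 * (νw i) ^ 2 + 800 * (rw i) ^ 2)) = FS := ⟨_, rfl⟩
  rw [hXdef] at hIIapp hXpos hF6 ⊢
  rw [hXPdef] at hF6 hsum
  rw [hFSdef] at hsum hF5
  have hB4'pos : (0 : ℝ) ≤ (B4'.card : ℝ) := Nat.cast_nonneg _
  have hB4pos : (0 : ℝ) ≤ (B4.card : ℝ) := Nat.cast_nonneg _
  have hRpos : (0 : ℝ) ≤ (R.card : ℝ) := Nat.cast_nonneg _
  have hNLpos : (0 : ℝ) ≤ (NL.card : ℝ) := Nat.cast_nonneg _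
  -- the rough count, charged to `X + #∂₄Ω`
  have hRle : (R.card : ℝ) ≤ K2 * X + |CII| * (B4.card : ℝ) := by
    have h1 : CII * (B4.card : ℝ) ≤ |CII| * (B4.card : ℝ) := mul_le_mul_of_nonneg_right (le_abs_self CII) hB4pos
    linarith [hIIapp, h1]
  -- the flatness sum, moved back to `Ω`
  have h1 : K * XP ≤ K * X + K * K₁ * (R.card : ℝ) := by
    have h := mul_le_mul_of_nonneg_left hF6 hK
    linear_combination h
  have h2 : CI * (B4'.card : ℝ) ≤ |CI| * (B4.card : ℝ) + |CI| * K₄ * (R.card : ℝ) := by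
    have t1 : CI * (B4'.card : ℝ) ≤ |CI| * (B4'.card : ℝ) := mul_le_mul_of_nonneg_right (le_abs_self CI) hB4'pos
    have hF94 : (B4'.card : ℝ) ≤ (B4.card : ℝ) + K₄ * (R.card : ℝ) := by linarith only [hF9, hF4]
    have t2 := mul_le_mul_of_nonneg_left hF94 (abs_nonneg CI)
    linear_combination t1 + t2
  have h3 : 200 * η' ^ 2 * (BAD.card : ℝ) ≤ K * X + K * K₁ * (R.card : ℝ) + |CI| * (B4.card : ℝ) + |CI| * K₄ * (R.card : ℝ) := by
    linarith only [hF5, hsum, h1, h2]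
  have hη2 : 0 ≤ 200 * η' ^ 2 := by positivity
  have hF123 : (NL.card : ℝ) ≤ (BAD.card : ℝ) + (R.card : ℝ) + K₈ * (R.card : ℝ) := by
    linarith only [hF1, hF2, hF3]
  have h4 : 200 * η' ^ 2 * (NL.card : ℝ) ≤ 200 * η' ^ 2 * (BAD.card : ℝ) + 200 * η' ^ 2 * (1 + K₈) * (R.card : ℝ) := by
    have h := mul_le_mul_of_nonneg_left hF123 hη2
    linear_combination h
  have h5 : 200 * η' ^ 2 * (NL.card : ℝ) ≤ K * X + L * (R.card : ℝ) + |CI| * (B4.card : ℝ) := by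
    rw [hLdef]
    linear_combination h3 + h4
  have h6 : L * (R.card : ℝ) ≤ L * K2 * X + L * |CII| * (B4.card : ℝ) := by
    have h := mul_le_mul_of_nonneg_left hRle hLpos
    linear_combination h
  have final : 200 * η' ^ 2 * (NL.card : ℝ) ≤ D * X + Mtot * (B4.card : ℝ) := by
    rw [hDdef, hMtot]
    linear_combination h5 + h6 + hXpos
  -- divide by `D`
  have hgoal : 200 * η' ^ 2 / D * (NL.card : ℝ) ≤ X + Mtot / D * (B4.card : ℝ) := by
    rw [div_mul_eq_mul_div, div_mul_eq_mul_div, div_le_iff₀ hDpos, add_mul, div_mul_cancel₀ _ hDpos.ne']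
    linarith [final]
  exact hgoal

/-- **The v3 held stub, derived**: `stub_nashInteriorCoercivity` from the three v4 stubs. -/
theorem nashInteriorCoercivity : Stmt.interiorCoercivity :=
  interiorCoercivity_of_v10 stub_offFamilyOfNonLayered stub_nashFlatnessPaid stub_nashRoughSitesPaid
    (chart_of_stubs_radius le_rfl stub_chartCoverage stub_chartCore stub_chartSites)

/-! ## The proved composition -/

/-- `1/3`-separated points are pairwise distinct. -/
theorem distinct_of_sep {N : ℕ} {x : Fin N → EuclideanSpace ℝ (Fin 3)}
    (hsep : ∀ i j : Fin N, i ≠ j → 1 / 3 ≤ dist (x i) (x j)) : ∀ i j : Fin N, i ≠ j → x i ≠ x j := by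
  intro i j hij h
  have := hsep i j hij
  rw [h, dist_self] at this
  norm_num at this

/-- **Glue (proved): the stubs ⟹ NashPNF.**  At a radius-8 interior site of a good `Ω` the chart is supplied by
`chart_of_stubs` on the landed coverage/sites pieces and `stub_chartCore`; force balance is supplied by
`stub_nashForceBalance` from the Nash clause (points are distinct by separation); the interior coercivity then
pays the INTERIOR non-layered count, and the remaining non-layered sites lie in the radius-8 collar
`B₈ = Ω ∖ int₈Ω`, whose size is `≤ (1 + |Cp|(17/4)⁴)·#∂₄Ω` by the landed collar count (`collar8_card_le`) and
pair count at scale `17/4` (`stub_pairCountOfCrossing`).  Constants: `c := c`, `C' := C + c·(1 + |Cp|(17/4)⁴)`. -/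
theorem nashPnf_of_stubs
    (hcore : ∀ (N : ℕ) (x : Fin N → EuclideanSpace ℝ (Fin 3)) (i : Fin N),
      (∀ k : Fin N, dist (x k) (x i) ≤ 3 → IsTwoShellGood (1 / 20) (47 / 50) 1 x k) →
      ∀ (a : ℝ) (A : EuclideanSpace ℝ (Fin 3) →ₗᵢ[ℝ] EuclideanSpace ℝ (Fin 3)) (P : Finset (EuclideanSpace ℝ (Fin 3))) (f : EuclideanSpace ℝ (Fin 3) → Fin N),
        47 / 50 ≤ a → a ≤ 1 → (P = fccTwoShellPattern ∨ P = hcpTwoShellPattern) →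
        (∀ v ∈ P, f v ≠ i ∧ dist (x (f v)) (x i + a • A v) ≤ 1 / 20 * a) → Set.InjOn f ↑P →
        (∀ j : Fin N, j ≠ i → dist (x j) (x i) ≤ 3 / 2 * a → ∃ v ∈ P, f v = j) →
        ∃ (R : EuclideanSpace ℝ (Fin 3) →ₗᵢ[ℝ] EuclideanSpace ℝ (Fin 3)) (s : ℤ → ℤ), IsHaggSeq s ∧
          (∀ v ∈ P, ∃ m u w : ℤ, R (barlowPos 1 (Real.sqrt 6 / 3) s m u w) = v) ∧
          (∀ m u w : ℤ, ‖barlowPos 1 (Real.sqrt 6 / 3) s m u w‖ ≤ 3 / 2 → barlowPos 1 (Real.sqrt 6 / 3) s m u w ≠ 0 → R (barlowPos 1 (Real.sqrt 6 / 3) s m u w) ∈ P) ∧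
          (∀ v ∈ P, ∀ k : Fin N, dist (x k) (x (f v)) ≤ 141 / 100 → dist (x k) (x i) ≤ 2 →
            ∃ m u w : ℤ, dist (x k) (x i + a • A (R (barlowPos 1 (Real.sqrt 6 / 3) s m u w))) ≤ 2 / 5) ∧
          (∀ v ∈ P, ∀ m u w : ℤ, ‖barlowPos 1 (Real.sqrt 6 / 3) s m u w‖ ≤ 43 / 20 → dist (R (barlowPos 1 (Real.sqrt 6 / 3) s m u w)) v ≤ 3 / 2 →
            ∃ k : Fin N, dist (x k) (x i + a • A (R (barlowPos 1 (Real.sqrt 6 / 3) s m u w))) ≤ 2 / 5))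
    (hfb : ∀ (N : ℕ) (x : Fin N → EuclideanSpace ℝ (Fin 3)),
      (∀ i j : Fin N, i ≠ j → x i ≠ x j) →
      (∀ (i : Fin N) (y : EuclideanSpace ℝ (Fin 3)), (∀ j : Fin N, j ≠ i → y ≠ x j) → siteEnergy lennardJones x i ≤ ∑ j ∈ Finset.univ.erase i, lennardJones (dist y (x j))) →
      ∀ i : Fin N, ∑ j ∈ Finset.univ.erase i,
        (deriv lennardJones (dist (x i) (x j)) / dist (x i) (x j)) • (x i - x j) = 0)
    (hcoer : ∀ η : ℝ, 0 < η → ∃ c : ℝ, 0 < c ∧ ∃ C : ℝ, ∀ (N : ℕ) (x : Fin N → EuclideanSpace ℝ (Fin 3)),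
      (∀ i j : Fin N, i ≠ j → 1 / 3 ≤ dist (x i) (x j)) →
      (∀ (i : Fin N) (y : EuclideanSpace ℝ (Fin 3)), (∀ j : Fin N, j ≠ i → y ≠ x j) → siteEnergy lennardJones x i ≤ ∑ j ∈ Finset.univ.erase i, lennardJones (dist y (x j))) →
      (∀ i : Fin N, ∑ j ∈ Finset.univ.erase i, (deriv lennardJones (dist (x i) (x j)) / dist (x i) (x j)) • (x i - x j) = 0) →
      ∀ Ω : Finset (Fin N), (∀ i ∈ Ω, IsTwoShellGood (1 / 20) (47 / 50) 1 x i) →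
      (∀ i ∈ Ω, (∀ k : Fin N, dist (x k) (x i) ≤ 8 → k ∈ Ω) →
        (∃ (A : EuclideanSpace ℝ (Fin 3) →ₗᵢ[ℝ] EuclideanSpace ℝ (Fin 3)) (a h : ℝ) (s : ℤ → ℤ), 47 / 50 ≤ a ∧ a ≤ 1 ∧ 39 / 50 * a ≤ h ∧ h ≤ 17 / 20 * a ∧ IsHaggSeq s ∧ (fun S : Set (EuclideanSpace ℝ (Fin 3)) => (∀ j : Fin N, dist (x j) (x i) ≤ 2 → ∃ p ∈ S, dist (x j) p ≤ 2 / 5) ∧ (∀ p ∈ S, dist p (x i) ≤ 2 → ∃ j : Fin N, dist (x j) p ≤ 2 / 5)) {p | ∃ m u v : ℤ, p = x i + A (((u : ℝ) • triangularVec₁ a) + ((v : ℝ) • triangularVec₂ a) + ((haggLabel s m : ℝ) • barlowOffset a) + ((m : ℝ) • layerNormal h))})) →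
        c * (Nat.card {i : Fin N // i ∈ Ω ∧ ((∀ k : Fin N, dist (x k) (x i) ≤ 8 → k ∈ Ω) ∧ ¬ (∃ (A : EuclideanSpace ℝ (Fin 3) →ₗᵢ[ℝ] EuclideanSpace ℝ (Fin 3)) (t : EuclideanSpace ℝ (Fin 3)) (a : ℝ) (s : ℤ → ℤ) (z : ℤ → ℝ), 47 / 50 ≤ a ∧ a ≤ 1 ∧ IsHaggSeq s ∧ (∀ m : ℤ, 39 / 50 * a ≤ z (m + 1) - z m ∧ z (m + 1) - z m ≤ 17 / 20 * a) ∧ (fun S : Set (EuclideanSpace ℝ (Fin 3)) => (∀ j : Fin N, dist (x j) (x i) ≤ 2 → ∃ p ∈ S, dist (x j + t) p ≤ η) ∧ (∀ p ∈ S, dist p (x i + t) ≤ 2 → ∃ j : Fin N, dist (x j + t) p ≤ η)) {p | ∃ m i j : ℤ, p = A (((i : ℝ) • triangularVec₁ a) + ((j : ℝ) • triangularVec₂ a) + ((haggLabel s m : ℝ) • barlowOffset a) + (z m • layerNormal 1))}))} : ℝ) ≤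
          (∑ i ∈ Ω, (1 / 2 : ℝ) * (∑ j ∈ Ω.erase i, lennardJones (dist (x i) (x j)))) - (Ω.card : ℝ) * (⨅ Q : PeriodicConfiguration 3, Q.energyPerParticle lennardJones) + C * (Nat.card {i : Fin N // i ∈ Ω ∧ ∃ j : Fin N, j ∉ Ω ∧ dist (x j) (x i) ≤ 4} : ℝ)) :
    Stmt.nashPureNearField := by
  intro η hη
  have hδ : (0 : ℝ) < 1 / 3 := by norm_num
  obtain ⟨c, hc, C, hC⟩ := hcoer η hη
  obtain ⟨Cp, hCp⟩ := stub_pairCountOfCrossing (1 / 3) hδ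
  set K : ℝ := 1 + |Cp| * (17 / 4 : ℝ) ^ 4 with hKdef
  refine ⟨c, hc, C + c * K, ?_⟩
  intro N x hsep hNash Ω hΩ
  have key := hC N x hsep hNash (hfb N x (distinct_of_sep hsep) hNash) Ω hΩ
    (fun i hi h8 => chart_of_stubs stub_chartCoverage hcore stub_chartSites N x Ω hΩ i hi h8)
  have hpair := hCp N x hsep Ω hΩ (17 / 4) (by norm_num)
  classical
  rw [lc_natCard_eq] at key hpair
  rw [lc_natCard_eq, lc_natCard_eq]
  rw [lc_natCard_eq] at key
  -- the radius-8 collar and the counting `#NL(Ω) ≤ #(NL ∩ int₈Ω) + #B₈`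
  set B : Finset (Fin N) := Ω.filter (fun i => ∃ j : Fin N, j ∉ Ω ∧ dist (x j) (x i) ≤ 8) with hBdef
  have hcount : ((Ω.filter fun i : Fin N => ¬ (∃ (A : EuclideanSpace ℝ (Fin 3) →ₗᵢ[ℝ] EuclideanSpace ℝ (Fin 3)) (t : EuclideanSpace ℝ (Fin 3)) (a : ℝ) (s : ℤ → ℤ) (z : ℤ → ℝ), 47 / 50 ≤ a ∧ a ≤ 1 ∧ IsHaggSeq s ∧ (∀ m : ℤ, 39 / 50 * a ≤ z (m + 1) - z m ∧ z (m + 1) - z m ≤ 17 / 20 * a) ∧ (fun S : Set (EuclideanSpace ℝ (Fin 3)) => (∀ j : Fin N, dist (x j) (x i) ≤ 2 → ∃ p ∈ S, dist (x j + t) p ≤ η) ∧ (∀ p ∈ S, dist p (x i + t) ≤ 2 → ∃ j : Fin N, dist (x j + t) p ≤ η)) {p | ∃ m i j : ℤ, p = A (((i : ℝ) • triangularVec₁ a) + ((j : ℝ) • triangularVec₂ a) + ((haggLabel s m : ℝ) • barlowOffset a) + (z m • layerNormal 1))})).card : ℝ) ≤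
      ((Ω.filter fun i : Fin N => ((∀ k : Fin N, dist (x k) (x i) ≤ 8 → k ∈ Ω) ∧ ¬ (∃ (A : EuclideanSpace ℝ (Fin 3) →ₗᵢ[ℝ] EuclideanSpace ℝ (Fin 3)) (t : EuclideanSpace ℝ (Fin 3)) (a : ℝ) (s : ℤ → ℤ) (z : ℤ → ℝ), 47 / 50 ≤ a ∧ a ≤ 1 ∧ IsHaggSeq s ∧ (∀ m : ℤ, 39 / 50 * a ≤ z (m + 1) - z m ∧ z (m + 1) - z m ≤ 17 / 20 * a) ∧ (fun S : Set (EuclideanSpace ℝ (Fin 3)) => (∀ j : Fin N, dist (x j) (x i) ≤ 2 → ∃ p ∈ S, dist (x j + t) p ≤ η) ∧ (∀ p ∈ S, dist p (x i + t) ≤ 2 → ∃ j : Fin N, dist (x j + t) p ≤ η)) {p | ∃ m i j : ℤ, p = A (((i : ℝ) • triangularVec₁ a) + ((j : ℝ) • triangularVec₂ a) + ((haggLabel s m : ℝ) • barlowOffset a) + (z m • layerNormal 1))}))).card : ℝ) + (B.card : ℝ) := by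
    have hsub : (Ω.filter fun i : Fin N => ¬ (∃ (A : EuclideanSpace ℝ (Fin 3) →ₗᵢ[ℝ] EuclideanSpace ℝ (Fin 3)) (t : EuclideanSpace ℝ (Fin 3)) (a : ℝ) (s : ℤ → ℤ) (z : ℤ → ℝ), 47 / 50 ≤ a ∧ a ≤ 1 ∧ IsHaggSeq s ∧ (∀ m : ℤ, 39 / 50 * a ≤ z (m + 1) - z m ∧ z (m + 1) - z m ≤ 17 / 20 * a) ∧ (fun S : Set (EuclideanSpace ℝ (Fin 3)) => (∀ j : Fin N, dist (x j) (x i) ≤ 2 → ∃ p ∈ S, dist (x j + t) p ≤ η) ∧ (∀ p ∈ S, dist p (x i + t) ≤ 2 → ∃ j : Fin N, dist (x j + t) p ≤ η)) {p | ∃ m i j : ℤ, p = A (((i : ℝ) • triangularVec₁ a) + ((j : ℝ) • triangularVec₂ a) + ((haggLabel s m : ℝ) • barlowOffset a) + (z m • layerNormal 1))})) ⊆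
        (Ω.filter fun i : Fin N => ((∀ k : Fin N, dist (x k) (x i) ≤ 8 → k ∈ Ω) ∧ ¬ (∃ (A : EuclideanSpace ℝ (Fin 3) →ₗᵢ[ℝ] EuclideanSpace ℝ (Fin 3)) (t : EuclideanSpace ℝ (Fin 3)) (a : ℝ) (s : ℤ → ℤ) (z : ℤ → ℝ), 47 / 50 ≤ a ∧ a ≤ 1 ∧ IsHaggSeq s ∧ (∀ m : ℤ, 39 / 50 * a ≤ z (m + 1) - z m ∧ z (m + 1) - z m ≤ 17 / 20 * a) ∧ (fun S : Set (EuclideanSpace ℝ (Fin 3)) => (∀ j : Fin N, dist (x j) (x i) ≤ 2 → ∃ p ∈ S, dist (x j + t) p ≤ η) ∧ (∀ p ∈ S, dist p (x i + t) ≤ 2 → ∃ j : Fin N, dist (x j + t) p ≤ η)) {p | ∃ m i j : ℤ, p = A (((i : ℝ) • triangularVec₁ a) + ((j : ℝ) • triangularVec₂ a) + ((haggLabel s m : ℝ) • barlowOffset a) + (z m • layerNormal 1))}))) ∪ B := by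
      intro i hi
      rw [Finset.mem_filter] at hi
      rw [Finset.mem_union, Finset.mem_filter, hBdef, Finset.mem_filter]
      by_cases h8 : ∀ k : Fin N, dist (x k) (x i) ≤ 8 → k ∈ Ω
      · exact Or.inl ⟨hi.1, h8, hi.2⟩
      · push Not at h8
        obtain ⟨k, hk, hkΩ⟩ := h8
        exact Or.inr ⟨hi.1, k, hkΩ, hk⟩
    exact_mod_cast (Finset.card_le_card hsub).trans (Finset.card_union_le _ _)
  -- the collar count: `#B₈ ≤ K · #∂₄Ω`
  have hcol := collar8_card_le x Ω
  set B4c : ℝ := ((Ω.filter fun i => ∃ j : Fin N, j ∉ Ω ∧ dist (x j) (x i) ≤ 4).card : ℝ) with hB4c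
  have hB40 : 0 ≤ B4c := Nat.cast_nonneg _
  have hBle : (B.card : ℝ) ≤ K * B4c := by
    have h1 : (B.card : ℝ) ≤ B4c + Cp * (17 / 4 : ℝ) ^ 4 * B4c := by
      have := hcol
      rw [← hBdef] at this
      linarith
    have h2 : Cp * (17 / 4 : ℝ) ^ 4 * B4c ≤ |Cp| * (17 / 4 : ℝ) ^ 4 * B4c :=
      mul_le_mul_of_nonneg_right (mul_le_mul_of_nonneg_right (le_abs_self Cp) (by positivity)) hB40
    rw [hKdef]
    nlinarith
  have hcK : 0 ≤ c := hc.le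
  have hstep : c * (B.card : ℝ) ≤ c * (K * B4c) := mul_le_mul_of_nonneg_left hBle hcK
  nlinarith [key, hcount, hstep, hB40]

/-- The INTERFACE LEMMA (landed chain of the twin crux, every `δ`): `Σ_{i∈int₄Ω} Σ_{j∉Ω} r⁻⁶ ≤ K(δ)·#∂₄Ω`. -/
theorem interfaceLemma :
    ∀ δ : ℝ, 0 < δ → ∃ K : ℝ, ∀ (N : ℕ) (x : Fin N → EuclideanSpace ℝ (Fin 3)),
      (∀ i j : Fin N, i ≠ j → δ ≤ dist (x i) (x j)) →
      ∀ Ω : Finset (Fin N), (∀ i ∈ Ω, IsTwoShellGood (1 / 20) (47 / 50) 1 x i) →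
        (∑ i ∈ Ω.filter (fun i => ∀ j : Fin N, dist (x j) (x i) ≤ 4 → j ∈ Ω),
            ∑ j ∈ Finset.univ.filter (fun j => j ∉ Ω), (dist (x i) (x j))⁻¹ ^ 6) ≤
          K * (Nat.card {i : Fin N // i ∈ Ω ∧ ∃ j : Fin N, j ∉ Ω ∧ dist (x j) (x i) ≤ 4} : ℝ) :=
  stub_interfaceOfPairCount stub_pairCountOfCrossing

/-- **NashPNF ⟹ the crux, inline (proved; the twin's `stub_cruxOfPureNearField` re-run on the Nash class at
`δ = 1/3`).**  The cross terms with `Ωᶜ` are boundary-summable (`pnf_cross_floor` with the interface lemma);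
`C` grows by `(250/12)·3⁶ + |K(1/3)|/12`. -/
theorem nashNearField_of_pnf (hPNF : Stmt.nashPureNearField) : Stmt.nashNearFieldInline := by
  intro η hη
  have hδ : (0 : ℝ) < 1 / 3 := by norm_num
  obtain ⟨K, hK⟩ := interfaceLemma (1 / 3) hδ
  obtain ⟨c, hc, C, hC⟩ := hPNF η hη
  refine ⟨c, hc, C + 250 / 12 * (1 / 3 : ℝ)⁻¹ ^ 6 + |K| / 12, fun N x hsep hNash Ω hΩ => ?_⟩
  have hcross := pnf_cross_floor x hδ hsep Ω (hK N x hsep Ω hΩ)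
  have hmain := hC N x hsep hNash Ω hΩ
  rw [pnf_siteSum_split x Ω]
  have hG0 : (0 : ℝ) ≤ (Nat.card {i : Fin N // i ∈ Ω ∧ ∃ j : Fin N, j ∉ Ω ∧ dist (x j) (x i) ≤ 4} : ℝ) :=
    Nat.cast_nonneg _
  nlinarith [hcross, hmain, hG0]

/-- The inline text IS the route decl (definitional unfolding; `let S := …;` vs `(fun S => …) …`). -/
theorem nashNearField_of_inline (h : Stmt.nashNearFieldInline) :
    Summit.AtomisticToContinuum.Crystallization.Theses.NashClassCertificates.NashNearField :=
  h

/-- **COMPOSITION (proved, no sorry): the five stub statements (placement, force balance, C′, I_flat, II_band — the first three LANDED)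
imply the crux BY NAME**, through `interiorCoercivity_of_v10`, `nashPnf_of_stubs`, `nashNearField_of_pnf`.  The stub signatures are written out; the
conclusion is literally the route decl
`Summit.AtomisticToContinuum.Crystallization.Theses.NashClassCertificates.NashNearField`. -/
theorem NashNearField_of :
    (∀ (N : ℕ) (x : Fin N → EuclideanSpace ℝ (Fin 3)) (i : Fin N),
      (∀ k : Fin N, dist (x k) (x i) ≤ 3 → IsTwoShellGood (1 / 20) (47 / 50) 1 x k) →
      ∀ (a : ℝ) (A : EuclideanSpace ℝ (Fin 3) →ₗᵢ[ℝ] EuclideanSpace ℝ (Fin 3)) (P : Finset (EuclideanSpace ℝ (Fin 3)))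
        (f : EuclideanSpace ℝ (Fin 3) → Fin N),
        47 / 50 ≤ a → a ≤ 1 → (P = fccTwoShellPattern ∨ P = hcpTwoShellPattern) →
        (∀ v ∈ P, f v ≠ i ∧ dist (x (f v)) (x i + a • A v) ≤ 1 / 20 * a) → Set.InjOn f ↑P →
        (∀ j : Fin N, j ≠ i → dist (x j) (x i) ≤ 3 / 2 * a → ∃ v ∈ P, f v = j) →
        ∃ (R : EuclideanSpace ℝ (Fin 3) →ₗᵢ[ℝ] EuclideanSpace ℝ (Fin 3)) (s : ℤ → ℤ), IsHaggSeq s ∧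
          (∀ v ∈ P, ∃ m u w : ℤ, R (barlowPos 1 (Real.sqrt 6 / 3) s m u w) = v) ∧
          (∀ m u w : ℤ, ‖barlowPos 1 (Real.sqrt 6 / 3) s m u w‖ ≤ 3 / 2 → barlowPos 1 (Real.sqrt 6 / 3) s m u w ≠ 0 →
            R (barlowPos 1 (Real.sqrt 6 / 3) s m u w) ∈ P) ∧
          (∀ v ∈ P, ∃ (a' : ℝ) (A' : EuclideanSpace ℝ (Fin 3) →ₗᵢ[ℝ] EuclideanSpace ℝ (Fin 3))
            (P' : Finset (EuclideanSpace ℝ (Fin 3))) (f' : EuclideanSpace ℝ (Fin 3) → Fin N)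
            (σm σu σw : EuclideanSpace ℝ (Fin 3) → ℤ),
            47 / 50 ≤ a' ∧ a' ≤ 1 ∧ (P' = fccTwoShellPattern ∨ P' = hcpTwoShellPattern) ∧
            (∀ w ∈ P', f' w ≠ f v ∧ dist (x (f' w)) (x (f v) + a' • A' w) ≤ 1 / 20 * a') ∧ Set.InjOn f' ↑P' ∧
            (∀ k : Fin N, k ≠ f v → dist (x k) (x (f v)) ≤ 3 / 2 * a' → ∃ w ∈ P', f' w = k) ∧
            Set.InjOn (fun w => barlowPos 1 (Real.sqrt 6 / 3) s (σm w) (σu w) (σw w)) ↑P' ∧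
            (∀ w ∈ P', R (barlowPos 1 (Real.sqrt 6 / 3) s (σm w) (σu w) (σw w)) ≠ v ∧
              dist (R (barlowPos 1 (Real.sqrt 6 / 3) s (σm w) (σu w) (σw w))) v ≤ 3 / 2 ∧
              ((‖barlowPos 1 (Real.sqrt 6 / 3) s (σm w) (σu w) (σw w)‖ ≤ 43 / 20 ∨ dist (x (f' w)) (x i) ≤ 2) →
                dist (x (f' w)) (x i + a • A (R (barlowPos 1 (Real.sqrt 6 / 3) s (σm w) (σu w) (σw w)))) ≤ 2 / 5)))) →
    (∀ (N : ℕ) (x : Fin N → EuclideanSpace ℝ (Fin 3)),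
      (∀ i j : Fin N, i ≠ j → x i ≠ x j) →
      (∀ (i : Fin N) (y : EuclideanSpace ℝ (Fin 3)), (∀ j : Fin N, j ≠ i → y ≠ x j) → siteEnergy lennardJones x i ≤ ∑ j ∈ Finset.univ.erase i, lennardJones (dist y (x j))) →
      ∀ i : Fin N, ∑ j ∈ Finset.univ.erase i,
        (deriv lennardJones (dist (x i) (x j)) / dist (x i) (x j)) • (x i - x j) = 0) →
    (∀ (N : ℕ) (x : Fin N → EuclideanSpace ℝ (Fin 3)) (i : Fin N) (s : ℤ → ℤ) (G : EuclideanSpace ℝ (Fin 3) →L[ℝ] EuclideanSpace ℝ (Fin 3)) (ν η : ℝ),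
      IsHaggSeq s → 0 ≤ ν → ν ≤ η / 2 → η ≤ 1 / 10 →
      ((∀ j : Fin N, dist (x j) (x i) ≤ 3 → ∃ m u v : ℤ, dist (x j - x i) (G (barlowPos 1 (Real.sqrt 6 / 3) s m u v)) ≤ ν) ∧ (∀ m u v : ℤ, ‖G (barlowPos 1 (Real.sqrt 6 / 3) s m u v)‖ ≤ 3 → ∃ j : Fin N, dist (x j - x i) (G (barlowPos 1 (Real.sqrt 6 / 3) s m u v)) ≤ ν) ∧ (∀ p : EuclideanSpace ℝ (Fin 3), 4 / 5 * ‖p‖ ≤ ‖G p‖ ∧ ‖G p‖ ≤ 6 / 5 * ‖p‖)) →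
      ¬ (∃ (A : EuclideanSpace ℝ (Fin 3) →ₗᵢ[ℝ] EuclideanSpace ℝ (Fin 3)) (t : EuclideanSpace ℝ (Fin 3)) (a : ℝ) (s : ℤ → ℤ) (z : ℤ → ℝ), 47 / 50 ≤ a ∧ a ≤ 1 ∧ IsHaggSeq s ∧ (∀ m : ℤ, 39 / 50 * a ≤ z (m + 1) - z m ∧ z (m + 1) - z m ≤ 17 / 20 * a) ∧ (fun S : Set (EuclideanSpace ℝ (Fin 3)) => (∀ j : Fin N, dist (x j) (x i) ≤ 2 → ∃ p ∈ S, dist (x j + t) p ≤ η) ∧ (∀ p ∈ S, dist p (x i + t) ≤ 2 → ∃ j : Fin N, dist (x j + t) p ≤ η)) {p | ∃ m i j : ℤ, p = A (((i : ℝ) • triangularVec₁ a) + ((j : ℝ) • triangularVec₂ a) + ((haggLabel s m : ℝ) • barlowOffset a) + (z m • layerNormal 1))}) →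
      (∀ (A : EuclideanSpace ℝ (Fin 3) →ₗᵢ[ℝ] EuclideanSpace ℝ (Fin 3)) (a h : ℝ), 47 / 50 ≤ a → a ≤ 1 → 39 / 50 * a ≤ h → h ≤ 17 / 20 * a → ∃ m u v : ℤ, ‖barlowPos 1 (Real.sqrt 6 / 3) s m u v‖ ≤ 3 ∧ (η - ν) ≤ dist (G (barlowPos 1 (Real.sqrt 6 / 3) s m u v)) (A (barlowPos a h s m u v)))) →
    (∃ ε₁ : ℝ, 1 / 100 ≤ ε₁ ∧ ε₁ ≤ 1 / 20 ∧ ∃ K : ℝ, 0 ≤ K ∧ ∃ C : ℝ, ∀ (N : ℕ) (x : Fin N → EuclideanSpace ℝ (Fin 3)),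
      (∀ i j : Fin N, i ≠ j → 1 / 3 ≤ dist (x i) (x j)) →
      (∀ (i : Fin N) (y : EuclideanSpace ℝ (Fin 3)), (∀ j : Fin N, j ≠ i → y ≠ x j) → siteEnergy lennardJones x i ≤ ∑ j ∈ Finset.univ.erase i, lennardJones (dist y (x j))) →
      (∀ i : Fin N, ∑ j ∈ Finset.univ.erase i, (deriv lennardJones (dist (x i) (x j)) / dist (x i) (x j)) • (x i - x j) = 0) →
      ∀ Ω : Finset (Fin N), (∀ i ∈ Ω, IsTwoShellGood ε₁ (47 / 50) 1 x i) →
      ∃ (sW : Fin N → ℤ → ℤ) (Gw : Fin N → (EuclideanSpace ℝ (Fin 3) →L[ℝ] EuclideanSpace ℝ (Fin 3))) (νw rw : Fin N → ℝ) (Aw : Fin N → (EuclideanSpace ℝ (Fin 3) →ₗᵢ[ℝ] EuclideanSpace ℝ (Fin 3))) (aw hw : Fin N → ℝ), (∀ i ∈ Ω, (∀ k : Fin N, dist (x k) (x i) ≤ 8 → k ∈ Ω) → IsHaggSeq (sW i) ∧ 0 ≤ νw i ∧ ((∀ j : Fin N, dist (x j) (x i) ≤ 3 → ∃ m u v : ℤ,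 dist (x j - x i) ((Gw i) (barlowPos 1 (Real.sqrt 6 / 3) (sW i) m u v)) ≤ (νw i)) ∧ (∀ m u v : ℤ, ‖(Gw i) (barlowPos 1 (Real.sqrt 6 / 3) (sW i) m u v)‖ ≤ 3 → ∃ j : Fin N, dist (x j - x i) ((Gw i) (barlowPos 1 (Real.sqrt 6 / 3) (sW i) m u v)) ≤ (νw i)) ∧ (∀ p : EuclideanSpace ℝ (Fin 3), 4 / 5 * ‖p‖ ≤ ‖(Gw i) p‖ ∧ ‖(Gw i) p‖ ≤ 6 / 5 * ‖p‖)) ∧ 47 / 50 ≤ aw i ∧ aw i ≤ 1 ∧ 39 / 50 * aw i ≤ hw i ∧ hw i ≤ 17 / 20 * aw i ∧ (∀ m u v : ℤ, ‖barlowPos 1 (Real.sqrt 6 / 3) (sW i) m u v‖ ≤ 3 → dist ((Gw i) (barlowPos 1 (Real.sqrt 6 / 3) (sW i) m u v)) ((Aw i) (barlowPos (aw i) (hw i) (sW i) m u v)) < rw i)) ∧ (∑ i ∈ Ω.filter (fun i => ∀ k : Fin N, dist (x k) (x i) ≤ 8 → k ∈ Ω), (2400 * (νw i) ^ 2 + 800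 * (rw i) ^ 2)) ≤ K * ((∑ i ∈ Ω, (1 / 2 : ℝ) * (∑ j ∈ Ω.erase i, lennardJones (dist (x i) (x j)))) - (Ω.card : ℝ) * (⨅ Q : PeriodicConfiguration 3, Q.energyPerParticle lennardJones)) + C * (Nat.card {i : Fin N // i ∈ Ω ∧ ∃ j : Fin N, j ∉ Ω ∧ dist (x j) (x i) ≤ 4} : ℝ)) →
    (∀ ε₁ : ℝ, 1 / 100 ≤ ε₁ → ε₁ ≤ 1 / 20 → ∃ K : ℝ, 0 ≤ K ∧ ∃ C : ℝ, ∀ (N : ℕ) (x : Fin N → EuclideanSpace ℝ (Fin 3)),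
      (∀ i j : Fin N, i ≠ j → 1 / 3 ≤ dist (x i) (x j)) →
      (∀ (i : Fin N) (y : EuclideanSpace ℝ (Fin 3)), (∀ j : Fin N, j ≠ i → y ≠ x j) → siteEnergy lennardJones x i ≤ ∑ j ∈ Finset.univ.erase i, lennardJones (dist y (x j))) →
      (∀ i : Fin N, ∑ j ∈ Finset.univ.erase i, (deriv lennardJones (dist (x i) (x j)) / dist (x i) (x j)) • (x i - x j) = 0) →
      ∀ Ω : Finset (Fin N), (∀ i ∈ Ω, IsTwoShellGood (1 / 20) (47 / 50) 1 x i) →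
      (∀ i ∈ Ω, (∀ k : Fin N, dist (x k) (x i) ≤ 3 → k ∈ Ω) → (∃ (A : EuclideanSpace ℝ (Fin 3) →ₗᵢ[ℝ] EuclideanSpace ℝ (Fin 3)) (a h : ℝ) (s : ℤ → ℤ), 47 / 50 ≤ a ∧ a ≤ 1 ∧ 39 / 50 * a ≤ h ∧ h ≤ 17 / 20 * a ∧ IsHaggSeq s ∧ (fun S : Set (EuclideanSpace ℝ (Fin 3)) => (∀ j : Fin N, dist (x j) (x i) ≤ 2 → ∃ p ∈ S, dist (x j) p ≤ 2 / 5) ∧ (∀ p ∈ S, dist p (x i) ≤ 2 → ∃ j : Fin N, dist (x j) p ≤ 2 / 5)) {p | ∃ m u v : ℤ, p = x i + A (((u : ℝ) • triangularVec₁ a) + ((v : ℝ) • triangularVec₂ a) + ((haggLabel s m : ℝ) • barlowOffset a) + ((m : ℝ) • layerNormal h))})) → (Nat.card {i : Fin N // i ∈ Ω ∧ ¬ IsTwoShellGood ε₁ (47 / 50) 1 x i} : ℝ) ≤ K * ((∑ i ∈ Ω, (1 / 2 : ℝ) * (∑ j ∈ Ω.erase i, lennardJones (dist (x i) (x j))))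 - (Ω.card : ℝ) * (⨅ Q : PeriodicConfiguration 3, Q.energyPerParticle lennardJones)) + C * (Nat.card {i : Fin N // i ∈ Ω ∧ ∃ j : Fin N, j ∉ Ω ∧ dist (x j) (x i) ≤ 4} : ℝ)) →
    Summit.AtomisticToContinuum.Crystallization.Theses.NashClassCertificates.NashNearField :=
  fun h₁ h₂ h₃ h₄ h₅ =>
    nashNearField_of_inline (nashNearField_of_pnf (nashPnf_of_stubs
      (Summit.AtomisticToContinuum.Crystallization.Theorems.NashClassCertificatesNashNearField.stub_chartCore_of_labelled_placement h₁)
      h₂ (interiorCoercivity_of_v10 h₃ h₄ h₅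
        (chart_of_stubs_radius le_rfl stub_chartCoverage
          (Summit.AtomisticToContinuum.Crystallization.Theorems.NashClassCertificatesNashNearField.stub_chartCore_of_labelled_placement h₁)
          stub_chartSites))))

/-- **Skeleton instance** (zero hypotheses; its only sorries are inside the registered stubs): the crux by name. -/
theorem NashNearField_skeleton :
    Summit.AtomisticToContinuum.Crystallization.Theses.NashClassCertificates.NashNearField :=
  NashNearField_of stub_labelledPlacement stub_nashForceBalance stub_offFamilyOfNonLayered stub_nashFlatnessPaid stub_nashRoughSitesPaid

end Summit.AtomisticToContinuum.Crystallization.Cruxes.NashNearField.Birth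

end
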